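import Literature.NumberTheory.LFunctions.NicolasCriterionProofs
import Literature.NumberTheory.LFunctions.NicolasMertensRHSharpProofs
import Literature.NumberTheory.LFunctions.InghamSmoothing
import Literature.NumberTheory.LFunctions.RobinLiThetaCriterionRH
import HarnessLib

/-!
# RH-EQUIVALENT — Nicolas 2012, Thm. 1.1 (1.4) PROVED under RH (`lim sup c(n) = e^γ(2+β)`) and Cor. 1.1 (1.4) as a kernel equivalence; nothing here bears on the truth of RH

RH-EQUIVALENT (a proved equivalence) / RH-CONDITIONAL (Thm. 1.1 (1.4) has the hypothesis
`RiemannHypothesis`); nothing here bears on the truth of RH. Literature-typing tranche 1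
(Broughan, *Equivalents of the Riemann Hypothesis* vol. 1, §5.7 "Nicolas' second theorem"), from
the primary source J.-L. Nicolas, *Small values of the Euler function and the Riemann hypothesis*,
Acta Arith. 155 (2012), 311–321 (arXiv:1202.0729), read in full.

The named fact `Literature.NumberTheory.LFunctions.Nicolas2012_thm1_1` (`NicolasCriterion.lean`)
vendors Thm. 1.1 as the conjunction of (1.4)–(1.7). Clauses (1.5)–(1.7) rest on a floating-point
computation of `c(N_k)` for all `k ≤ π(10⁹) = 50 847 534` (§4 of the paper: "we have calculated
`c(N_k)` in Maple with 30 decimal digits") and stay a named fact. Clause (1.4),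

  under RH, `lim sup_{n → ∞} c(n) = e^γ (2 + β)`, `c(n) = (n/φ(n) − e^γ log log n) √(log n)`,

is purely analytic and is PROVED here (`Nicolas2012_thm1_1_limsup`, in the `ε`-form of the fact:
eventually `c(n) < e^γ(2+β) + ε` and frequently `c(n) > e^γ(2+β) − ε`), following the printed proof:

* §1 `W(x) = ∑_ρ m(ρ) x^{i Im ρ}/(ρ(1−ρ))` ((1.18), `nicolasW`, real part taken so that `W` is a real
  function unconditionally) with `|W(x)| ≤ β` under RH ((1.19), `abs_nicolasW_le`; the tree's
  `norm_tsum_zeroOrder_mul_div_le_nicolasBeta`).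
* §2 Lemma 2.5 in `W`-form (`nicolasJ_le_W_of_RH`: `J(x) ≤ −W(x)/(√x log x) + β D_x`, the tree's
  `NicolasUpper.nicolasJ_le_of_RH` had replaced `−W` by `β`), Cor. 2.1 lower half in the sharp form
  `J − K ≥ (1 − log² x/(32π x^{1/4})) F_{1/2}(x)` for `x ≥ 599²` (`jk_lower_sharp_of_RH`: under RH
  `ψ − θ ≥ θ(√t) ≥ √t − T(√t)`, (2.9), with Schoenfeld's bound `Schoenfeld1976_theta_holds`; the
  tree's `jk_lower_of_RH` has the factor `4/5`, too weak for the value of the `lim sup`), whence the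
  `W`-form of (2.19): `−log f(x) · √x log x ≥ W(x) + 2 − η₂(x)` with `η₂ → 0` (`neg_log_nicolasF_ge_W`).
* §3 (3.4) `c(N_k) = e^γ √θ(x) log θ(x) (1/f(x) − 1)` for `p_k ≤ x < p_{k+1}` (`nicolasC_primorial_floor_eq`)
  and Prop. 3.1 in asymptotic form: for every `ε > 0`, eventually in `x`,
  `e^γ(2 + W(x)) − ε ≤ c(⌊x⌋#) ≤ e^γ(2+β) + ε` (the upper bound from the tree's PROVED (2.18),
  `Nicolas2012_logf_lower_sharp_holds`; `√θ log θ/(√x log x) → 1` from Schoenfeld's bound).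
* §4 "`lim sup_{x→∞} W(x) = β` by the pigeonhole principle" (`frequently_lt_nicolasW`): truncate
  `∑_ρ m(ρ)/|ρ|² = β` (`hasSum_zeroOrder_div_norm_sq_of_RH`) and apply the simultaneous recurrence
  of finitely many frequencies (`InghamSmoothing.exists_large_almostPeriod`, compactness of the torus).
* §5 Lemma 3.1 (`nicolasC_le_of_primorial_le`): `c(n) ≤ c(N_k)` for `N_k ≤ n < N_{k+1}`, via
  `n/φ(n) ≤ N_k/φ(N_k)` (one-prime exchange, `exists_primorial_le_div_totient_le`) and the decrease of
  `t ↦ (A − e^γ log log t)√(log t)` once `A ≤ e^γ(log log N_k + 2)` (printed: Rosser–Schoenfeld's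
  (1.1) for all `k`; here, under RH, from Prop. 2.1 for `k` large — all the `lim sup` needs — while the
  `n` whose `N_k` is small have `c(n) ≤ 0` eventually).
* §6 Thm. 1.1 (1.4) (`Nicolas2012_thm1_1_limsup`) and **Cor. 1.1 (1.4) PROVED**:
  `riemannHypothesis_iff_nicolasC_limsup` — RH `⟺ lim sup c(n) = e^γ(2+β)` (in `ε`-form), the `⟸`
  half being the tree's `Nicolas2012_nicolasC_primorial_unbounded_holds` (if RH fails `c(N_k)` is
  unbounded above), exactly as in `riemannHypothesis_iff_nicolasC_limsup_of`; and the primorial form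
  `riemannHypothesis_iff_nicolasC_primorial_limsup` (the abstract's "`c(N_k)` bounded under RH,
  unbounded above and below otherwise", sharpened to the value of the `lim sup`).
  `Nicolas2012_thm1_1_of_clauses` records that the fact now follows from its clauses (1.5)–(1.7) alone.

* §7 **The standard-axiom road**: the three asymptotic inputs of §§3–6 — `θ(x)/x → 1`; an upper
  bound `−log f(x)·√x log x ≤ u(x)`, `u → β+2` ((2.18) in asymptotic form); a lower bound
  `≥ W(x) + 2 − e(x)`, `e → 0` ((2.19) in `W`-form) — are proved from von Koch's theorem under RH
  (`θ(x) = x + O(√x log² x)`, the tree's `LiThetaRH.exists_abs_theta_sub_le_of_RH`, standard axioms)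
  instead of Schoenfeld's explicit (1.12) and the tree's explicit (2.18): `tendsto_theta_div_of_RH`,
  `upRoad_of_RH` (Lemma 2.1 lower, Lemma 2.5 lower, (2.4), and Cor. 2.1 upper from the pointwise
  `ψ − θ ≤ ψ(√t) + ψ(t^{1/3}) + ψ(t^{1/5})` of Mathlib with von Koch at `√t`), `lowRoad_of_RH`.

* §8 The abstract's form ("under RH `c(N_k)` is bounded … if RH fails, `c(N_k)` is not bounded above
  or below"): `nicolasC_primorial_bddAbove_of_RH`, `nicolasC_primorial_bddBelow_of_RH`
  (`c(N_k) > 2` eventually under RH, Prop. 3.1 (3.3)), and the kernel equivalences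
  `riemannHypothesis_iff_nicolasC_primorial_bddAbove`, `riemannHypothesis_iff_nicolasC_primorial_bddBelow`.

* §9 The analytic range of (1.7) with an explicit threshold (Schoenfeld road): under RH
  `c(p#) ≥ 2.65 > 2.41 ≥ c(2)` for every `p ≥ 599²` (`nicolasC_two_lt_nicolasC_primorial_of_RH`;
  printed for `k > π(10⁹)` via (3.3)), hence **Cor. 1.1 (1.7) modulo the finite check `p < 599²`**
  (`riemannHypothesis_iff_nicolasC_two_le_of_smallRange`, over `Schoenfeld1976_theta` — feed it the
  tree's `Schoenfeld1976_theta_holds` — and the 30 519 primes below `599²`, left as a hypothesis for a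
  kernel certificate; Nicolas's table covers them; standard axioms).

* §10 **Nicolas 1983, Théorème 1 (RH-FREE)** — the affirmative answer to Rosser–Schoenfeld's question
  "existe-t-il une infinité de `n` pour lesquels `n/φ(n) > e^γ log log n`?" (J. Number Theory 17
  (1983), p. 375; Nicolas 2012, §1): `Nicolas1983_thm1_primorial` (the inequality holds at primorials
  `p#` with `p` beyond any bound) and `Nicolas1983_thm1` (`{n | nicolasInequality n}` is infinite),
  PROVED with standard axioms by cases on RH exactly as Nicolas derives Thm. 1 from Thm. 2: under RH
  §8's `c(N_k) > 2 > 0` eventually (von Koch road), otherwise Thm. 2 (b) (`Nicolas.Nicolas1983_thm2b`).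

Axioms: `Nicolas2012_thm1_1_limsup`, `riemannHypothesis_iff_nicolasC_limsup`,
`riemannHypothesis_iff_nicolasC_primorial_limsup` (von Koch road, §7) and the explicit-road forms
`Nicolas2012_thm1_1_limsup_of`, `riemannHypothesis_iff_nicolasC_limsup_of'` (over the hypotheses
`Schoenfeld1976_theta` ((1.12)) and `Nicolas2012_logf_lower_sharp` ((2.18)), both DISCHARGED in the tree
with computational closures) all have STANDARD axioms `[propext, Classical.choice, Quot.sound]`; §§3–6
are written once, generically in the three asymptotic inputs, and instantiated on both roads.
No new named fact; definitions: `nicolasW` (printed (1.18)) and the auxiliary explicit functions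
`NicolasLimsup.phase/eta/eta2/ratio/vUp/uUp/lowerErr/lowerErrOf/eulerRatio/etaK/eta2K/etaUp/uK` of the proof.

## References

* J.-L. Nicolas, *Small values of the Euler function and the Riemann hypothesis*, Acta Arith. 155
  (2012), 311–321 (arXiv:1202.0729): (1.18)–(1.19), Lemma 2.5, Cor. 2.1, Prop. 2.1 (2.18)–(2.19),
  Lemma 3.1, Prop. 3.1, §4 [corpus:paper:arxiv-1202.0729 p0003–p0007]. [Nicolas2012]
* J.-L. Nicolas, *Petites valeurs de la fonction d'Euler*, J. Number Theory 17 (1983), 375–388,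
  Théorème 1 (p. 375) and Théorème 2 (p. 376) [corpus:paper:doi-10-1016-0022-314x-83-90055-0 p0001–p0002]. [Nicolas1983]
* K. Broughan, *Equivalents of the Riemann Hypothesis. Vol. 1*, CUP 2017, §5.7 "Nicolas' Second
  Theorem" (pp. 137–143). [Broughan2017Arithmetic]
* P. T. Bateman, H. G. Diamond, *Analytic Number Theory* (2004), Lemma 11.1 (simultaneous
  recurrence). [BatemanDiamond2004]
-/

noncomputable section

open Filter Set MeasureTheory Topology Complex
open scoped Real Chebyshev

namespace Literature.NumberTheory.LFunctions

open Nicolas Mertens NicolasJ NicolasFz NicolasK NicolasJExplicit NicolasUpper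

namespace NicolasLimsup

/-! ### §1 `W(x)` (Nicolas 2012, (1.18)) and `|W(x)| ≤ β` under RH ((1.19)) -/

/-- The unimodular coefficient `x^{i Im ρ}` of (1.18). [cite: Nicolas2012, (1.18)] -/
def phase (ρ : ℂ) (x : ℝ) : ℂ := (x : ℂ) ^ (((ρ.im : ℝ) : ℂ) * I)

/-- `|x^{i Im ρ}| = 1` for `x > 0`. [folklore] -/
private theorem norm_phase {x : ℝ} (hx : 0 < x) (ρ : ℂ) : ‖phase ρ x‖ = 1 := by
  rw [phase, Complex.norm_cpow_eq_rpow_re_of_pos hx]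
  simp

/-- `x^{i Im ρ} = e^{i (Im ρ) log x}` for `x > 0`. [folklore] -/
private theorem phase_eq_exp {x : ℝ} (hx : 0 < x) (ρ : ℂ) :
    phase ρ x = cexp (((ρ.im * Real.log x : ℝ) : ℂ) * I) := by
  rw [phase, Complex.cpow_def_of_ne_zero (by exact_mod_cast hx.ne'), ← Complex.ofReal_log hx.le]
  congr 1
  push_cast
  ring

end NicolasLimsup

open NicolasLimsup in
/-- **Nicolas's `W(x) = ∑_ρ x^{i Im ρ}/(ρ(1−ρ))`** (Nicolas 2012, (1.18); `ρ` runs over the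
non-trivial zeros of `ζ` with multiplicity `m(ρ)`). The series is real under RH (conjugate zeros
pair up); we take its real part so that `W` is a real function unconditionally.
[cite: Nicolas2012, (1.18)] -/
def nicolasW (x : ℝ) : ℝ :=
  (∑' ρ : Zeros, (riemannZetaZeroOrder (ρ : ℂ) : ℂ) * phase (ρ : ℂ) x / ((ρ : ℂ) * (1 - ρ))).re

namespace NicolasLimsup

/-- Unfolding lemma for `nicolasW`. [cite: Nicolas2012, (1.18)] -/
theorem nicolasW_def (x : ℝ) : nicolasW x =
    (∑' ρ : Zeros, (riemannZetaZeroOrder (ρ : ℂ) : ℂ) * phase (ρ : ℂ) x / ((ρ : ℂ) * (1 - ρ))).re :=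
  rfl

/-- **(1.19) `|W(x)| ≤ β` under RH** (`x > 0`). [cite: Nicolas2012, (1.19)] -/
theorem abs_nicolasW_le (hRH : RiemannHypothesis) {x : ℝ} (hx : 0 < x) : |nicolasW x| ≤ nicolasBeta := by
  have h := (norm_tsum_zeroOrder_mul_div_le_nicolasBeta hRH (c := fun ρ ↦ phase ρ x)
    (fun ρ _ ↦ (norm_phase hx ρ).le)).2
  exact (Complex.abs_re_le_norm _).trans h

/-- `W(x) ≤ β` under RH. [cite: Nicolas2012, (1.19)] -/
theorem nicolasW_le (hRH : RiemannHypothesis) {x : ℝ} (hx : 0 < x) : nicolasW x ≤ nicolasBeta :=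
  (le_abs_self _).trans (abs_nicolasW_le hRH hx)

/-- `−β ≤ W(x)` under RH. [cite: Nicolas2012, (1.19)] -/
theorem neg_le_nicolasW (hRH : RiemannHypothesis) {x : ℝ} (hx : 0 < x) : -nicolasBeta ≤ nicolasW x :=
  (abs_le.1 (abs_nicolasW_le hRH hx)).1

/-! ### §2 Lemma 2.5 and (2.19) in `W`-form -/

/-- Under RH, `x^{ρ−1} √x = x^{i Im ρ}` at a non-trivial zero (`Re ρ = 1/2`). [cite: Nicolas2012, Lemma 2.5 (proof)] -/
theorem cpow_sub_one_mul_sqrt (hRH : RiemannHypothesis) {x : ℝ} (hx : 0 < x) {ρ : ℂ}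
    (hρ : ρ ∈ RHWave0.riemannZetaNontrivialZeros) :
    (x : ℂ) ^ (ρ - 1) * (Real.sqrt x : ℂ) = phase ρ x := by
  have hre := re_eq_half_of_RH hRH hρ
  have hx0 : (x : ℂ) ≠ 0 := by exact_mod_cast hx.ne'
  rw [Real.sqrt_eq_rpow, Complex.ofReal_cpow hx.le, ← Complex.cpow_add _ _ hx0, phase]
  congr 1
  apply Complex.ext
  · simp [hre]; norm_num
  · simp

/-- **The zeros' bracket in `W`-form** (Nicolas 2012, Lemma 2.5 (2.14)–(2.15)): under RH, for `x > 1`,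
`Re(−∑_ρ (m(ρ)/ρ) F_ρ(x)) ≤ −W(x)/(√x log x) + β D_x` (`J₂` bounded by `β D_x` as in the tree's
`re_zeros_bracket_ge`, the `F`-main term kept exact). [cite: Nicolas2012, Lemma 2.5 (2.14)–(2.15)] -/
theorem re_zeros_bracket_le_W (hRH : RiemannHypothesis) {x : ℝ} (hx : 1 < x) :
    (-∑' ρ : Zeros, (riemannZetaZeroOrder (ρ : ℂ) : ℂ) / (ρ : ℂ) * Fz (ρ : ℂ) x).re ≤
      -nicolasW x / (Real.sqrt x * Real.log x) + nicolasBeta * Dx x := by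
  have hx0 : 0 < x := by linarith
  have hlx : 0 < Real.log x := Real.log_pos hx
  have hsx : 0 < Real.sqrt x := Real.sqrt_pos.2 hx0
  have hD := Dx_pos hx
  set c₁ : ℂ → ℂ := fun ρ ↦ (x : ℂ) ^ (ρ - 1) * (Real.sqrt x : ℂ) with hc₁
  set c₂ : ℂ → ℂ := fun ρ ↦ (1 - ρ) * rz ρ x / (Dx x : ℂ) with hc₂
  have hc₁le : ∀ ρ ∈ RHWave0.riemannZetaNontrivialZeros, ‖c₁ ρ‖ ≤ 1 := by
    intro ρ hρ
    rw [hc₁]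
    simp only
    rw [cpow_sub_one_mul_sqrt hRH hx0 hρ, norm_phase hx0]
  have hc₂le : ∀ ρ ∈ RHWave0.riemannZetaNontrivialZeros, ‖c₂ ρ‖ ≤ 1 := by
    intro ρ hρ
    have hre := re_eq_half_of_RH hRH hρ
    have h1ρ : 1 - ρ ≠ 0 := one_sub_ne_zero' hρ
    have hn : 0 < ‖1 - ρ‖ := norm_pos_iff.2 h1ρ
    have hr := norm_rz_le hre hx
    rw [hc₂]
    simp only
    rw [norm_div, norm_mul, Complex.norm_real, Real.norm_eq_abs, abs_of_pos hD, div_le_one hD]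
    calc ‖1 - ρ‖ * ‖rz ρ x‖ ≤ ‖1 - ρ‖ * ((1 + 4 / Real.log x) / (‖1 - ρ‖ * Real.sqrt x * Real.log x ^ 2)) :=
          mul_le_mul_of_nonneg_left hr hn.le
      _ = Dx x := by rw [Dx]; field_simp
  obtain ⟨hsum₁, -⟩ := norm_tsum_zeroOrder_mul_div_le_nicolasBeta hRH hc₁le
  obtain ⟨hsum₂, hle₂⟩ := norm_tsum_zeroOrder_mul_div_le_nicolasBeta hRH hc₂le
  set T₁ : Zeros → ℂ := fun ρ ↦ (riemannZetaZeroOrder (ρ : ℂ) : ℂ) * c₁ ρ / ((ρ : ℂ) * (1 - ρ)) with hT₁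
  set T₂ : Zeros → ℂ := fun ρ ↦ (riemannZetaZeroOrder (ρ : ℂ) : ℂ) * c₂ ρ / ((ρ : ℂ) * (1 - ρ)) with hT₂
  set a : ℝ := 1 / (Real.sqrt x * Real.log x) with ha
  have hterm : ∀ ρ : Zeros, -((riemannZetaZeroOrder (ρ : ℂ) : ℂ) / (ρ : ℂ) * Fz (ρ : ℂ) x) =
      -(a : ℂ) * T₁ ρ - (Dx x : ℂ) * T₂ ρ := by
    intro ρ
    have hρ0 : (ρ : ℂ) ≠ 0 := ne_zero ρ.2
    have h1ρ : 1 - (ρ : ℂ) ≠ 0 := one_sub_ne_zero' ρ.2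
    have hDC : (Dx x : ℂ) ≠ 0 := by exact_mod_cast hD.ne'
    have hsC : (Real.sqrt x : ℂ) ≠ 0 := by exact_mod_cast hsx.ne'
    have hlC : (Real.log x : ℂ) ≠ 0 := by exact_mod_cast hlx.ne'
    rw [Fz_eq (re_lt_one ρ.2) hx, hT₁, hT₂, hc₁, hc₂, ha]
    simp only
    push_cast
    field_simp
    ring
  have hs₁ : Summable T₁ := hsum₁.of_norm
  have hs₂ : Summable T₂ := hsum₂.of_norm
  have htsum : -∑' ρ : Zeros, (riemannZetaZeroOrder (ρ : ℂ) : ℂ) / (ρ : ℂ) * Fz (ρ : ℂ) x =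
      -(a : ℂ) * ∑' ρ, T₁ ρ - (Dx x : ℂ) * ∑' ρ, T₂ ρ := by
    rw [← tsum_neg, tsum_congr hterm, ← tsum_mul_left, ← tsum_mul_left,
      ← (hs₁.mul_left _).tsum_sub (hs₂.mul_left _)]
  -- the `T₁`-sum is `W(x)` termwise
  have hT₁W : (∑' ρ, T₁ ρ).re = nicolasW x := by
    rw [nicolasW_def]
    congr 1
    refine tsum_congr fun ρ ↦ ?_
    rw [hT₁, hc₁]
    simp only
    rw [cpow_sub_one_mul_sqrt hRH hx0 ρ.2]
  rw [htsum, Complex.sub_re, Complex.mul_re, Complex.mul_re]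
  simp only [Complex.neg_re, Complex.ofReal_re, Complex.neg_im, Complex.ofReal_im, neg_zero,
    zero_mul, sub_zero]
  rw [hT₁W]
  have h2' : -nicolasBeta ≤ (∑' ρ, T₂ ρ).re := by
    have := (Complex.abs_re_le_norm (∑' ρ, T₂ ρ)).trans hle₂
    exact (abs_le.1 this).1
  have e : -nicolasW x / (Real.sqrt x * Real.log x) = -a * nicolasW x := by rw [ha]; ring
  rw [e]
  nlinarith [mul_le_mul_of_nonneg_left h2' hD.le]

/-- **Nicolas 2012, Lemma 2.5, upper half in `W`-form**: under RH, for `x ≥ 2`,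
`J(x) ≤ −W(x)/(√x log x) + β (1 + 4/log x)/(√x log² x)` ((2.14)–(2.15): `J = −W/(√x log x) − J₁ − J₂`,
`|J₂| ≤ β D_x`, and the trivial zeros' bracket `J₁` absorbed by the linear term `−log(2π)/(x log x)`
exactly as in the tree's `NicolasUpper.nicolasJ_le_of_RH`, whose proof is followed verbatim with the
`F`-main term kept as `W`). [cite: Nicolas2012, Lemma 2.5 (2.14)–(2.15)] -/
theorem nicolasJ_le_W_of_RH (hRH : RiemannHypothesis) {x : ℝ} (hx : 2 ≤ x) :
    nicolasJ x ≤ -nicolasW x / (Real.sqrt x * Real.log x)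
      + nicolasBeta * ((1 + 4 / Real.log x) / (Real.sqrt x * Real.log x ^ 2)) := by
  have hx1 : 1 < x := by linarith
  have hx0 : 0 < x := by linarith
  obtain ⟨C, -, hC⟩ := exists_norm_psiOneRemainder_le
  have hiZ := integrableOn_Zsum_mul_w0' hRH hx1
  obtain ⟨hiLr, hL⟩ := linear_term hx1
  have hiL : IntegrableOn (fun t : ℝ ↦ (t : ℂ) * (w0' t : ℂ)) (Ioi x) := by
    have h0 : IntegrableOn (fun t : ℝ ↦ ((t * w0' t : ℝ) : ℂ)) (Ioi x) := hiLr.ofReal (𝕜 := ℂ)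
    refine h0.congr_fun (fun t _ ↦ by push_cast; ring) measurableSet_Ioi
  have hiE := integrableOn_psiOneRemainder_mul_w0' hx1 hC
  obtain ⟨-, hZ⟩ := zeros_bracket hRH hx1
  have hZre := re_zeros_bracket_le_W hRH hx1
  have hE := re_remainder_bracket_ge hx1 hC
  have hJ : (nicolasJ x : ℂ) = -(Rone x : ℂ) * (w0 x : ℂ) - ∫ t in Ioi x, (Rone t : ℂ) * (w0' t : ℂ) := by
    rw [nicolasJ]
    push_cast
    rw [← integral_complex_ofReal]
    congr 1
    refine setIntegral_congr_fun measurableSet_Ioi fun t _ ↦ ?_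
    push_cast; ring
  have hRx := Rone_eq_explicit hx1.le
  have hint_eq : ∫ t in Ioi x, (Rone t : ℂ) * (w0' t : ℂ) =
      -(∫ t in Ioi x, Zsum t * (w0' t : ℂ)) - Complex.log (2 * π) * (∫ t in Ioi x, (t : ℂ) * (w0' t : ℂ)) +
        ∫ t in Ioi x, psiOneRemainder t * (w0' t : ℂ) := by
    have h1 : ∫ t in Ioi x, (Rone t : ℂ) * (w0' t : ℂ) =
        ∫ t in Ioi x, (-(Zsum t * (w0' t : ℂ)) - Complex.log (2 * π) * ((t : ℂ) * (w0' t : ℂ)) +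
          psiOneRemainder t * (w0' t : ℂ)) := by
      refine setIntegral_congr_fun measurableSet_Ioi fun t ht ↦ ?_
      rw [Rone_eq_explicit (hx1.trans ht).le]; ring
    have hA : IntegrableOn (fun t : ℝ ↦ -(Zsum t * (w0' t : ℂ)) - Complex.log (2 * π) * ((t : ℂ) * (w0' t : ℂ)))
        (Ioi x) := hiZ.neg.sub (hiL.const_mul _)
    have hN : IntegrableOn (fun t : ℝ ↦ -(Zsum t * (w0' t : ℂ))) (Ioi x) := hiZ.neg
    have hM : IntegrableOn (fun t : ℝ ↦ Complex.log (2 * π) * ((t : ℂ) * (w0' t : ℂ))) (Ioi x) :=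
      hiL.const_mul _
    rw [h1, integral_add hA hiE, integral_sub hN hM, MeasureTheory.integral_neg,
      MeasureTheory.integral_const_mul]
  have hLC : (x : ℂ) * (w0 x : ℂ) + ∫ t in Ioi x, (t : ℂ) * (w0' t : ℂ) = ((-(1 / (x * Real.log x)) : ℝ) : ℂ) := by
    rw [← hL]
    push_cast
    rw [← integral_complex_ofReal]
    congr 1
    refine setIntegral_congr_fun measurableSet_Ioi fun t _ ↦ ?_
    push_cast; ring
  have key : (nicolasJ x : ℂ) =
      (Zsum x * (w0 x : ℂ) + ∫ t in Ioi x, Zsum t * (w0' t : ℂ)) +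
        Complex.log (2 * π) * ((x : ℂ) * (w0 x : ℂ) + ∫ t in Ioi x, (t : ℂ) * (w0' t : ℂ)) -
        (psiOneRemainder x * (w0 x : ℂ) + ∫ t in Ioi x, psiOneRemainder t * (w0' t : ℂ)) := by
    rw [hJ, hint_eq, hRx]; ring
  rw [hZ, hLC, log_two_pi] at key
  have hre : nicolasJ x =
      (-∑' ρ : Zeros, (riemannZetaZeroOrder (ρ : ℂ) : ℂ) / (ρ : ℂ) * Fz (ρ : ℂ) x).re +
        Real.log (2 * π) * (-(1 / (x * Real.log x))) -
        (psiOneRemainder x * (w0 x : ℂ) + ∫ t in Ioi x, psiOneRemainder t * (w0' t : ℂ)).re := by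
    have h := congrArg Complex.re key
    rw [Complex.ofReal_re, Complex.sub_re, Complex.add_re, ← Complex.ofReal_mul, Complex.ofReal_re] at h
    exact h
  rw [hre]
  have hlx : 0 < Real.log x := Real.log_pos hx1
  have hl2 : (0.6931471803 : ℝ) < Real.log x :=
    lt_of_lt_of_le Real.log_two_gt_d9 (Real.log_le_log (by norm_num) hx)
  have habs : x / (2 * (x ^ 2 - 1)) * w0 x ≤ Real.log (2 * π) / (x * Real.log x) := by
    have h2π : 1 ≤ Real.log (2 * π) := by
      rw [Real.le_log_iff_exp_le (by positivity)]
      have h1 := Real.exp_one_lt_d9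
      have h2 := Real.pi_gt_three
      linarith
    have hx21 : 0 < x ^ 2 - 1 := by nlinarith
    have hinv : 1 / Real.log x ≤ 3 / 2 := by
      rw [div_le_div_iff₀ hlx (by norm_num)]; linarith
    have hw0le : w0 x ≤ 4 / x ^ 2 := by
      rw [w0, NicolasFz.wt]
      refine div_le_div_of_nonneg_right ?_ (by positivity)
      have hsq : 1 / Real.log x ^ 2 = (1 / Real.log x) ^ 2 := by rw [one_div_pow]
      rw [hsq]
      nlinarith [hinv, one_div_pos.2 hlx]
    have step1 : x / (2 * (x ^ 2 - 1)) * w0 x ≤ x / (2 * (x ^ 2 - 1)) * (4 / x ^ 2) :=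
      mul_le_mul_of_nonneg_left hw0le (by positivity)
    have step2 : x / (2 * (x ^ 2 - 1)) * (4 / x ^ 2) = 2 / (x * (x ^ 2 - 1)) := by
      field_simp; ring
    have step3 : 2 / (x * (x ^ 2 - 1)) ≤ 1 / (x * Real.log x) := by
      rw [div_le_div_iff₀ (by positivity) (by positivity)]
      have hlog := Real.log_le_sub_one_of_pos hx0
      nlinarith
    have step4 : 1 / (x * Real.log x) ≤ Real.log (2 * π) / (x * Real.log x) :=
      div_le_div_of_nonneg_right h2π (by positivity)
    linarith
  have e : Real.log (2 * π) * (-(1 / (x * Real.log x))) = -(Real.log (2 * π) / (x * Real.log x)) := by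
    ring
  rw [e]
  rw [Dx] at hZre
  linarith [hZre, hE, habs]

/-! ### Cor. 2.1, lower half, sharp form: `J − K ≥ (1 − η(x)) F_{1/2}(x)` under RH -/

/-- Schoenfeld's relative error at `√t`: `η(x) = log² x/(32π x^{1/4})` (`T(√x)/√x`, (1.12)).
[cite: Nicolas2012, (1.12) and (2.9)] -/
def eta (x : ℝ) : ℝ := Real.log x ^ 2 / (32 * π * x ^ ((1 : ℝ) / 4))

/-- `η(x) ≥ 0` for `x ≥ 1`. [folklore] -/
private theorem eta_nonneg {x : ℝ} (hx : 0 < x) : 0 ≤ eta x := by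
  unfold eta; positivity

/-- `log x ≥ 12` for `x ≥ 358801`. [folklore] -/
private theorem twelve_le_log {x : ℝ} (hx : 358801 ≤ x) : 12 ≤ Real.log x := by
  rw [Real.le_log_iff_exp_le (by linarith)]
  have h1 : Real.exp 12 = Real.exp 1 ^ 12 := by rw [← Real.exp_nat_mul]; norm_num
  rw [h1]
  have h2 := Real.exp_one_lt_d9
  have h3 : Real.exp 1 ^ 12 < 2.7182818286 ^ 12 :=
    pow_lt_pow_left₀ h2 (Real.exp_pos 1).le (by norm_num)
  have h4 : (2.7182818286 : ℝ) ^ 12 < 358801 := by norm_num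
  linarith

/-- `η(x) ≤ 2/3` for `x ≥ 358801` (crude: `log x ≤ 8 x^{1/8}`, so `log² x ≤ 64 x^{1/4}`, and
`64 < (2/3)·32π`). [folklore] -/
private theorem eta_le {x : ℝ} (hx : 358801 ≤ x) : eta x ≤ 2 / 3 := by
  have hx0 : 0 < x := by linarith
  set u : ℝ := x ^ ((1 : ℝ) / 4) with hu
  have hu0 : 0 < u := Real.rpow_pos_of_pos hx0 _
  have hπ := Real.pi_gt_three
  have hlog8 : Real.log x ≤ 8 * Real.sqrt u := by
    have h := Real.log_le_rpow_div hx0.le (show (0 : ℝ) < 1 / 8 by norm_num)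
    have hsu : Real.sqrt u = x ^ ((1 : ℝ) / 8) := by
      rw [hu, Real.sqrt_eq_rpow, ← Real.rpow_mul hx0.le]; norm_num
    rw [hsu]
    linarith [show x ^ ((1 : ℝ) / 8) / (1 / 8 : ℝ) = 8 * x ^ ((1 : ℝ) / 8) by ring]
  have hlog0 : 0 ≤ Real.log x := Real.log_nonneg (by linarith)
  have hsq : Real.log x ^ 2 ≤ 64 * u := by
    have hs0 : 0 ≤ Real.sqrt u := Real.sqrt_nonneg _
    have hss : Real.sqrt u * Real.sqrt u = u := Real.mul_self_sqrt hu0.le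
    nlinarith
  rw [eta, ← hu, div_le_iff₀ (by positivity)]
  have h64 : 64 * u ≤ 2 / 3 * (32 * π * u) := by nlinarith
  linarith

/-- Under RH, for `t ≥ x ≥ 599² = 358801`: `ψ(t) − θ(t) ≥ (1 − η(x)) √t`, from
`ψ − θ ≥ θ(√t) ≥ √t − T(√t) = √t (1 − η(t))` ((2.9) with Schoenfeld's (1.12) at `√t ≥ 599`) and the
decrease of `η` on `[e⁸, ∞)`. [cite: Nicolas2012, Lemma 2.4 (2.9); Schoenfeld1976, §6] -/
theorem psi_sub_theta_ge_sharp (hS : Schoenfeld1976_theta) (hRH : RiemannHypothesis) {x t : ℝ}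
    (hx : 358801 ≤ x) (hxt : x ≤ t) :
    (1 - eta x) * Real.sqrt t ≤ ψ t - θ t := by
  have ht : 358801 ≤ t := hx.trans hxt
  have ht2 : (2 : ℝ) ≤ t := by linarith
  have ht0 : 0 < t := by linarith
  have hx0 : 0 < x := by linarith
  have hsq : (599 : ℝ) ≤ Real.sqrt t := by
    rw [show (599 : ℝ) = Real.sqrt (599 ^ 2) by rw [Real.sqrt_sq (by norm_num)]]
    exact Real.sqrt_le_sqrt (by norm_num; linarith)
  have hS := hS hRH (Real.sqrt t) hsq
  -- `θ(√t) ≥ √t − √(√t) log²(√t)/(8π) = √t − η(t) √t`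
  have hst0 : 0 < Real.sqrt t := Real.sqrt_pos.2 ht0
  have hlow : Real.sqrt t - Real.sqrt (Real.sqrt t) * Real.log (Real.sqrt t) ^ 2 / (8 * π) ≤ θ (Real.sqrt t) := by
    have := (abs_le.1 hS).1; linarith
  have hq : Real.sqrt (Real.sqrt t) = t ^ ((1 : ℝ) / 4) := by
    rw [Real.sqrt_eq_rpow, Real.sqrt_eq_rpow, ← Real.rpow_mul ht0.le]; norm_num
  have hls : Real.log (Real.sqrt t) = Real.log t / 2 := by
    rw [Real.sqrt_eq_rpow, Real.log_rpow ht0]; ring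
  have hT : Real.sqrt (Real.sqrt t) * Real.log (Real.sqrt t) ^ 2 / (8 * π) = eta t * Real.sqrt t := by
    rw [hq, hls, eta]
    have h4 : t ^ ((1 : ℝ) / 4) * t ^ ((1 : ℝ) / 4) = Real.sqrt t := by
      rw [← Real.rpow_add ht0, Real.sqrt_eq_rpow]; norm_num
    have hq0 : 0 < t ^ ((1 : ℝ) / 4) := Real.rpow_pos_of_pos ht0 _
    field_simp
    nlinarith [h4]
  -- `η(t) ≤ η(x)` (`log² u/u^{1/4}` decreasing for `log u ≥ 8`)
  have hηle : eta t ≤ eta x := by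
    have hmono := log_pow_div_rpow_le (a := (1 : ℝ) / 4) (k := 2) (by norm_num) (by norm_num) hx0
      (by have := twelve_le_log hx; norm_num; linarith) hxt
    rw [eta, eta, div_eq_mul_one_div, div_eq_mul_one_div (Real.log x ^ 2)]
    have e1 : ∀ u : ℝ, 0 < u → Real.log u ^ 2 / (32 * π * u ^ ((1 : ℝ) / 4)) =
        Real.log u ^ 2 / u ^ ((1 : ℝ) / 4) * (1 / (32 * π)) := by
      intro u hu
      have : 0 < u ^ ((1 : ℝ) / 4) := Real.rpow_pos_of_pos hu _
      field_simp
    rw [← div_eq_mul_one_div, ← div_eq_mul_one_div, e1 t ht0, e1 x hx0]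
    exact mul_le_mul_of_nonneg_right hmono (by positivity)
  -- `ψ − θ ≥ θ(√t)`
  have hψθ : θ (Real.sqrt t) ≤ ψ t - θ t := by
    rw [Chebyshev.psi_eq_theta_add_sum_theta ht2, add_sub_cancel_left]
    have hK : 2 ∈ Finset.Icc 2 ⌊Real.log t / Real.log 2⌋₊ := by
      rw [Finset.mem_Icc]
      refine ⟨le_rfl, Nat.le_floor ?_⟩
      rw [Nat.cast_ofNat, le_div_iff₀ (Real.log_pos one_lt_two)]
      calc (2 : ℝ) * Real.log 2 = Real.log (2 ^ 2) := by rw [Real.log_pow]; norm_num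
        _ ≤ Real.log t := Real.log_le_log (by norm_num) (by norm_num; linarith)
    have hle : θ (t ^ ((1 : ℝ) / 2)) ≤ ∑ n ∈ Finset.Icc 2 ⌊Real.log t / Real.log 2⌋₊, θ (t ^ ((1 : ℝ) / n)) := by
      refine Finset.single_le_sum (f := fun n : ℕ ↦ θ (t ^ ((1 : ℝ) / n))) (fun n _ ↦ Chebyshev.theta_nonneg _) hK
        |>.trans_eq' ?_
      norm_num
    rw [Real.sqrt_eq_rpow]
    exact hle
  have : (1 - eta x) * Real.sqrt t ≤ (1 - eta t) * Real.sqrt t :=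
    mul_le_mul_of_nonneg_right (by linarith) hst0.le
  nlinarith [hlow, hT, hψθ, this]

/-- **From a pointwise lower bound to Cor. 2.1's lower half**: under RH, if `ψ(t) − θ(t) ≥ c √t`
for all `t ≥ x` (`x > 1`) then `c F_{1/2}(x) ≤ J(x) − K(x)` (`J − K = lim_X ∫ₓ^X (ψ − θ) w₀`,
`F_{1/2} = lim_X ∫ₓ^X √t w₀`). [cite: Nicolas2012, Cor. 2.1 (2.13) (proof)] -/
theorem jk_ge_of_pointwise (hRH : RiemannHypothesis) {x c : ℝ} (hx : 1 < x)
    (h : ∀ t : ℝ, x ≤ t → c * Real.sqrt t ≤ ψ t - θ t) :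
    c * (Fz (1 / 2 : ℝ) x).re ≤ nicolasJ x - nicolasKInt x := by
  obtain ⟨C, hC⟩ := exists_abs_Rone_le_of_RH hRH
  have hR : ∀ t, x ≤ t → |Rone t| ≤ C * t ^ (3 / 2 : ℝ) := fun t ht ↦ hC t (by linarith)
  have hlim := (tendsto_integral_R_mul_w0 hx hR).sub (tendsto_integral_S_mul_w0 hx)
  have hlow := (tendsto_integral_rpow_mul_w0 hx).const_mul c
  refine le_of_tendsto_of_tendsto hlow hlim ?_
  filter_upwards [eventually_ge_atTop x] with X hX
  have hiψ := intervalIntegrable_R_mul_w0 hx hX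
  have hiθ := intervalIntegrable_S_mul_w0 hx hX
  have hi2 := intervalIntegrable_rpow_mul_w0 (1 / 2) hx hX
  rw [← intervalIntegral.integral_sub hiψ hiθ, ← intervalIntegral.integral_const_mul]
  refine intervalIntegral.integral_mono_on hX (hi2.const_mul _) (hiψ.sub hiθ) fun t ht ↦ ?_
  have ht1 : 1 < t := hx.trans_le ht.1
  have hw := (w0_pos ht1).le
  have h' := h t ht.1
  rw [Real.sqrt_eq_rpow] at h'
  have e1 : c * (t ^ ((1 : ℝ) / 2) * w0 t) = (c * t ^ ((1 : ℝ) / 2)) * w0 t := by ring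
  have e2 : (ψ t - t) * w0 t - (θ t - t) * w0 t = (ψ t - θ t) * w0 t := by ring
  rw [e1, e2]
  exact mul_le_mul_of_nonneg_right h' hw

/-- **From a pointwise upper bound to Cor. 2.1's upper half**: under RH, if `ψ(t) − θ(t) ≤ c √t`
for all `t ≥ x` (`x > 1`) then `J(x) − K(x) ≤ c F_{1/2}(x)`. [cite: Nicolas2012, Cor. 2.1 (2.13) (proof)] -/
theorem jk_le_of_pointwise (hRH : RiemannHypothesis) {x c : ℝ} (hx : 1 < x)
    (h : ∀ t : ℝ, x ≤ t → ψ t - θ t ≤ c * Real.sqrt t) :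
    nicolasJ x - nicolasKInt x ≤ c * (Fz (1 / 2 : ℝ) x).re := by
  obtain ⟨C, hC⟩ := exists_abs_Rone_le_of_RH hRH
  have hR : ∀ t, x ≤ t → |Rone t| ≤ C * t ^ (3 / 2 : ℝ) := fun t ht ↦ hC t (by linarith)
  have hlim := (tendsto_integral_R_mul_w0 hx hR).sub (tendsto_integral_S_mul_w0 hx)
  have hup := (tendsto_integral_rpow_mul_w0 hx).const_mul c
  refine le_of_tendsto_of_tendsto hlim hup ?_
  filter_upwards [eventually_ge_atTop x] with X hX
  have hiψ := intervalIntegrable_R_mul_w0 hx hX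
  have hiθ := intervalIntegrable_S_mul_w0 hx hX
  have hi2 := intervalIntegrable_rpow_mul_w0 (1 / 2) hx hX
  rw [← intervalIntegral.integral_sub hiψ hiθ, ← intervalIntegral.integral_const_mul]
  refine intervalIntegral.integral_mono_on hX (hiψ.sub hiθ) (hi2.const_mul _) fun t ht ↦ ?_
  have ht1 : 1 < t := hx.trans_le ht.1
  have hw := (w0_pos ht1).le
  have h' := h t ht.1
  rw [Real.sqrt_eq_rpow] at h'
  have e1 : c * (t ^ ((1 : ℝ) / 2) * w0 t) = (c * t ^ ((1 : ℝ) / 2)) * w0 t := by ring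
  have e2 : (ψ t - t) * w0 t - (θ t - t) * w0 t = (ψ t - θ t) * w0 t := by ring
  rw [e1, e2]
  exact mul_le_mul_of_nonneg_right h' hw

/-- **Nicolas 2012, Cor. 2.1 (2.13), lower half, sharp form under RH**: for `x ≥ 599²`,
`(1 − η(x)) F_{1/2}(x) ≤ J(x) − K(x)` (printed: `F_{1/2} ≤ J − K` for `x ≥ 121`, through the
table (2.11); here the factor `1 − η(x) → 1` replaces the table). [cite: Nicolas2012, Cor. 2.1 (2.13)] -/
theorem jk_lower_sharp_of_RH (hS : Schoenfeld1976_theta) (hRH : RiemannHypothesis) {x : ℝ}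
    (hx : 358801 ≤ x) :
    (1 - eta x) * (Fz (1 / 2 : ℝ) x).re ≤ nicolasJ x - nicolasKInt x :=
  jk_ge_of_pointwise hRH (by linarith) fun _ ht ↦ psi_sub_theta_ge_sharp hS hRH hx ht

/-- The error of the `W`-form of (2.19): `η₂(x) = 2η(x) + (2 + β(1 + 4/log x))/log x + 4 log x/√x`.
[cite: Nicolas2012, (2.19)] -/
def eta2 (x : ℝ) : ℝ :=
  2 * eta x + (2 + nicolasBeta * (1 + 4 / Real.log x)) / Real.log x + 4 * Real.log x / Real.sqrt x

/-- **(2.19) in `W`-form, generic in the lower factor of Cor. 2.1 (PROVED under RH)**: for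
`x ≥ 599²`, if `c F_{1/2}(x) ≤ J(x) − K(x)` with `0 ≤ c ≤ 1`, then
`−log f(x) · √x log x ≥ W(x) + 2 − [2(1−c) + (2 + β(1+4/log x))/log x + 4 log x/√x]`
(Lemma 2.1 upper with the tree's tail `4/x`, Lemma 2.5 in `W`-form, (2.4)).
[cite: Nicolas2012, Prop. 2.1 (2.19)] -/
theorem neg_log_nicolasF_ge_W_of (hRH : RiemannHypothesis) {x c : ℝ} (hx : 358801 ≤ x)
    (hc0 : 0 ≤ c) (hc1 : c ≤ 1) (hJK : c * (Fz (1 / 2 : ℝ) x).re ≤ nicolasJ x - nicolasKInt x) :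
    nicolasW x + 2 - (2 * (1 - c) + (2 + nicolasBeta * (1 + 4 / Real.log x)) / Real.log x
      + 4 * Real.log x / Real.sqrt x) ≤ -Real.log (nicolasF x) * (Real.sqrt x * Real.log x) := by
  have hx1 : 1 < x := by linarith
  have hx0 : 0 < x := by linarith
  have h1 := lemma21_upper (show (3 : ℝ) ≤ x by linarith)
  have h3 := nicolasJ_le_W_of_RH hRH (show (2 : ℝ) ≤ x by linarith)
  have h4 := Fhalf_ge hx1
  have hβ0 : 0 < nicolasBeta := lt_trans (by norm_num) nicolasBeta_gt
  set L := Real.log x with hLdef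
  set s := Real.sqrt x with hsdef
  have hs0 : 0 < s := Real.sqrt_pos.2 hx0
  have hL0 : 0 < L := Real.log_pos hx1
  have hxs : x = s * s := (Real.mul_self_sqrt hx0.le).symm
  set F := (Fz (1 / 2 : ℝ) x).re with hF
  set W := nicolasW x with hW
  have hF0 : 0 ≤ 2 / (s * L) - 2 / (s * L ^ 2) := by
    have hL12 : 12 ≤ L := twelve_le_log hx
    have hle : s * L ≤ s * L ^ 2 := mul_le_mul_of_nonneg_left (by nlinarith) hs0.le
    have : 2 / (s * L ^ 2) ≤ 2 / (s * L) := div_le_div_of_nonneg_left (by norm_num) (by positivity) hle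
    linarith
  have h24 : c * (2 / (s * L) - 2 / (s * L ^ 2)) ≤ nicolasJ x - nicolasKInt x :=
    (mul_le_mul_of_nonneg_left h4 hc0).trans hJK
  have hlogf : Real.log (nicolasF x) ≤ -W / (s * L) + nicolasBeta * ((1 + 4 / L) / (s * L ^ 2))
      - c * (2 / (s * L) - 2 / (s * L ^ 2)) + 4 / x := by linarith
  have hsL : 0 < s * L := mul_pos hs0 hL0
  have key : Real.log (nicolasF x) * (s * L) ≤ -W + nicolasBeta * (1 + 4 / L) / L
      - c * (2 - 2 / L) + 4 * L / s := by
    have e1 : (-W / (s * L) + nicolasBeta * ((1 + 4 / L) / (s * L ^ 2))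
        - c * (2 / (s * L) - 2 / (s * L ^ 2)) + 4 / x) * (s * L) =
        -W + nicolasBeta * (1 + 4 / L) / L - c * (2 - 2 / L) + 4 * L / s := by
      rw [hxs]; field_simp
    rw [← e1]
    exact mul_le_mul_of_nonneg_right hlogf hsL.le
  have hdrop : c * (2 - 2 / L) ≥ 2 - 2 * (1 - c) - 2 / L := by
    have : 0 ≤ (1 - c) * (2 / L) := by positivity
    nlinarith
  have e2 : (2 + nicolasBeta * (1 + 4 / L)) / L = 2 / L + nicolasBeta * (1 + 4 / L) / L := by
    rw [add_div]
  rw [e2]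
  linarith

/-- **(2.19) in `W`-form (PROVED under RH)**: for `x ≥ 599² = 358801`,
`−log f(x) · √x log x ≥ W(x) + 2 − η₂(x)`, i.e.
`log f(x) ≤ −(W(x)+2)/(√x log x) + 2η(x)/(√x log x) + (2 + β(1+4/log x))/(√x log² x) + 4/x`
(Lemma 2.1 upper with the tree's tail `4/x`, Cor. 2.1 sharp lower half, Lemma 2.5 in `W`-form, (2.4)).
[cite: Nicolas2012, Prop. 2.1 (2.19)] -/
theorem neg_log_nicolasF_ge_W (hS : Schoenfeld1976_theta) (hRH : RiemannHypothesis) {x : ℝ}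
    (hx : 358801 ≤ x) :
    nicolasW x + 2 - eta2 x ≤ -Real.log (nicolasF x) * (Real.sqrt x * Real.log x) := by
  have hx0 : 0 < x := by linarith
  have h := neg_log_nicolasF_ge_W_of hRH hx (by linarith [eta_le hx]) (by linarith [eta_nonneg hx0])
    (jk_lower_sharp_of_RH hS hRH hx)
  have e : 2 * (1 - (1 - eta x)) = 2 * eta x := by ring
  rw [e] at h
  rw [eta2]
  exact h

/-! ### §3 (3.4) and Prop. 3.1 in asymptotic form -/

/-- `f` is a step function: `f(x) = f(⌊x⌋)`. [cite: Nicolas2012, (1.9)] -/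
theorem nicolasF_eq_floor (x : ℝ) : nicolasF x = nicolasF (⌊x⌋₊ : ℕ) := by
  rw [nicolasF, nicolasF, Nat.floor_natCast, ← Chebyshev.theta_eq_theta_coe_floor]

/-- `log(⌊x⌋#) = θ(x)`. [cite: Nicolas2012, §3 (`log N_k = θ(p_k)`)] -/
theorem log_primorial_floor (x : ℝ) : Real.log (primorial ⌊x⌋₊ : ℝ) = θ x := by
  rw [Chebyshev.theta_eq_theta_coe_floor x, Chebyshev.theta_eq_log_primorial, Nat.floor_natCast]

/-- **(3.4)**: for `x ≥ 3`, with `N = ⌊x⌋# = N_k` (`p_k ≤ x < p_{k+1}`),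
`c(N) = e^γ √θ(x) log θ(x) (1/f(x) − 1)`. [cite: Nicolas2012, Prop. 3.1 (3.4)] -/
theorem nicolasC_primorial_floor_eq {x : ℝ} (hx : 3 ≤ x) :
    nicolasC (primorial ⌊x⌋₊) =
      rexp Real.eulerMascheroniConstant * (Real.sqrt (θ x) * Real.log (θ x)) * (1 / nicolasF x - 1) := by
  set m := ⌊x⌋₊ with hm
  have hθ := log_primorial_floor x
  rw [← hm] at hθ
  have hf : nicolasF x = rexp Real.eulerMascheroniConstant * Real.log (θ x) *
      ((Nat.totient (primorial m) : ℝ) / primorial m) := by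
    rw [nicolasF_eq_floor, ← hm, nicolasF_natCast_eq, hθ]
  have hf0 : nicolasF x ≠ 0 := (nicolasF_pos hx).ne'
  have hN0 : (0 : ℝ) < primorial m := by exact_mod_cast primorial_pos m
  have hφ0 : (0 : ℝ) < Nat.totient (primorial m) := by exact_mod_cast Nat.totient_pos.2 (primorial_pos m)
  have hlog0 : Real.log (θ x) ≠ 0 := by
    have := one_lt_theta hx
    exact (Real.log_pos this).ne'
  have hratio : (primorial m : ℝ) / (Nat.totient (primorial m) : ℝ) =
      rexp Real.eulerMascheroniConstant * Real.log (θ x) / nicolasF x := by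
    rw [hf]; field_simp
  rw [nicolasC, hθ, hratio]
  field_simp

/-- `e^v − 1 ≤ v e^v` for every real `v` (convexity). [folklore] -/
private theorem exp_sub_one_le_mul_exp (v : ℝ) : rexp v - 1 ≤ v * rexp v := by
  have h := Real.add_one_le_exp (-v)
  have hv := Real.exp_pos v
  have : (-v + 1) * rexp v ≤ rexp (-v) * rexp v := mul_le_mul_of_nonneg_right h hv.le
  rw [← Real.exp_add, neg_add_cancel, Real.exp_zero] at this
  nlinarith

/-- `1/f − 1 ≥ −log f` (`f > 0`). [folklore] -/
private theorem neg_log_le_inv_sub_one {f : ℝ} (hf : 0 < f) : -Real.log f ≤ 1 / f - 1 := by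
  have h := Real.add_one_le_exp (-Real.log f)
  rw [Real.exp_neg, Real.exp_log hf, inv_eq_one_div] at h
  linarith

/-- `1/f − 1 ≤ v e^v` whenever `−v ≤ log f` (`f > 0`). [folklore] -/
private theorem inv_sub_one_le {f v : ℝ} (hf : 0 < f) (hv : -v ≤ Real.log f) : 1 / f - 1 ≤ v * rexp v := by
  have h1 : 1 / f ≤ rexp v := by
    rw [← Real.exp_log hf, one_div, ← Real.exp_neg]
    exact Real.exp_le_exp.2 (by linarith)
  linarith [exp_sub_one_le_mul_exp v]

/-- The ratio `√θ(x) log θ(x)/(√x log x)`. [cite: Nicolas2012, Prop. 3.1 (proof)] -/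
def ratio (x : ℝ) : ℝ := Real.sqrt (θ x) * Real.log (θ x) / (Real.sqrt x * Real.log x)

/-- `ratio x ≥ 0` for `x ≥ 3`. [folklore] -/
private theorem ratio_nonneg {x : ℝ} (hx : 3 ≤ x) : 0 ≤ ratio x := by
  have := one_lt_theta hx
  have : 0 ≤ Real.log (θ x) := Real.log_nonneg this.le
  have : 0 ≤ Real.log x := Real.log_nonneg (by linarith)
  unfold ratio; positivity

/-- Under RH, `θ(x)/x → 1` (Schoenfeld: `|θ(x) − x| ≤ √x log² x/(8π)`, `x ≥ 599`).
[cite: Schoenfeld1976, §6; Nicolas2012, (1.12)] -/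
theorem tendsto_theta_div (hS : Schoenfeld1976_theta) (hRH : RiemannHypothesis) :
    Tendsto (fun x : ℝ ↦ θ x / x) atTop (𝓝 1) := by
  have hlo : Tendsto (fun x : ℝ ↦ Real.log x ^ (2 : ℝ) / x ^ ((1 : ℝ) / 2)) atTop (𝓝 0) :=
    (isLittleO_log_rpow_rpow_atTop 2 (by norm_num)).tendsto_div_nhds_zero
  have hb : Tendsto (fun x : ℝ ↦ Real.log x ^ (2 : ℝ) / x ^ ((1 : ℝ) / 2) / (8 * π)) atTop (𝓝 0) := by
    simpa using hlo.div_const (8 * π)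
  have h0 : Tendsto (fun x : ℝ ↦ 1 - Real.log x ^ (2 : ℝ) / x ^ ((1 : ℝ) / 2) / (8 * π)) atTop (𝓝 1) := by
    simpa using (tendsto_const_nhds (x := (1 : ℝ))).sub hb
  have h1 : Tendsto (fun x : ℝ ↦ 1 + Real.log x ^ (2 : ℝ) / x ^ ((1 : ℝ) / 2) / (8 * π)) atTop (𝓝 1) := by
    simpa using (tendsto_const_nhds (x := (1 : ℝ))).add hb
  refine tendsto_of_tendsto_of_tendsto_of_le_of_le' h0 h1 ?_ ?_
  all_goals filter_upwards [eventually_ge_atTop (599 : ℝ)] with x hx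
  all_goals
    have hx0 : 0 < x := by linarith
    have hS := abs_le.1 (hS hRH x hx)
    have hs : Real.sqrt x = x ^ ((1 : ℝ) / 2) := Real.sqrt_eq_rpow x
    have hsx : 0 < Real.sqrt x := Real.sqrt_pos.2 hx0
    have hxs : x = Real.sqrt x * Real.sqrt x := (Real.mul_self_sqrt hx0.le).symm
    have hL2 : Real.log x ^ (2 : ℝ) = Real.log x ^ 2 := by norm_cast
    have e : Real.log x ^ (2 : ℝ) / x ^ ((1 : ℝ) / 2) / (8 * π) =
        Real.sqrt x * Real.log x ^ 2 / (8 * π) / x := by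
      rw [← hs, hL2]; field_simp; nlinarith [hxs]
    rw [e]
  · rw [le_div_iff₀ hx0, sub_mul, one_mul, div_mul_cancel₀ _ hx0.ne']
    linarith [hS.1]
  · rw [div_le_iff₀ hx0, add_mul, one_mul, div_mul_cancel₀ _ hx0.ne']
    linarith [hS.2]

/-- `√θ(x) log θ(x)/(√x log x) → 1` as soon as `θ(x)/x → 1`.
[cite: Nicolas2012, Prop. 3.1 (proof, "≤ 0.0069/log x")] -/
theorem tendsto_ratio_of (hθ : Tendsto (fun x : ℝ ↦ θ x / x) atTop (𝓝 1)) : Tendsto ratio atTop (𝓝 1) := by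
  -- `√(θ/x) → 1`
  have hsq : Tendsto (fun x : ℝ ↦ Real.sqrt (θ x / x)) atTop (𝓝 1) := by
    have := (Real.continuous_sqrt.tendsto 1).comp hθ
    rw [Real.sqrt_one] at this
    exact this
  -- `log(θ/x) → 0`, hence `log θ/log x = 1 + log(θ/x)/log x → 1`
  have hlg : Tendsto (fun x : ℝ ↦ Real.log (θ x / x)) atTop (𝓝 0) := by
    have := ((Real.continuousAt_log one_ne_zero).tendsto).comp hθ
    rw [Real.log_one] at this
    exact this
  have hq : Tendsto (fun x : ℝ ↦ Real.log (θ x / x) / Real.log x) atTop (𝓝 0) :=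
    hlg.div_atTop Real.tendsto_log_atTop
  have hl : Tendsto (fun x : ℝ ↦ 1 + Real.log (θ x / x) / Real.log x) atTop (𝓝 1) := by
    simpa using (tendsto_const_nhds (x := (1 : ℝ))).add hq
  have hprod := hsq.mul hl
  rw [one_mul] at hprod
  refine hprod.congr' ?_
  filter_upwards [eventually_ge_atTop (3 : ℝ)] with x hx
  have hx0 : 0 < x := by linarith
  have hθ1 := one_lt_theta hx
  have hlx : Real.log x ≠ 0 := (Real.log_pos (by linarith)).ne'
  rw [ratio, Real.sqrt_div (Chebyshev.theta_nonneg x), Real.log_div (by linarith) hx0.ne']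
  field_simp
  ring

/-- Under RH, `√θ(x) log θ(x)/(√x log x) → 1` (Schoenfeld road). [cite: Nicolas2012, Prop. 3.1 (proof)] -/
theorem tendsto_ratio (hS : Schoenfeld1976_theta) (hRH : RiemannHypothesis) : Tendsto ratio atTop (𝓝 1) :=
  tendsto_ratio_of (tendsto_theta_div hS hRH)

/-- `√x log x → ∞`. [folklore] -/
private theorem tendsto_sqrt_mul_log : Tendsto (fun x : ℝ ↦ Real.sqrt x * Real.log x) atTop atTop := by
  have hs : Tendsto Real.sqrt atTop atTop := by
    have := tendsto_rpow_atTop (show (0 : ℝ) < 1 / 2 by norm_num)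
    exact this.congr' (by filter_upwards with x; exact (Real.sqrt_eq_rpow x).symm)
  exact hs.atTop_mul_atTop₀ Real.tendsto_log_atTop

/-- The negative of the lower bound (2.18):
`v(x) = (β+2)/(√x log x) − (2−β)/(√x log² x) + (8+4β)/(√x log³ x) + log(2π)/(x log x) + 2/(x^{2/3} log x) + log³ x/(64π² x)`.
[cite: Nicolas2012, (2.18)] -/
def vUp (x : ℝ) : ℝ :=
  (nicolasBeta + 2) / (Real.sqrt x * Real.log x) - (2 - nicolasBeta) / (Real.sqrt x * Real.log x ^ 2)
    + (8 + 4 * nicolasBeta) / (Real.sqrt x * Real.log x ^ 3) + Real.log (2 * π) / (x * Real.log x)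
    + 2 / (x ^ ((2 : ℝ) / 3) * Real.log x) + Real.log x ^ 3 / (64 * π ^ 2 * x)

/-- `v(x) · √x log x` in closed form:
`u(x) = (β+2) − (2−β)/log x + (8+4β)/log² x + log(2π)/√x + 2x^{−1/6} + log⁴ x/(64π² √x)`.
[cite: Nicolas2012, (2.18) ⟹ (2.20)] -/
def uUp (x : ℝ) : ℝ :=
  (nicolasBeta + 2) - (2 - nicolasBeta) / Real.log x + (8 + 4 * nicolasBeta) / Real.log x ^ 2
    + Real.log (2 * π) / Real.sqrt x + 2 * x ^ (-(1 : ℝ) / 6) + Real.log x ^ 4 / (64 * π ^ 2 * Real.sqrt x)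

/-- `v(x) √x log x = u(x)` (`x > 1`; substitution `x = y⁶`). [folklore] -/
private theorem vUp_mul_eq_uUp {x : ℝ} (hx : 1 < x) : vUp x * (Real.sqrt x * Real.log x) = uUp x := by
  have hx0 : 0 < x := by linarith
  set L := Real.log x with hL
  have hL0 : 0 < L := Real.log_pos hx
  set y : ℝ := x ^ ((1 : ℝ) / 6) with hy
  have hy0 : 0 < y := Real.rpow_pos_of_pos hx0 _
  have hs : Real.sqrt x = y ^ 3 := by
    rw [hy, ← Real.rpow_natCast, ← Real.rpow_mul hx0.le, Real.sqrt_eq_rpow]; norm_num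
  have h23 : x ^ ((2 : ℝ) / 3) = y ^ 4 := by
    rw [hy, ← Real.rpow_natCast, ← Real.rpow_mul hx0.le]; norm_num
  have h16 : x ^ (-(1 : ℝ) / 6) = y⁻¹ := by
    rw [hy, ← Real.rpow_neg_one, ← Real.rpow_mul hx0.le]; norm_num
  have hx6 : x = y ^ 6 := by
    rw [hy, ← Real.rpow_natCast, ← Real.rpow_mul hx0.le]; norm_num
  rw [vUp, uUp, ← hL, hs, h23, h16]
  rw [hx6]
  field_simp

/-- (2.18) reads `log f(x) ≥ −v(x)` (`x ≥ 599`, under RH). [cite: Nicolas2012, (2.18)] -/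
theorem neg_vUp_le_log_nicolasF (h18 : Nicolas2012_logf_lower_sharp) (hRH : RiemannHypothesis) {x : ℝ}
    (hx : 599 ≤ x) : -vUp x ≤ Real.log (nicolasF x) := by
  have h := h18 hRH x hx
  rw [neg_div] at h
  rw [vUp]
  linarith

/-- `u(x) → β + 2`. [cite: Nicolas2012, Prop. 2.1 ((2.18) ⟹ (2.16))] -/
theorem tendsto_uUp : Tendsto uUp atTop (𝓝 (nicolasBeta + 2)) := by
  have hL := Real.tendsto_log_atTop
  have hs : Tendsto Real.sqrt atTop atTop := by
    have := tendsto_rpow_atTop (show (0 : ℝ) < 1 / 2 by norm_num)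
    exact this.congr' (by filter_upwards with x; exact (Real.sqrt_eq_rpow x).symm)
  have h1 : Tendsto (fun x : ℝ ↦ (2 - nicolasBeta) / Real.log x) atTop (𝓝 0) :=
    tendsto_const_nhds.div_atTop hL
  have h2 : Tendsto (fun x : ℝ ↦ (8 + 4 * nicolasBeta) / Real.log x ^ 2) atTop (𝓝 0) :=
    tendsto_const_nhds.div_atTop (hL.atTop_mul_atTop₀ hL |>.congr' (by filter_upwards with x; ring))
  have h3 : Tendsto (fun x : ℝ ↦ Real.log (2 * π) / Real.sqrt x) atTop (𝓝 0) :=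
    tendsto_const_nhds.div_atTop hs
  have h4 : Tendsto (fun x : ℝ ↦ 2 * x ^ (-(1 : ℝ) / 6)) atTop (𝓝 0) := by
    have := (tendsto_rpow_neg_atTop (show (0 : ℝ) < 1 / 6 by norm_num)).const_mul 2
    rw [mul_zero] at this
    exact this.congr' (by filter_upwards with x; ring_nf)
  have h5 : Tendsto (fun x : ℝ ↦ Real.log x ^ 4 / (64 * π ^ 2 * Real.sqrt x)) atTop (𝓝 0) := by
    have hlo : Tendsto (fun x : ℝ ↦ Real.log x ^ (4 : ℝ) / x ^ ((1 : ℝ) / 2)) atTop (𝓝 0) :=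
      (isLittleO_log_rpow_rpow_atTop 4 (by norm_num)).tendsto_div_nhds_zero
    have := hlo.div_const (64 * π ^ 2)
    rw [zero_div] at this
    refine this.congr' ?_
    filter_upwards [eventually_ge_atTop (0 : ℝ)] with x hx
    have hL4 : Real.log x ^ (4 : ℝ) = Real.log x ^ 4 := by norm_cast
    rw [hL4, ← Real.sqrt_eq_rpow]
    ring
  have := ((((tendsto_const_nhds (x := nicolasBeta + 2)).sub h1).add h2).add h3).add h4 |>.add h5
  simp only [sub_zero, add_zero] at this
  exact this

/-- `v(x) → 0`. [cite: Nicolas2012, Prop. 2.1] -/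
theorem tendsto_vUp : Tendsto vUp atTop (𝓝 0) := by
  refine (tendsto_uUp.div_atTop tendsto_sqrt_mul_log).congr' ?_
  filter_upwards [eventually_gt_atTop (1 : ℝ)] with x hx
  have hsL0 : Real.sqrt x * Real.log x ≠ 0 :=
    (mul_pos (Real.sqrt_pos.2 (by linarith)) (Real.log_pos hx)).ne'
  rw [← vUp_mul_eq_uUp hx, mul_div_cancel_right₀ _ hsL0]

/-- (2.18) as an upper bound for `−log f(x) · √x log x` by `u(x)` (`x ≥ 599`, under RH).
[cite: Nicolas2012, (2.18)] -/
theorem neg_log_nicolasF_mul_le_uUp (h18 : Nicolas2012_logf_lower_sharp) (hRH : RiemannHypothesis) {x : ℝ}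
    (hx : 599 ≤ x) : -Real.log (nicolasF x) * (Real.sqrt x * Real.log x) ≤ uUp x := by
  have h := neg_vUp_le_log_nicolasF h18 hRH hx
  have hsL : 0 < Real.sqrt x * Real.log x :=
    mul_pos (Real.sqrt_pos.2 (by linarith)) (Real.log_pos (by linarith))
  rw [← vUp_mul_eq_uUp (by linarith : (1 : ℝ) < x)]
  exact mul_le_mul_of_nonneg_right (by linarith) hsL.le

/-- **The upper comparison function**: if `θ(x)/x → 1` and `u → β + 2` then
`e^γ · ratio(x) · u(x) · e^{u(x)/(√x log x)} → e^γ(2+β)`. [cite: Nicolas2012, Prop. 3.1 (3.2)] -/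
theorem tendsto_upperFn_of (hθ : Tendsto (fun x : ℝ ↦ θ x / x) atTop (𝓝 1)) {u : ℝ → ℝ}
    (hu : Tendsto u atTop (𝓝 (nicolasBeta + 2))) :
    Tendsto (fun x : ℝ ↦ rexp Real.eulerMascheroniConstant * ratio x * u x *
      rexp (u x / (Real.sqrt x * Real.log x))) atTop (𝓝 nicolasCLimsup) := by
  have hv : Tendsto (fun x : ℝ ↦ u x / (Real.sqrt x * Real.log x)) atTop (𝓝 0) :=
    hu.div_atTop tendsto_sqrt_mul_log
  have hexp : Tendsto (fun x : ℝ ↦ rexp (u x / (Real.sqrt x * Real.log x))) atTop (𝓝 1) := by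
    have := (Real.continuous_exp.tendsto 0).comp hv
    rw [Real.exp_zero] at this
    exact this
  have h : Tendsto (fun x : ℝ ↦ rexp Real.eulerMascheroniConstant * ratio x * u x *
      rexp (u x / (Real.sqrt x * Real.log x))) atTop
      (𝓝 (rexp Real.eulerMascheroniConstant * 1 * (nicolasBeta + 2) * 1)) :=
    (((tendsto_const_nhds (x := rexp Real.eulerMascheroniConstant)).mul (tendsto_ratio_of hθ)).mul hu).mul hexp
  rw [nicolasCLimsup]
  convert h using 2
  rw [mul_one, mul_one, add_comm]

/-- **Prop. 3.1 (3.2), asymptotic and generic form (PROVED)**: if `θ(x)/x → 1`, `u → β + 2` and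
`−log f(x) · √x log x ≤ u(x)` eventually, then for every `ε > 0`, eventually in `x`,
`c(⌊x⌋#) < e^γ(2+β) + ε`. Road: `1/f − 1 ≤ v e^v` for `v = u/(√x log x) ≥ −log f`, (3.4),
`√θ log θ/(√x log x) → 1`. [cite: Nicolas2012, Prop. 3.1 (3.2)] -/
theorem eventually_nicolasC_primorial_floor_lt_of (hθ : Tendsto (fun x : ℝ ↦ θ x / x) atTop (𝓝 1))
    {u : ℝ → ℝ} (hu : Tendsto u atTop (𝓝 (nicolasBeta + 2)))
    (hup : ∀ᶠ x : ℝ in atTop, -Real.log (nicolasF x) * (Real.sqrt x * Real.log x) ≤ u x)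
    {ε : ℝ} (hε : 0 < ε) :
    ∀ᶠ x : ℝ in atTop, nicolasC (primorial ⌊x⌋₊) < nicolasCLimsup + ε := by
  have hev := (tendsto_upperFn_of hθ hu).eventually_lt_const (lt_add_of_pos_right nicolasCLimsup hε)
  filter_upwards [hev, hup, eventually_ge_atTop (3 : ℝ)] with x hlt hupx hx3
  refine lt_of_le_of_lt ?_ hlt
  have hx0 : 0 < x := by linarith
  have hsx : 0 < Real.sqrt x := Real.sqrt_pos.2 hx0
  have hlx : 0 < Real.log x := Real.log_pos (by linarith)
  have hsL : 0 < Real.sqrt x * Real.log x := mul_pos hsx hlx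
  rw [nicolasC_primorial_floor_eq hx3]
  have hf := nicolasF_pos hx3
  have hv : -(u x / (Real.sqrt x * Real.log x)) ≤ Real.log (nicolasF x) := by
    rw [neg_le, le_div_iff₀ hsL]
    exact hupx
  have h1 := inv_sub_one_le hf hv
  have hθ1 := one_lt_theta hx3
  have hA : 0 ≤ rexp Real.eulerMascheroniConstant * (Real.sqrt (θ x) * Real.log (θ x)) := by
    have : 0 ≤ Real.log (θ x) := Real.log_nonneg hθ1.le
    positivity
  have h2 := mul_le_mul_of_nonneg_left h1 hA
  refine h2.trans (le_of_eq ?_)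
  rw [ratio]
  field_simp

/-- **Prop. 3.1 (3.2), asymptotic form (PROVED under RH, Schoenfeld/(2.18) road)**: for every
`ε > 0`, eventually in `x`, `c(⌊x⌋#) < e^γ(2+β) + ε`. [cite: Nicolas2012, Prop. 3.1 (3.2)] -/
theorem eventually_nicolasC_primorial_floor_lt (hS : Schoenfeld1976_theta) (h18 : Nicolas2012_logf_lower_sharp)
    (hRH : RiemannHypothesis) {ε : ℝ} (hε : 0 < ε) :
    ∀ᶠ x : ℝ in atTop, nicolasC (primorial ⌊x⌋₊) < nicolasCLimsup + ε :=
  eventually_nicolasC_primorial_floor_lt_of (tendsto_theta_div hS hRH) tendsto_uUp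
    (by filter_upwards [eventually_ge_atTop (599 : ℝ)] with x hx; exact neg_log_nicolasF_mul_le_uUp h18 hRH hx) hε

/-- The upper comparison function of the Schoenfeld/(2.18) road,
`e^γ · ratio(x) · u(x) · e^{v(x)} → e^γ(2+β)`. [cite: Nicolas2012, Prop. 3.1 (3.2)] -/
theorem tendsto_upperFn (hS : Schoenfeld1976_theta) (hRH : RiemannHypothesis) :
    Tendsto (fun x : ℝ ↦ rexp Real.eulerMascheroniConstant * ratio x * uUp x * rexp (vUp x))
      atTop (𝓝 nicolasCLimsup) := by
  refine (tendsto_upperFn_of (tendsto_theta_div hS hRH) tendsto_uUp).congr' ?_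
  filter_upwards [eventually_gt_atTop (1 : ℝ)] with x hx
  have hsL0 : Real.sqrt x * Real.log x ≠ 0 :=
    (mul_pos (Real.sqrt_pos.2 (by linarith)) (Real.log_pos hx)).ne'
  rw [← vUp_mul_eq_uUp hx, mul_div_cancel_right₀ _ hsL0]

/-- The lower error `E(x) = e^γ (|ratio(x) − 1| (2 + β + |η₂(x)|) + |η₂(x)|)` of the Schoenfeld
road. [cite: Nicolas2012, Prop. 3.1 (3.3)] -/
def lowerErr (x : ℝ) : ℝ :=
  rexp Real.eulerMascheroniConstant * (|ratio x - 1| * (2 + nicolasBeta + |eta2 x|) + |eta2 x|)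

/-- The lower error for a general (2.19)-error `e`: `E_e(x) = e^γ (|ratio(x) − 1| (2 + β + |e(x)|) + |e(x)|)`.
[cite: Nicolas2012, Prop. 3.1 (3.3)] -/
def lowerErrOf (e : ℝ → ℝ) (x : ℝ) : ℝ :=
  rexp Real.eulerMascheroniConstant * (|ratio x - 1| * (2 + nicolasBeta + |e x|) + |e x|)

/-- `E_e → 0` when `θ(x)/x → 1` and `e → 0`. [folklore] -/
private theorem tendsto_lowerErrOf (hθ : Tendsto (fun x : ℝ ↦ θ x / x) atTop (𝓝 1)) {e : ℝ → ℝ}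
    (he : Tendsto e atTop (𝓝 0)) : Tendsto (lowerErrOf e) atTop (𝓝 0) := by
  have hr : Tendsto (fun x : ℝ ↦ |ratio x - 1|) atTop (𝓝 0) := by
    have := (tendsto_ratio_of hθ).sub (tendsto_const_nhds (x := (1 : ℝ)))
    rw [sub_self] at this
    simpa using this.abs
  have he' : Tendsto (fun x : ℝ ↦ |e x|) atTop (𝓝 0) := by simpa using he.abs
  have h1 : Tendsto (fun x : ℝ ↦ 2 + nicolasBeta + |e x|) atTop (𝓝 (2 + nicolasBeta)) := by
    simpa using (tendsto_const_nhds (x := 2 + nicolasBeta)).add he'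
  have h0 : Tendsto (fun x : ℝ ↦ rexp Real.eulerMascheroniConstant *
      (|ratio x - 1| * (2 + nicolasBeta + |e x|) + |e x|)) atTop (𝓝 0) := by
    simpa using ((hr.mul h1).add he').const_mul (rexp Real.eulerMascheroniConstant)
  exact h0

/-- `η(x) → 0`. [folklore] -/
private theorem tendsto_eta : Tendsto eta atTop (𝓝 0) := by
  have hlo : Tendsto (fun x : ℝ ↦ Real.log x ^ (2 : ℝ) / x ^ ((1 : ℝ) / 4)) atTop (𝓝 0) :=
    (isLittleO_log_rpow_rpow_atTop 2 (by norm_num)).tendsto_div_nhds_zero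
  have := hlo.div_const (32 * π)
  rw [zero_div] at this
  refine this.congr' ?_
  filter_upwards with x
  have hL2 : Real.log x ^ (2 : ℝ) = Real.log x ^ 2 := by norm_cast
  rw [eta, hL2]
  ring

/-- `η₂(x) → 0`. [folklore] -/
private theorem tendsto_eta2 : Tendsto eta2 atTop (𝓝 0) := by
  have hL := Real.tendsto_log_atTop
  have h1 : Tendsto (fun x : ℝ ↦ 2 * eta x) atTop (𝓝 0) := by
    simpa using tendsto_eta.const_mul 2
  have h4L : Tendsto (fun x : ℝ ↦ 4 / Real.log x) atTop (𝓝 0) := tendsto_const_nhds.div_atTop hL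
  have hnum : Tendsto (fun x : ℝ ↦ 2 + nicolasBeta * (1 + 4 / Real.log x)) atTop (𝓝 (2 + nicolasBeta)) := by
    have := (tendsto_const_nhds (x := (2 : ℝ))).add
      ((tendsto_const_nhds (x := nicolasBeta)).mul ((tendsto_const_nhds (x := (1 : ℝ))).add h4L))
    simpa using this
  have h2 : Tendsto (fun x : ℝ ↦ (2 + nicolasBeta * (1 + 4 / Real.log x)) / Real.log x) atTop (𝓝 0) :=
    hnum.div_atTop hL
  have h3 : Tendsto (fun x : ℝ ↦ 4 * Real.log x / Real.sqrt x) atTop (𝓝 0) := by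
    have hlo : Tendsto (fun x : ℝ ↦ Real.log x ^ (1 : ℝ) / x ^ ((1 : ℝ) / 2)) atTop (𝓝 0) :=
      (isLittleO_log_rpow_rpow_atTop 1 (by norm_num)).tendsto_div_nhds_zero
    have := hlo.const_mul 4
    rw [mul_zero] at this
    refine this.congr' ?_
    filter_upwards with x
    rw [Real.rpow_one, ← Real.sqrt_eq_rpow]
    ring
  have h0 : Tendsto (fun x : ℝ ↦ 2 * eta x + (2 + nicolasBeta * (1 + 4 / Real.log x)) / Real.log x
      + 4 * Real.log x / Real.sqrt x) atTop (𝓝 0) := by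
    simpa using (h1.add h2).add h3
  exact h0

/-- `E(x) → 0` (Schoenfeld road). [folklore] -/
private theorem tendsto_lowerErr (hS : Schoenfeld1976_theta) (hRH : RiemannHypothesis) :
    Tendsto lowerErr atTop (𝓝 0) :=
  tendsto_lowerErrOf (tendsto_theta_div hS hRH) tendsto_eta2

/-- **Prop. 3.1 (3.3), pointwise generic form (PROVED under RH)**: for `x ≥ 3`, if
`W(x) + 2 − E ≤ −log f(x) · √x log x` then
`c(⌊x⌋#) ≥ e^γ (2 + W(x)) − e^γ (|ratio(x) − 1| (2 + β + |E|) + |E|)`. Road: (3.4), `1/f − 1 ≥ −log f`,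
`|W| ≤ β`. [cite: Nicolas2012, Prop. 3.1 (3.3)] -/
theorem nicolasC_primorial_floor_ge_of (hRH : RiemannHypothesis) {x E : ℝ} (hx : 3 ≤ x)
    (hW : nicolasW x + 2 - E ≤ -Real.log (nicolasF x) * (Real.sqrt x * Real.log x)) :
    rexp Real.eulerMascheroniConstant * (2 + nicolasW x)
      - rexp Real.eulerMascheroniConstant * (|ratio x - 1| * (2 + nicolasBeta + |E|) + |E|)
      ≤ nicolasC (primorial ⌊x⌋₊) := by
  have hx0 : 0 < x := by linarith
  rw [nicolasC_primorial_floor_eq hx]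
  have hf := nicolasF_pos hx
  have h1 := neg_log_le_inv_sub_one hf
  have hθ1 := one_lt_theta hx
  have hA : 0 ≤ Real.sqrt (θ x) * Real.log (θ x) := by
    have : 0 ≤ Real.log (θ x) := Real.log_nonneg hθ1.le
    positivity
  have hγ := Real.exp_pos Real.eulerMascheroniConstant
  have hsx : 0 < Real.sqrt x := Real.sqrt_pos.2 hx0
  have hlx : 0 < Real.log x := Real.log_pos (by linarith)
  have hr0 := ratio_nonneg hx
  have h2 : ratio x * (nicolasW x + 2 - E) ≤ (Real.sqrt (θ x) * Real.log (θ x)) * (1 / nicolasF x - 1) := by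
    have step1 : ratio x * (nicolasW x + 2 - E) ≤
        ratio x * (-Real.log (nicolasF x) * (Real.sqrt x * Real.log x)) := mul_le_mul_of_nonneg_left hW hr0
    have step2 : ratio x * (-Real.log (nicolasF x) * (Real.sqrt x * Real.log x)) =
        (Real.sqrt (θ x) * Real.log (θ x)) * (-Real.log (nicolasF x)) := by
      rw [ratio]; field_simp
    have step3 : (Real.sqrt (θ x) * Real.log (θ x)) * (-Real.log (nicolasF x)) ≤
        (Real.sqrt (θ x) * Real.log (θ x)) * (1 / nicolasF x - 1) := mul_le_mul_of_nonneg_left h1 hA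
    linarith
  have h3 := mul_le_mul_of_nonneg_left h2 hγ.le
  have h4 : rexp Real.eulerMascheroniConstant * (2 + nicolasW x)
      - rexp Real.eulerMascheroniConstant * (|ratio x - 1| * (2 + nicolasBeta + |E|) + |E|) ≤
      rexp Real.eulerMascheroniConstant * (ratio x * (nicolasW x + 2 - E)) := by
    rw [← mul_sub]
    refine mul_le_mul_of_nonneg_left ?_ hγ.le
    have hWb := abs_nicolasW_le hRH hx0
    have key : |(ratio x - 1) * (nicolasW x + 2 - E)| ≤ |ratio x - 1| * (2 + nicolasBeta + |E|) := by
      rw [abs_mul]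
      refine mul_le_mul_of_nonneg_left ?_ (abs_nonneg _)
      calc |nicolasW x + 2 - E| ≤ |nicolasW x + 2| + |E| := abs_sub _ _
        _ ≤ (2 + nicolasBeta) + |E| := by
            gcongr
            calc |nicolasW x + 2| ≤ |nicolasW x| + |2| := abs_add_le _ _
              _ ≤ nicolasBeta + 2 := by rw [abs_two]; linarith
              _ = 2 + nicolasBeta := add_comm _ _
    have e : ratio x * (nicolasW x + 2 - E) =
        (2 + nicolasW x) + ((ratio x - 1) * (nicolasW x + 2 - E) - E) := by ring
    rw [e]
    have := neg_abs_le ((ratio x - 1) * (nicolasW x + 2 - E))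
    have := le_abs_self E
    linarith
  calc rexp Real.eulerMascheroniConstant * (2 + nicolasW x)
        - rexp Real.eulerMascheroniConstant * (|ratio x - 1| * (2 + nicolasBeta + |E|) + |E|)
      ≤ rexp Real.eulerMascheroniConstant * (ratio x * (nicolasW x + 2 - E)) := h4
    _ ≤ rexp Real.eulerMascheroniConstant * ((Real.sqrt (θ x) * Real.log (θ x)) * (1 / nicolasF x - 1)) := h3
    _ = _ := by ring

/-- **Prop. 3.1 (3.3), asymptotic form (PROVED under RH, Schoenfeld road)**: for `x ≥ 599²`,
`c(⌊x⌋#) ≥ e^γ (2 + W(x)) − E(x)` with `E → 0` (`tendsto_lowerErr`). [cite: Nicolas2012, Prop. 3.1 (3.3)] -/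
theorem nicolasC_primorial_floor_ge (hS : Schoenfeld1976_theta) (hRH : RiemannHypothesis) {x : ℝ}
    (hx : 358801 ≤ x) :
    rexp Real.eulerMascheroniConstant * (2 + nicolasW x) - lowerErr x ≤ nicolasC (primorial ⌊x⌋₊) := by
  have h := nicolasC_primorial_floor_ge_of hRH (by linarith) (neg_log_nicolasF_ge_W hS hRH hx)
  rw [lowerErr]
  exact h

/-! ### §4 `lim sup_{x → ∞} W(x) = β` ("by the pigeonhole principle", Nicolas 2012 §4) -/

/-- Under RH the general term of `W` is `(m(ρ)/|ρ|²) · x^{i Im ρ}`. [cite: Nicolas2012, (1.18)–(1.19)] -/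
theorem term_eq_of_RH (hRH : RiemannHypothesis) (ρ : Zeros) (x : ℝ) :
    (riemannZetaZeroOrder (ρ : ℂ) : ℂ) * phase (ρ : ℂ) x / ((ρ : ℂ) * (1 - ρ)) =
      (((riemannZetaZeroOrder (ρ : ℂ) : ℝ) / ‖(ρ : ℂ)‖ ^ 2 : ℝ) : ℂ) * phase (ρ : ℂ) x := by
  rw [mul_one_sub_eq_norm_sq_of_RH hRH ρ.2]
  have hρ : (‖(ρ : ℂ)‖ ^ 2 : ℝ) ≠ 0 := pow_ne_zero _ (norm_ne_zero_iff.2 (ne_zero ρ.2))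
  have hρC : ((‖(ρ : ℂ)‖ ^ 2 : ℝ) : ℂ) ≠ 0 := by exact_mod_cast hρ
  push_cast
  field_simp

/-- **`lim sup_{x→∞} W(x) = β` under RH, lower half** (the upper half is (1.19)): for every `ε > 0`,
`W(x) > β − ε` for arbitrarily large `x`. Proof (Nicolas: "by the pigeonhole principle, cf. [EMF] or
[HW]"): a finite set `F` of zeros carries all but `ε/3` of `∑_ρ m(ρ)/|ρ|² = β`; by simultaneous
recurrence (`InghamSmoothing.exists_large_almostPeriod`, compactness of the torus) there are
arbitrarily large `τ` with `|e^{iγτ} − 1| < ε/(3β)` for all `ρ = 1/2 + iγ ∈ F`, and at `x = e^τ` the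
finite part of `W` exceeds `∑_F m/|ρ|² − ε/3` while the tail is `≥ −ε/3`.
[cite: Nicolas2012, §4 (proof of (1.4)); BatemanDiamond2004, Lemma 11.1] -/
theorem frequently_lt_nicolasW (hRH : RiemannHypothesis) {ε : ℝ} (hε : 0 < ε) :
    ∃ᶠ x : ℝ in atTop, nicolasBeta - ε < nicolasW x := by
  set a : Zeros → ℝ := fun ρ ↦ (riemannZetaZeroOrder (ρ : ℂ) : ℝ) / ‖(ρ : ℂ)‖ ^ 2 with ha
  have ha0 : ∀ ρ, 0 ≤ a ρ := fun ρ ↦ div_nonneg (zeroOrder_nonneg' ρ) (sq_nonneg _)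
  have hS : HasSum a nicolasBeta := hasSum_zeroOrder_div_norm_sq_of_RH hRH
  have hβ0 : 0 < nicolasBeta := lt_trans (by norm_num) nicolasBeta_gt
  -- a finite set of zeros carrying all but `ε/3` of `β`
  obtain ⟨F, hF⟩ : ∃ F : Finset Zeros, nicolasBeta - ε / 3 < ∑ ρ ∈ F, a ρ :=
    (hS.eventually (lt_mem_nhds (by linarith))).exists
  have hFle : ∑ ρ ∈ F, a ρ ≤ nicolasBeta := sum_zeroOrder_div_norm_sq_le_nicolasBeta hRH F
  have htail : ∑' ρ : ((↑F : Set Zeros)ᶜ : Set Zeros), a ρ < ε / 3 := by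
    have h := hS.summable.sum_add_tsum_compl (s := F)
    rw [hS.tsum_eq] at h
    linarith
  set δ : ℝ := ε / (3 * nicolasBeta) with hδ
  have hδ0 : 0 < δ := by positivity
  rw [frequently_atTop]
  intro B
  obtain ⟨τ, hτL, hclose⟩ := InghamSmoothing.exists_large_almostPeriod F (fun ρ : Zeros ↦ (ρ : ℂ).im)
    hδ0 (show (0 : ℝ) < |Real.log (max B 1)| + 1 by positivity)
  refine ⟨Real.exp τ, ?_, ?_⟩
  · calc B ≤ max B 1 := le_max_left _ _
      _ = Real.exp (Real.log (max B 1)) := (Real.exp_log (by positivity)).symm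
      _ ≤ Real.exp τ := Real.exp_le_exp.2 (le_trans (le_abs_self _) (by linarith))
  set x : ℝ := Real.exp τ with hxdef
  have hx0 : 0 < x := Real.exp_pos τ
  -- the complex series `g ρ = a(ρ) x^{iγ}`
  set g : Zeros → ℂ := fun ρ ↦ ((a ρ : ℝ) : ℂ) * phase (ρ : ℂ) x with hg
  have hnorm : ∀ ρ, ‖g ρ‖ = a ρ := by
    intro ρ
    rw [hg]
    simp only
    rw [norm_mul, norm_phase hx0, mul_one, Complex.norm_real, Real.norm_eq_abs, abs_of_nonneg (ha0 ρ)]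
  have hgs : Summable (fun ρ ↦ ‖g ρ‖) := hS.summable.congr fun ρ ↦ (hnorm ρ).symm
  have hg' : Summable g := hgs.of_norm
  have hW : nicolasW x = (∑' ρ, g ρ).re := by
    rw [nicolasW_def]
    congr 1
    exact tsum_congr fun ρ ↦ term_eq_of_RH hRH ρ x
  rw [hW, ← hg'.sum_add_tsum_compl (s := F), Complex.add_re, Complex.re_sum]
  -- the tail
  have htailC : -(ε / 3) < (∑' ρ : ((↑F : Set Zeros)ᶜ : Set Zeros), g ρ).re := by
    have h1 : ‖∑' ρ : ((↑F : Set Zeros)ᶜ : Set Zeros), g ρ‖ ≤ ∑' ρ : ((↑F : Set Zeros)ᶜ : Set Zeros), ‖g ρ‖ :=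
      norm_tsum_le_tsum_norm (hgs.subtype _)
    have h2 : ∑' ρ : ((↑F : Set Zeros)ᶜ : Set Zeros), ‖g ρ‖ = ∑' ρ : ((↑F : Set Zeros)ᶜ : Set Zeros), a ρ :=
      tsum_congr fun ρ ↦ hnorm ρ
    have h3 := neg_abs_le (∑' ρ : ((↑F : Set Zeros)ᶜ : Set Zeros), g ρ).re
    have h4 := Complex.abs_re_le_norm (∑' ρ : ((↑F : Set Zeros)ᶜ : Set Zeros), g ρ)
    linarith
  -- the finite part at `x = e^τ`
  have hfin : ∑ ρ ∈ F, a ρ - ε / 3 ≤ ∑ ρ ∈ F, (g ρ).re := by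
    have hterm : ∀ ρ ∈ F, a ρ * (1 - δ) ≤ (g ρ).re := by
      intro ρ hρ
      rw [hg]
      simp only
      rw [Complex.re_ofReal_mul]
      refine mul_le_mul_of_nonneg_left ?_ (ha0 ρ)
      have hph : phase (ρ : ℂ) x = cexp ((((ρ : ℂ).im * τ : ℝ) : ℂ) * I) := by
        rw [phase_eq_exp hx0, hxdef, Real.log_exp]
      have hc := hclose ρ hρ
      rw [← hph] at hc
      have h1 := Complex.abs_re_le_norm (phase (ρ : ℂ) x - 1)
      rw [Complex.sub_re, Complex.one_re] at h1
      have := (abs_le.1 (h1.trans hc.le)).1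
      linarith
    calc ∑ ρ ∈ F, a ρ - ε / 3 = ∑ ρ ∈ F, a ρ - δ * nicolasBeta := by rw [hδ]; field_simp
      _ ≤ ∑ ρ ∈ F, a ρ - δ * ∑ ρ ∈ F, a ρ := by nlinarith
      _ = ∑ ρ ∈ F, a ρ * (1 - δ) := by rw [Finset.mul_sum, ← Finset.sum_sub_distrib]; exact Finset.sum_congr rfl fun ρ _ ↦ by ring
      _ ≤ ∑ ρ ∈ F, (g ρ).re := Finset.sum_le_sum hterm
  linarith

/-! ### §5 Lemma 3.1: `c(n) ≤ c(N_k)` for `N_k ≤ n < N_{k+1}` -/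

/-- `∏_{p ∈ S} p/(p − 1)` — the value of `n/φ(n)` on the prime-factor set `S` of `n`.
[cite: Nicolas2012, Lemma 3.1 (proof)] -/
def eulerRatio (S : Finset ℕ) : ℝ := ∏ p ∈ S, (p : ℝ) / ((p : ℝ) - 1)

/-- `n/φ(n) = ∏_{p ∣ n} p/(p−1)` (`n ≠ 0`). [folklore] -/
private theorem div_totient_eq_eulerRatio {n : ℕ} (hn : n ≠ 0) :
    (n : ℝ) / (Nat.totient n : ℝ) = eulerRatio n.primeFactors := by
  have hφ := Nat.totient_eq_mul_prod_factors n
  have hφR : (Nat.totient n : ℝ) = (n : ℝ) * ∏ p ∈ n.primeFactors, (1 - (p : ℝ)⁻¹) := by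
    have := congrArg (Rat.cast : ℚ → ℝ) hφ
    push_cast at this
    exact this
  have hn0 : (n : ℝ) ≠ 0 := by exact_mod_cast hn
  have hprod : ∏ p ∈ n.primeFactors, (1 - (p : ℝ)⁻¹) = (eulerRatio n.primeFactors)⁻¹ := by
    rw [eulerRatio, ← Finset.prod_inv_distrib]
    refine Finset.prod_congr rfl fun p hp ↦ ?_
    have hp2 : (2 : ℝ) ≤ p := by exact_mod_cast (Nat.prime_of_mem_primeFactors hp).two_le
    have hp0 : (p : ℝ) ≠ 0 := by linarith
    rw [inv_div]
    field_simp
  have hE : eulerRatio n.primeFactors ≠ 0 := by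
    rw [eulerRatio]
    refine Finset.prod_ne_zero_iff.2 fun p hp ↦ ?_
    have hp2 : (2 : ℝ) ≤ p := by exact_mod_cast (Nat.prime_of_mem_primeFactors hp).two_le
    exact div_ne_zero (by linarith) (by linarith)
  rw [hφR, hprod]
  field_simp

/-- `P#/φ(P#) = ∏_{p ≤ P} p/(p−1)`. [folklore] -/
private theorem primorial_div_totient_eq (P : ℕ) :
    (primorial P : ℝ) / (Nat.totient (primorial P) : ℝ) = eulerRatio (Nat.primesLE P) := by
  rw [div_totient_eq_eulerRatio (primorial_pos P).ne', primeFactors_primorial]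

/-- Monotonicity of `∏ p/(p−1)` in the set of primes. [folklore] -/
private theorem eulerRatio_mono {S T : Finset ℕ} (hT : ∀ p ∈ T, p.Prime) (hST : S ⊆ T) :
    eulerRatio S ≤ eulerRatio T := by
  classical
  rw [eulerRatio, eulerRatio]
  set g : ℕ → ℝ := fun p ↦ if p ∈ S then (p : ℝ) / ((p : ℝ) - 1) else 1 with hg
  have h1 : ∏ p ∈ S, (p : ℝ) / ((p : ℝ) - 1) = ∏ p ∈ S, g p :=
    Finset.prod_congr rfl fun p hp ↦ by rw [hg]; simp [hp]
  have h2 : ∏ p ∈ S, g p = ∏ p ∈ T, g p :=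
    Finset.prod_subset hST fun p _ hpS ↦ by rw [hg]; simp [hpS]
  rw [h1, h2]
  refine Finset.prod_le_prod (fun p hp ↦ ?_) (fun p hp ↦ ?_)
  · rw [hg]
    simp only
    split_ifs
    · have hp2 : (2 : ℝ) ≤ p := by exact_mod_cast (hT p hp).two_le
      exact div_nonneg (by linarith) (by linarith)
    · exact zero_le_one
  · rw [hg]
    simp only
    split_ifs
    · exact le_rfl
    · have hp2 : (2 : ℝ) ≤ p := by exact_mod_cast (hT p hp).two_le
      rw [le_div_iff₀ (by linarith)]
      linarith

/-- `P ↦ P#/φ(P#)` is non-decreasing. [folklore] -/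
private theorem primorial_div_totient_mono {P Q : ℕ} (h : P ≤ Q) :
    (primorial P : ℝ) / (Nat.totient (primorial P) : ℝ) ≤ (primorial Q : ℝ) / (Nat.totient (primorial Q) : ℝ) := by
  rw [primorial_div_totient_eq, primorial_div_totient_eq]
  exact eulerRatio_mono (fun p hp ↦ Nat.prime_of_mem_primesLE hp)
    (fun p hp ↦ Nat.mem_primesLE.2 ⟨(Nat.le_of_mem_primesLE hp).trans h, Nat.prime_of_mem_primesLE hp⟩)

/-- The exchange step: for primes `p < q` the factor `q/(q−1)` is at most `p/(p−1)`. [cite: Nicolas2012, Lemma 3.1 (proof: `q_i ≥ p_i`)] -/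
theorem div_sub_one_anti {p q : ℕ} (hp : 2 ≤ p) (hpq : p ≤ q) :
    (q : ℝ) / ((q : ℝ) - 1) ≤ (p : ℝ) / ((p : ℝ) - 1) := by
  have hp2 : (2 : ℝ) ≤ p := by exact_mod_cast hp
  have hpq' : (p : ℝ) ≤ q := by exact_mod_cast hpq
  rw [div_le_div_iff₀ (by linarith) (by linarith)]
  nlinarith

/-- **The combinatorial half of Lemma 3.1**: for a finite set `S` of primes there is `P` with
`P# ≤ ∏_{S} p` and `∏_{S} p/(p−1) ≤ P#/φ(P#)` (replace the largest "gap" prime by the missing smaller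
one until `S` is an initial segment of the primes; strong induction on `∏_S p`).
[cite: Nicolas2012, Lemma 3.1 (proof)] -/
theorem exists_primorial_le_prod (N : ℕ) : ∀ S : Finset ℕ, (∀ p ∈ S, p.Prime) → ∏ p ∈ S, p = N →
    ∃ P : ℕ, primorial P ≤ N ∧ eulerRatio S ≤ eulerRatio (Nat.primesLE P) := by
  induction N using Nat.strong_induction_on with
  | _ N ih =>
  intro S hS hN
  by_cases hinit : ∀ p q : ℕ, p.Prime → q ∈ S → p < q → p ∈ S
  · -- `S` is an initial segment of the primes: `S = primesLE (max S)` (or `S = ∅`)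
    rcases S.eq_empty_or_nonempty with hSe | hSne
    · refine ⟨0, ?_, ?_⟩
      · rw [← hN, hSe, Finset.prod_empty]
        decide
      · rw [hSe]
        refine eulerRatio_mono (fun p hp ↦ Nat.prime_of_mem_primesLE hp) (Finset.empty_subset _)
    · set M := S.max' hSne with hM
      have hSeq : S = Nat.primesLE M := by
        ext p
        rw [Nat.mem_primesLE]
        constructor
        · exact fun hp ↦ ⟨S.le_max' p hp, hS p hp⟩
        · rintro ⟨hpM, hp⟩
          rcases hpM.lt_or_eq with hlt | heq
          · exact hinit p M hp (S.max'_mem hSne) hlt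
          · rw [heq]; exact S.max'_mem hSne
      refine ⟨M, ?_, ?_⟩
      · rw [← hN, hSeq, primorial_eq_prod_primesLE]
      · rw [hSeq]
  · push Not at hinit
    obtain ⟨p, q, hp, hqS, hpq, hpS⟩ := hinit
    have hq := hS q hqS
    set S' := insert p (S.erase q) with hS'
    have hpS' : p ∉ S.erase q := fun h ↦ hpS (Finset.mem_of_mem_erase h)
    have hS'prime : ∀ r ∈ S', r.Prime := by
      intro r hr
      rcases Finset.mem_insert.1 hr with h | h
      · rw [h]; exact hp
      · exact hS r (Finset.mem_of_mem_erase h)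
    have hprodS : ∏ r ∈ S, r = q * ∏ r ∈ S.erase q, r := (Finset.mul_prod_erase S id hqS).symm
    have hprodS' : ∏ r ∈ S', r = p * ∏ r ∈ S.erase q, r := Finset.prod_insert hpS'
    have hpos : 0 < ∏ r ∈ S.erase q, r :=
      Finset.prod_pos fun r hr ↦ (hS r (Finset.mem_of_mem_erase hr)).pos
    have hlt : ∏ r ∈ S', r < N := by
      rw [← hN, hprodS, hprodS']
      exact Nat.mul_lt_mul_of_pos_right hpq hpos
    obtain ⟨P, hPN, hPle⟩ := ih _ hlt S' hS'prime rfl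
    refine ⟨P, hPN.trans hlt.le, le_trans ?_ hPle⟩
    -- the exchange: `eulerRatio S ≤ eulerRatio S'`
    have hE : eulerRatio S = (q : ℝ) / ((q : ℝ) - 1) * eulerRatio (S.erase q) := by
      rw [eulerRatio, eulerRatio, ← Finset.mul_prod_erase S _ hqS]
    have hE' : eulerRatio S' = (p : ℝ) / ((p : ℝ) - 1) * eulerRatio (S.erase q) := by
      rw [eulerRatio, eulerRatio, hS', Finset.prod_insert hpS']
    rw [hE, hE']
    have hR0 : 0 ≤ eulerRatio (S.erase q) := by
      rw [eulerRatio]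
      refine Finset.prod_nonneg fun r hr ↦ ?_
      have hr2 : (2 : ℝ) ≤ r := by exact_mod_cast (hS r (Finset.mem_of_mem_erase hr)).two_le
      exact div_nonneg (by linarith) (by linarith)
    exact mul_le_mul_of_nonneg_right (div_sub_one_anti hp.two_le hpq.le) hR0

/-- **Lemma 3.1, the inequality `n/φ(n) ≤ N_k/φ(N_k)` with `N_k ≤ n`**: for `n ≥ 1` there is `P`
with `P# ≤ n` and `n/φ(n) ≤ P#/φ(P#)`. [cite: Nicolas2012, Lemma 3.1 (proof)] -/
theorem exists_primorial_le_div_totient_le {n : ℕ} (hn : n ≠ 0) :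
    ∃ P : ℕ, primorial P ≤ n ∧ (n : ℝ) / (Nat.totient n : ℝ) ≤ (primorial P : ℝ) / (Nat.totient (primorial P) : ℝ) := by
  obtain ⟨P, hP, hle⟩ := exists_primorial_le_prod _ n.primeFactors (fun p hp ↦ Nat.prime_of_mem_primeFactors hp) rfl
  refine ⟨P, hP.trans (Nat.le_of_dvd (Nat.pos_of_ne_zero hn) (Nat.prod_primeFactors_dvd n)), ?_⟩
  rw [div_totient_eq_eulerRatio hn, primorial_div_totient_eq]
  exact hle

/-- **Lemma 3.1, the calculus step**: `u ↦ (A − e^γ log u) √u` is non-increasing on `[u₀, ∞)` when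
`A ≤ e^γ (log u₀ + 2)` (printed via `h'(n) ≤ 0`; here via the convexity of `s ↦ s log s`).
[cite: Nicolas2012, Lemma 3.1 (proof, `dh/dn`)] -/
theorem sub_log_mul_sqrt_le {A u₀ u : ℝ} (hu₀ : 0 < u₀) (hu : u₀ ≤ u)
    (hA : A ≤ rexp Real.eulerMascheroniConstant * (Real.log u₀ + 2)) :
    (A - rexp Real.eulerMascheroniConstant * Real.log u) * Real.sqrt u ≤
      (A - rexp Real.eulerMascheroniConstant * Real.log u₀) * Real.sqrt u₀ := by
  have hu0 : 0 < u := hu₀.trans_le hu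
  set s := Real.sqrt u with hs
  set s₀ := Real.sqrt u₀ with hs₀
  have hs0 : 0 < s := Real.sqrt_pos.2 hu0
  have hs₀0 : 0 < s₀ := Real.sqrt_pos.2 hu₀
  have hss : s₀ ≤ s := Real.sqrt_le_sqrt hu
  have hlu : Real.log u = 2 * Real.log s := by
    rw [hs, Real.sqrt_eq_rpow, Real.log_rpow hu0]; ring
  have hlu₀ : Real.log u₀ = 2 * Real.log s₀ := by
    rw [hs₀, Real.sqrt_eq_rpow, Real.log_rpow hu₀]; ring
  -- convexity: `s log s − s₀ log s₀ ≥ (log s₀ + 1)(s − s₀)`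
  have hconv : (Real.log s₀ + 1) * (s - s₀) ≤ s * Real.log s - s₀ * Real.log s₀ := by
    have h := Real.one_sub_inv_le_log_of_pos (div_pos hs0 hs₀0)
    rw [Real.log_div hs0.ne' hs₀0.ne', inv_div] at h
    have h2 : s - s₀ ≤ s * (Real.log s - Real.log s₀) := by
      have := mul_le_mul_of_nonneg_left h hs0.le
      rwa [mul_sub, mul_one, mul_div_cancel₀ _ hs0.ne'] at this
    nlinarith
  have hγ := Real.exp_pos Real.eulerMascheroniConstant
  rw [hlu, hlu₀]
  rw [hlu₀] at hA
  nlinarith [mul_le_mul_of_nonneg_left hconv hγ.le, mul_nonneg (sub_nonneg.2 hss) (sub_nonneg.2 (sub_nonneg.2 hA))]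

/-- **Nicolas 2012, Lemma 3.1 (PROVED, large-`k` form)**: if `P# ≤ n`, `n/φ(n) ≤ P#/φ(P#)` and
`P#/φ(P#) ≤ e^γ (log log P# + 2)` (Rosser–Schoenfeld's (1.1) in print; supplied below for large `P`
under RH), then `c(n) ≤ c(P#)`. [cite: Nicolas2012, Lemma 3.1 (3.1)] -/
theorem nicolasC_le_of_primorial_le {n P : ℕ} (hP : 2 ≤ P) (hPn : primorial P ≤ n)
    (hφ : (n : ℝ) / (Nat.totient n : ℝ) ≤ (primorial P : ℝ) / (Nat.totient (primorial P) : ℝ))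
    (hA : (primorial P : ℝ) / (Nat.totient (primorial P) : ℝ) ≤
      rexp Real.eulerMascheroniConstant * (Real.log (Real.log (primorial P : ℝ)) + 2)) :
    nicolasC n ≤ nicolasC (primorial P) := by
  have hN2 : (2 : ℝ) ≤ (primorial P : ℝ) := by
    exact_mod_cast le_trans hP le_primorial_self
  have hn2 : (2 : ℝ) ≤ (n : ℝ) := le_trans hN2 (by exact_mod_cast hPn)
  have hu₀ : 0 < Real.log (primorial P : ℝ) := Real.log_pos (by linarith)
  have hu : Real.log (primorial P : ℝ) ≤ Real.log (n : ℝ) :=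
    Real.log_le_log (by linarith) (by exact_mod_cast hPn)
  rw [nicolasC, nicolasC]
  have hsq : 0 ≤ Real.sqrt (Real.log (n : ℝ)) := Real.sqrt_nonneg _
  calc ((n : ℝ) / (Nat.totient n : ℝ) - rexp Real.eulerMascheroniConstant * Real.log (Real.log (n : ℝ))) *
        Real.sqrt (Real.log (n : ℝ))
      ≤ ((primorial P : ℝ) / (Nat.totient (primorial P) : ℝ) -
          rexp Real.eulerMascheroniConstant * Real.log (Real.log (n : ℝ))) * Real.sqrt (Real.log (n : ℝ)) :=
        mul_le_mul_of_nonneg_right (by linarith) hsq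
    _ ≤ _ := sub_log_mul_sqrt_le hu₀ hu hA

/-- `log θ(x)/log x → 1` as soon as `θ(x)/x → 1`. [folklore] -/
private theorem tendsto_log_theta_div_log_of (hθ : Tendsto (fun x : ℝ ↦ θ x / x) atTop (𝓝 1)) :
    Tendsto (fun x : ℝ ↦ Real.log (θ x) / Real.log x) atTop (𝓝 1) := by
  have hlg : Tendsto (fun x : ℝ ↦ Real.log (θ x / x)) atTop (𝓝 0) := by
    have := ((Real.continuousAt_log one_ne_zero).tendsto).comp hθ
    rw [Real.log_one] at this
    exact this
  have hq : Tendsto (fun x : ℝ ↦ Real.log (θ x / x) / Real.log x) atTop (𝓝 0) :=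
    hlg.div_atTop Real.tendsto_log_atTop
  have hl : Tendsto (fun x : ℝ ↦ 1 + Real.log (θ x / x) / Real.log x) atTop (𝓝 1) := by
    simpa using (tendsto_const_nhds (x := (1 : ℝ))).add hq
  refine hl.congr' ?_
  filter_upwards [eventually_ge_atTop (3 : ℝ)] with x hx
  have hx0 : 0 < x := by linarith
  have hθ1 := one_lt_theta hx
  have hlx : Real.log x ≠ 0 := (Real.log_pos (by linarith)).ne'
  rw [Real.log_div (by linarith) hx0.ne']
  field_simp
  ring

/-- Under RH, `log θ(x)/log x → 1` (Schoenfeld road). [cite: Schoenfeld1976, §6] -/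
theorem tendsto_log_theta_div_log (hS : Schoenfeld1976_theta) (hRH : RiemannHypothesis) :
    Tendsto (fun x : ℝ ↦ Real.log (θ x) / Real.log x) atTop (𝓝 1) :=
  tendsto_log_theta_div_log_of (tendsto_theta_div hS hRH)

/-- `⌊x⌋#/φ(⌊x⌋#) = e^γ log θ(x)/f(x)` (`x ≥ 3`). [cite: Nicolas2012, (1.9) and §3] -/
theorem primorial_floor_div_totient_eq {x : ℝ} (hx : 3 ≤ x) :
    (primorial ⌊x⌋₊ : ℝ) / (Nat.totient (primorial ⌊x⌋₊) : ℝ) =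
      rexp Real.eulerMascheroniConstant * Real.log (θ x) / nicolasF x := by
  set m := ⌊x⌋₊ with hm
  have hθ := log_primorial_floor x
  rw [← hm] at hθ
  have hf : nicolasF x = rexp Real.eulerMascheroniConstant * Real.log (θ x) *
      ((Nat.totient (primorial m) : ℝ) / primorial m) := by
    rw [nicolasF_eq_floor, ← hm, nicolasF_natCast_eq, hθ]
  have hN0 : (0 : ℝ) < primorial m := by exact_mod_cast primorial_pos m
  have hφ0 : (0 : ℝ) < Nat.totient (primorial m) := by exact_mod_cast Nat.totient_pos.2 (primorial_pos m)
  have hlog0 : Real.log (θ x) ≠ 0 := (Real.log_pos (one_lt_theta hx)).ne'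
  rw [hf]
  field_simp

/-- **The hypothesis of Lemma 3.1 for large `k`, generic form**: if `θ(x)/x → 1`, `u → β+2` and
`−log f(x)·√x log x ≤ u(x)` eventually, then eventually in `x`, `⌊x⌋#/φ(⌊x⌋#) ≤ e^γ (log log ⌊x⌋# + 2)`
(`1/f ≤ 1 + v e^v`, `v = u/(√x log x)`, and `log θ · v e^v → 0`). [cite: Nicolas2012, Lemma 3.1 with (1.1); Prop. 2.1] -/
theorem eventually_primorial_div_totient_le_of (hθ : Tendsto (fun x : ℝ ↦ θ x / x) atTop (𝓝 1))
    {u : ℝ → ℝ} (hu : Tendsto u atTop (𝓝 (nicolasBeta + 2)))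
    (hup : ∀ᶠ x : ℝ in atTop, -Real.log (nicolasF x) * (Real.sqrt x * Real.log x) ≤ u x) :
    ∀ᶠ x : ℝ in atTop, (primorial ⌊x⌋₊ : ℝ) / (Nat.totient (primorial ⌊x⌋₊) : ℝ) ≤
      rexp Real.eulerMascheroniConstant * (Real.log (Real.log (primorial ⌊x⌋₊ : ℝ)) + 2) := by
  -- `log θ(x) · v(x) e^{v(x)} = (log θ/log x) · (u(x)/√x) · e^{v} → 1 · 0 · 1 = 0`
  have hs : Tendsto Real.sqrt atTop atTop := by
    have := tendsto_rpow_atTop (show (0 : ℝ) < 1 / 2 by norm_num)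
    exact this.congr' (by filter_upwards with x; exact (Real.sqrt_eq_rpow x).symm)
  have h1 := tendsto_log_theta_div_log_of hθ
  have h2 : Tendsto (fun x : ℝ ↦ u x / Real.sqrt x) atTop (𝓝 0) := hu.div_atTop hs
  have hv : Tendsto (fun x : ℝ ↦ u x / (Real.sqrt x * Real.log x)) atTop (𝓝 0) :=
    hu.div_atTop tendsto_sqrt_mul_log
  have h3 : Tendsto (fun x : ℝ ↦ rexp (u x / (Real.sqrt x * Real.log x))) atTop (𝓝 1) := by
    have := (Real.continuous_exp.tendsto 0).comp hv
    rw [Real.exp_zero] at this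
    exact this
  have h := (h1.mul h2).mul h3
  rw [one_mul, zero_mul] at h
  have hev := h.eventually_lt_const (show (0 : ℝ) < 2 by norm_num)
  filter_upwards [hev, hup, eventually_ge_atTop (3 : ℝ)] with x hlt hupx hx3
  have hx1 : (1 : ℝ) < x := by linarith
  have hx0 : 0 < x := by linarith
  have hθ1 := one_lt_theta hx3
  have hlθ : 0 < Real.log (θ x) := Real.log_pos hθ1
  have hf := nicolasF_pos hx3
  have hγ := Real.exp_pos Real.eulerMascheroniConstant
  have hsx : 0 < Real.sqrt x := Real.sqrt_pos.2 hx0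
  have hlx : 0 < Real.log x := Real.log_pos hx1
  have hsL : 0 < Real.sqrt x * Real.log x := mul_pos hsx hlx
  set v : ℝ := u x / (Real.sqrt x * Real.log x) with hvdef
  rw [primorial_floor_div_totient_eq hx3, log_primorial_floor]
  have hvle : -v ≤ Real.log (nicolasF x) := by
    rw [hvdef, neg_le, le_div_iff₀ hsL]
    exact hupx
  have hinv : 1 / nicolasF x ≤ 1 + v * rexp v := by
    linarith [inv_sub_one_le hf hvle]
  -- `log θ · v e^v < 2`
  have hkey : Real.log (θ x) * (v * rexp v) < 2 := by
    have e : Real.log (θ x) / Real.log x * (u x / Real.sqrt x) * rexp v =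
        Real.log (θ x) * (v * rexp v) := by
      rw [hvdef]; field_simp
    rw [← e]; exact hlt
  calc rexp Real.eulerMascheroniConstant * Real.log (θ x) / nicolasF x
      = rexp Real.eulerMascheroniConstant * Real.log (θ x) * (1 / nicolasF x) := by rw [mul_one_div]
    _ ≤ rexp Real.eulerMascheroniConstant * Real.log (θ x) * (1 + v * rexp v) :=
        mul_le_mul_of_nonneg_left hinv (by positivity)
    _ = rexp Real.eulerMascheroniConstant * (Real.log (θ x) + Real.log (θ x) * (v * rexp v)) := by ring
    _ ≤ rexp Real.eulerMascheroniConstant * (Real.log (θ x) + 2) := by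
        refine mul_le_mul_of_nonneg_left ?_ hγ.le
        linarith

/-- **The hypothesis of Lemma 3.1 for large `k` under RH (Schoenfeld/(2.18) road)**: eventually in `x`,
`⌊x⌋#/φ(⌊x⌋#) ≤ e^γ (log log ⌊x⌋# + 2)`. [cite: Nicolas2012, Lemma 3.1 with (1.1); Prop. 2.1] -/
theorem eventually_primorial_div_totient_le (hS : Schoenfeld1976_theta) (h18 : Nicolas2012_logf_lower_sharp)
    (hRH : RiemannHypothesis) :
    ∀ᶠ x : ℝ in atTop, (primorial ⌊x⌋₊ : ℝ) / (Nat.totient (primorial ⌊x⌋₊) : ℝ) ≤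
      rexp Real.eulerMascheroniConstant * (Real.log (Real.log (primorial ⌊x⌋₊ : ℝ)) + 2) :=
  eventually_primorial_div_totient_le_of (tendsto_theta_div hS hRH) tendsto_uUp
    (by filter_upwards [eventually_ge_atTop (599 : ℝ)] with x hx; exact neg_log_nicolasF_mul_le_uUp h18 hRH hx)

/-! ### §6 Assembly: Thm. 1.1 (1.4) under RH from the three asymptotic inputs -/

/-- `e^γ(2+β) > 0`. [folklore] -/
private theorem nicolasCLimsup_pos : 0 < nicolasCLimsup := by
  rw [nicolasCLimsup]
  have := nicolasBeta_gt
  have : 0 < 2 + nicolasBeta := by linarith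
  positivity

/-- `⌊x⌋# → ∞`. [folklore] -/
private theorem tendsto_primorial_floor : Tendsto (fun x : ℝ ↦ primorial ⌊x⌋₊) atTop atTop :=
  tendsto_atTop_mono (fun _ ↦ le_primorial_self) tendsto_nat_floor_atTop

/-- **Thm. 1.1 (1.4), upper half, generic form (PROVED)**: if `θ(x)/x → 1`, `u → β + 2` and
`−log f(x)·√x log x ≤ u(x)` eventually, then for every `ε > 0`, `c(n) < e^γ(2+β) + ε` for all large
`n` (Lemma 3.1 + Prop. 3.1 (3.2); the integers `n` whose `N_k` is small have `c(n) ≤ 0`).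
[cite: Nicolas2012, Thm. 1.1 (1.4), §4] -/
theorem eventually_nicolasC_lt_of (hθ : Tendsto (fun x : ℝ ↦ θ x / x) atTop (𝓝 1))
    {u : ℝ → ℝ} (hu : Tendsto u atTop (𝓝 (nicolasBeta + 2)))
    (hup : ∀ᶠ x : ℝ in atTop, -Real.log (nicolasF x) * (Real.sqrt x * Real.log x) ≤ u x)
    {ε : ℝ} (hε : 0 < ε) :
    ∀ᶠ n : ℕ in atTop, nicolasC n < nicolasCLimsup + ε := by
  obtain ⟨X₁, hX₁⟩ := eventually_atTop.1 (eventually_nicolasC_primorial_floor_lt_of hθ hu hup hε)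
  obtain ⟨X₂, hX₂⟩ := eventually_atTop.1 (eventually_primorial_div_totient_le_of hθ hu hup)
  set X : ℕ := max (max ⌈X₁⌉₊ ⌈X₂⌉₊) 3 with hX
  have hγ := Real.exp_pos Real.eulerMascheroniConstant
  have hP : ∀ P : ℕ, X ≤ P → nicolasC (primorial P) < nicolasCLimsup + ε ∧
      (primorial P : ℝ) / (Nat.totient (primorial P) : ℝ) ≤
        rexp Real.eulerMascheroniConstant * (Real.log (Real.log (primorial P : ℝ)) + 2) := by
    intro P hP
    have hP1 : X₁ ≤ (P : ℝ) := (Nat.le_ceil X₁).trans (by exact_mod_cast (le_max_left _ _).trans ((le_max_left _ _).trans hP))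
    have hP2 : X₂ ≤ (P : ℝ) := (Nat.le_ceil X₂).trans (by exact_mod_cast (le_max_right _ _).trans ((le_max_left _ _).trans hP))
    have h1 := hX₁ P hP1
    have h2 := hX₂ P hP2
    rw [Nat.floor_natCast] at h1 h2
    exact ⟨h1, h2⟩
  set A₀ : ℝ := (primorial X : ℝ) / (Nat.totient (primorial X) : ℝ) with hA₀
  set N₀ : ℕ := ⌈Real.exp (Real.exp (A₀ / rexp Real.eulerMascheroniConstant))⌉₊ with hN₀
  refine eventually_atTop.2 ⟨max N₀ 2, fun n hn ↦ ?_⟩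
  have hn2 : 2 ≤ n := (le_max_right _ _).trans hn
  have hnN : N₀ ≤ n := (le_max_left _ _).trans hn
  have hn0 : n ≠ 0 := by omega
  obtain ⟨P, hPn, hφ⟩ := exists_primorial_le_div_totient_le hn0
  by_cases hPX : X ≤ P
  · obtain ⟨hc, hA⟩ := hP P hPX
    have hP2 : 2 ≤ P := le_trans (by rw [hX]; exact le_trans (by norm_num) (le_max_right _ _)) hPX
    exact (nicolasC_le_of_primorial_le hP2 hPn hφ hA).trans_lt hc
  · have hPX' : P ≤ X := (not_le.1 hPX).le
    have hA₀n : (n : ℝ) / (Nat.totient n : ℝ) ≤ A₀ := hφ.trans (primorial_div_totient_mono hPX')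
    have hn2R : (2 : ℝ) ≤ n := by exact_mod_cast hn2
    have hlog : A₀ ≤ rexp Real.eulerMascheroniConstant * Real.log (Real.log (n : ℝ)) := by
      have h1 : Real.exp (Real.exp (A₀ / rexp Real.eulerMascheroniConstant)) ≤ n :=
        (Nat.le_ceil _).trans (by exact_mod_cast hnN)
      have h2 : Real.exp (A₀ / rexp Real.eulerMascheroniConstant) ≤ Real.log (n : ℝ) :=
        (Real.le_log_iff_exp_le (by linarith)).2 h1
      have h3 : A₀ / rexp Real.eulerMascheroniConstant ≤ Real.log (Real.log (n : ℝ)) :=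
        (Real.le_log_iff_exp_le (lt_of_lt_of_le (Real.exp_pos _) h2)).2 h2
      rwa [div_le_iff₀ hγ, mul_comm] at h3
    have hc : nicolasC n ≤ 0 := by
      rw [nicolasC]
      exact mul_nonpos_of_nonpos_of_nonneg (by linarith) (Real.sqrt_nonneg _)
    linarith [nicolasCLimsup_pos]

/-- **Thm. 1.1 (1.4), lower half, generic form (PROVED under RH)**: if `θ(x)/x → 1`, `e → 0` and
`W(x) + 2 − e(x) ≤ −log f(x)·√x log x` eventually, then for every `ε > 0`, `c(n) > e^γ(2+β) − ε`
for infinitely many `n` (namely `n = N_k` with `W(p_k) > β − ε/(2e^γ)`: Prop. 3.1 (3.3) and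
`lim sup W = β`). [cite: Nicolas2012, Thm. 1.1 (1.4), §4] -/
theorem frequently_lt_nicolasC_floor_of (hRH : RiemannHypothesis) (hθ : Tendsto (fun x : ℝ ↦ θ x / x) atTop (𝓝 1))
    {e : ℝ → ℝ} (he : Tendsto e atTop (𝓝 0))
    (hlow : ∀ᶠ x : ℝ in atTop, nicolasW x + 2 - e x ≤ -Real.log (nicolasF x) * (Real.sqrt x * Real.log x))
    {ε : ℝ} (hε : 0 < ε) :
    ∃ᶠ x : ℝ in atTop, nicolasCLimsup - ε < nicolasC (primorial ⌊x⌋₊) := by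
  have hγ := Real.exp_pos Real.eulerMascheroniConstant
  have h1 : ∀ᶠ x : ℝ in atTop, lowerErrOf e x < ε / 2 :=
    (tendsto_lowerErrOf hθ he).eventually_lt_const (by linarith)
  have h2 : ∃ᶠ x : ℝ in atTop, nicolasBeta - ε / (2 * rexp Real.eulerMascheroniConstant) < nicolasW x :=
    frequently_lt_nicolasW hRH (by positivity)
  have h3 : ∃ᶠ x : ℝ in atTop, nicolasCLimsup - ε < nicolasC (primorial ⌊x⌋₊) := by
    refine (h2.and_eventually ((h1.and hlow).and (eventually_ge_atTop (3 : ℝ)))).mono ?_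
    rintro x ⟨hW, ⟨hE, hlowx⟩, hx⟩
    have h := nicolasC_primorial_floor_ge_of hRH hx hlowx
    rw [lowerErrOf] at hE
    rw [nicolasCLimsup]
    have hW' : rexp Real.eulerMascheroniConstant * (nicolasBeta - nicolasW x) < ε / 2 := by
      have := mul_lt_mul_of_pos_left hW hγ
      have e : rexp Real.eulerMascheroniConstant * (nicolasBeta - ε / (2 * rexp Real.eulerMascheroniConstant)) =
          rexp Real.eulerMascheroniConstant * nicolasBeta - ε / 2 := by
        field_simp
      linarith
    nlinarith
  exact h3

/-- **Thm. 1.1 (1.4), lower half, generic form (PROVED under RH)** over the integers `n`.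
[cite: Nicolas2012, Thm. 1.1 (1.4), §4] -/
theorem frequently_lt_nicolasC_of (hRH : RiemannHypothesis) (hθ : Tendsto (fun x : ℝ ↦ θ x / x) atTop (𝓝 1))
    {e : ℝ → ℝ} (he : Tendsto e atTop (𝓝 0))
    (hlow : ∀ᶠ x : ℝ in atTop, nicolasW x + 2 - e x ≤ -Real.log (nicolasF x) * (Real.sqrt x * Real.log x))
    {ε : ℝ} (hε : 0 < ε) :
    ∃ᶠ n : ℕ in atTop, nicolasCLimsup - ε < nicolasC n :=
  tendsto_primorial_floor.frequently (frequently_lt_nicolasC_floor_of hRH hθ he hlow hε)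

/-- **Thm. 1.1 (1.4), upper half (Schoenfeld/(2.18) road)**. [cite: Nicolas2012, Thm. 1.1 (1.4), §4] -/
theorem eventually_nicolasC_lt (hS : Schoenfeld1976_theta) (h18 : Nicolas2012_logf_lower_sharp)
    (hRH : RiemannHypothesis) {ε : ℝ} (hε : 0 < ε) :
    ∀ᶠ n : ℕ in atTop, nicolasC n < nicolasCLimsup + ε :=
  eventually_nicolasC_lt_of (tendsto_theta_div hS hRH) tendsto_uUp
    (by filter_upwards [eventually_ge_atTop (599 : ℝ)] with x hx; exact neg_log_nicolasF_mul_le_uUp h18 hRH hx) hε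

/-- **Thm. 1.1 (1.4), lower half (Schoenfeld road)**. [cite: Nicolas2012, Thm. 1.1 (1.4), §4] -/
theorem frequently_lt_nicolasC (hS : Schoenfeld1976_theta) (hRH : RiemannHypothesis) {ε : ℝ} (hε : 0 < ε) :
    ∃ᶠ n : ℕ in atTop, nicolasCLimsup - ε < nicolasC n :=
  frequently_lt_nicolasC_of hRH (tendsto_theta_div hS hRH) tendsto_eta2
    (by filter_upwards [eventually_ge_atTop (358801 : ℝ)] with x hx; exact neg_log_nicolasF_ge_W hS hRH hx) hε

/-! ### §7 The standard-axiom road: von Koch's `θ(x) = x + O(√x log² x)` under RH replaces (1.12) and (2.18) -/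

/-- Under RH, `θ(x)/x → 1`, from von Koch's `θ(x) = x + O(√x log² x)` (the tree's
`LiThetaRH.exists_abs_theta_sub_le_of_RH`, standard axioms). [cite: Nicolas2012, (1.12) (qualitative)] -/
theorem tendsto_theta_div_of_RH (hRH : RiemannHypothesis) : Tendsto (fun x : ℝ ↦ θ x / x) atTop (𝓝 1) := by
  obtain ⟨K, X, hK, hX, h⟩ := LiThetaRH.exists_abs_theta_sub_le_of_RH hRH
  have hlo : Tendsto (fun x : ℝ ↦ Real.log x ^ (2 : ℝ) / x ^ ((1 : ℝ) / 2)) atTop (𝓝 0) :=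
    (isLittleO_log_rpow_rpow_atTop 2 (by norm_num)).tendsto_div_nhds_zero
  have hb : Tendsto (fun x : ℝ ↦ K * (Real.log x ^ (2 : ℝ) / x ^ ((1 : ℝ) / 2))) atTop (𝓝 0) := by
    simpa using hlo.const_mul K
  have h0 : Tendsto (fun x : ℝ ↦ 1 - K * (Real.log x ^ (2 : ℝ) / x ^ ((1 : ℝ) / 2))) atTop (𝓝 1) := by
    simpa using (tendsto_const_nhds (x := (1 : ℝ))).sub hb
  have h1 : Tendsto (fun x : ℝ ↦ 1 + K * (Real.log x ^ (2 : ℝ) / x ^ ((1 : ℝ) / 2))) atTop (𝓝 1) := by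
    simpa using (tendsto_const_nhds (x := (1 : ℝ))).add hb
  refine tendsto_of_tendsto_of_tendsto_of_le_of_le' h0 h1 ?_ ?_
  all_goals filter_upwards [eventually_ge_atTop X] with x hx
  all_goals
    have hx0 : 0 < x := by linarith
    have hS := abs_le.1 (h x hx)
    have hs : Real.sqrt x = x ^ ((1 : ℝ) / 2) := Real.sqrt_eq_rpow x
    have hsx : 0 < Real.sqrt x := Real.sqrt_pos.2 hx0
    have hxs : x = Real.sqrt x * Real.sqrt x := (Real.mul_self_sqrt hx0.le).symm
    have hL2 : Real.log x ^ (2 : ℝ) = Real.log x ^ 2 := by norm_cast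
    have e : K * (Real.log x ^ (2 : ℝ) / x ^ ((1 : ℝ) / 2)) = K * Real.sqrt x * Real.log x ^ 2 / x := by
      rw [← hs, hL2]; field_simp; nlinarith [hxs]
    rw [e]
  · rw [le_div_iff₀ hx0, sub_mul, one_mul, div_mul_cancel₀ _ hx0.ne']
    linarith [hS.1]
  · rw [div_le_iff₀ hx0, add_mul, one_mul, div_mul_cancel₀ _ hx0.ne']
    linarith [hS.2]

/-- Under RH, eventually `θ(x) ≥ 4x/5` (Nicolas's standing input (1.14), here from `θ(x)/x → 1`).
[cite: Nicolas2012, (1.14)] -/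
theorem eventually_theta_ge_four_fifths (hRH : RiemannHypothesis) : ∀ᶠ x : ℝ in atTop, 4 / 5 * x ≤ θ x := by
  have h := (tendsto_theta_div_of_RH hRH).eventually_const_lt (show (4 : ℝ) / 5 < 1 by norm_num)
  filter_upwards [h, eventually_gt_atTop (0 : ℝ)] with x hx hx0
  rw [lt_div_iff₀ hx0] at hx
  exact hx.le

/-- The von Koch relative error at `√t`: `η_K(x) = K log² x/(4 x^{1/4})`. [cite: Nicolas2012, (2.9)] -/
def etaK (K x : ℝ) : ℝ := K * Real.log x ^ 2 / (4 * x ^ ((1 : ℝ) / 4))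

/-- `η_K ≥ 0`. [folklore] -/
private theorem etaK_nonneg {K x : ℝ} (hK : 0 ≤ K) (hx : 0 < x) : 0 ≤ etaK K x := by
  unfold etaK; positivity

/-- `η_K` is non-increasing on `[e⁸, ∞)`. [folklore] -/
private theorem etaK_anti {K x t : ℝ} (hK : 0 ≤ K) (hx : 358801 ≤ x) (hxt : x ≤ t) : etaK K t ≤ etaK K x := by
  have hx0 : 0 < x := by linarith
  have ht0 : 0 < t := by linarith
  have hmono := log_pow_div_rpow_le (a := (1 : ℝ) / 4) (k := 2) (by norm_num) (by norm_num) hx0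
    (by have := twelve_le_log hx; norm_num; linarith) hxt
  have e : ∀ u : ℝ, 0 < u → etaK K u = K / 4 * (Real.log u ^ 2 / u ^ ((1 : ℝ) / 4)) := by
    intro u hu
    have : 0 < u ^ ((1 : ℝ) / 4) := Real.rpow_pos_of_pos hu _
    rw [etaK]; field_simp
  rw [e t ht0, e x hx0]
  exact mul_le_mul_of_nonneg_left hmono (by positivity)

/-- `η_K → 0`. [folklore] -/
private theorem tendsto_etaK (K : ℝ) : Tendsto (etaK K) atTop (𝓝 0) := by
  have hlo : Tendsto (fun x : ℝ ↦ Real.log x ^ (2 : ℝ) / x ^ ((1 : ℝ) / 4)) atTop (𝓝 0) :=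
    (isLittleO_log_rpow_rpow_atTop 2 (by norm_num)).tendsto_div_nhds_zero
  have := hlo.const_mul (K / 4)
  rw [mul_zero] at this
  refine this.congr' ?_
  filter_upwards [eventually_gt_atTop (0 : ℝ)] with x hx
  have hL2 : Real.log x ^ (2 : ℝ) = Real.log x ^ 2 := by norm_cast
  have : 0 < x ^ ((1 : ℝ) / 4) := Real.rpow_pos_of_pos hx _
  rw [etaK, hL2]
  field_simp

/-- `√(√t) = t^{1/4}`, `log √t = log t/2`, and the von Koch error at `√t` in units of `√t`. [folklore] -/
private theorem vonKoch_sqrt_eq {K t : ℝ} (ht : 0 < t) :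
    K * Real.sqrt (Real.sqrt t) * Real.log (Real.sqrt t) ^ 2 = etaK K t * Real.sqrt t := by
  have hq : Real.sqrt (Real.sqrt t) = t ^ ((1 : ℝ) / 4) := by
    rw [Real.sqrt_eq_rpow, Real.sqrt_eq_rpow, ← Real.rpow_mul ht.le]; norm_num
  have hls : Real.log (Real.sqrt t) = Real.log t / 2 := by
    rw [Real.sqrt_eq_rpow, Real.log_rpow ht]; ring
  have h4 : t ^ ((1 : ℝ) / 4) * t ^ ((1 : ℝ) / 4) = Real.sqrt t := by
    rw [← Real.rpow_add ht, Real.sqrt_eq_rpow]; norm_num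
  have hq0 : 0 < t ^ ((1 : ℝ) / 4) := Real.rpow_pos_of_pos ht _
  rw [hq, hls, etaK, ← h4]
  field_simp
  ring

/-- `θ(√t) ≤ ψ(t) − θ(t)` (`t ≥ 4`): `ψ − θ = ∑_{k ≥ 2} θ(t^{1/k})`. [cite: Nicolas2012, Lemma 2.4 (2.9)] -/
private theorem theta_sqrt_le_psi_sub_theta {t : ℝ} (ht : 4 ≤ t) : θ (Real.sqrt t) ≤ ψ t - θ t := by
  have ht2 : (2 : ℝ) ≤ t := by linarith
  rw [Chebyshev.psi_eq_theta_add_sum_theta ht2, add_sub_cancel_left]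
  have hK : 2 ∈ Finset.Icc 2 ⌊Real.log t / Real.log 2⌋₊ := by
    rw [Finset.mem_Icc]
    refine ⟨le_rfl, Nat.le_floor ?_⟩
    rw [Nat.cast_ofNat, le_div_iff₀ (Real.log_pos one_lt_two)]
    calc (2 : ℝ) * Real.log 2 = Real.log (2 ^ 2) := by rw [Real.log_pow]; norm_num
      _ ≤ Real.log t := Real.log_le_log (by norm_num) (by norm_num; linarith)
  have hle : θ (t ^ ((1 : ℝ) / 2)) ≤ ∑ n ∈ Finset.Icc 2 ⌊Real.log t / Real.log 2⌋₊, θ (t ^ ((1 : ℝ) / n)) := by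
    refine Finset.single_le_sum (f := fun n : ℕ ↦ θ (t ^ ((1 : ℝ) / n))) (fun n _ ↦ Chebyshev.theta_nonneg _) hK
      |>.trans_eq' ?_
    norm_num
  rw [Real.sqrt_eq_rpow]
  exact hle

/-- **Pointwise lower bound under RH via von Koch**: there are `K > 0`, `X₁` with
`ψ(t) − θ(t) ≥ (1 − η_K(x)) √t` for `t ≥ x ≥ X₁` (`ψ − θ ≥ θ(√t) ≥ √t − K t^{1/4} log² √t`).
[cite: Nicolas2012, Lemma 2.4 (2.9)] -/
theorem psi_sub_theta_ge_of_RH (hRH : RiemannHypothesis) : ∃ K X₁ : ℝ, 0 < K ∧ 358801 ≤ X₁ ∧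
    ∀ x t : ℝ, X₁ ≤ x → x ≤ t → (1 - etaK K x) * Real.sqrt t ≤ ψ t - θ t := by
  obtain ⟨K, X, hK, hX, h⟩ := LiThetaRH.exists_abs_theta_sub_le_of_RH hRH
  refine ⟨K, max 358801 (X ^ 2), hK, le_max_left _ _, fun x t hx hxt ↦ ?_⟩
  have hx1 : 358801 ≤ x := (le_max_left _ _).trans hx
  have hX2 : X ^ 2 ≤ t := ((le_max_right _ _).trans hx).trans hxt
  have ht0 : 0 < t := by linarith
  have hsq : X ≤ Real.sqrt t := by
    rw [show X = Real.sqrt (X ^ 2) from (Real.sqrt_sq (by linarith)).symm]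
    exact Real.sqrt_le_sqrt hX2
  have hS := (abs_le.1 (h (Real.sqrt t) hsq)).1
  have hT := vonKoch_sqrt_eq (K := K) ht0
  have hηle := etaK_anti hK.le hx1 hxt
  have hψθ := theta_sqrt_le_psi_sub_theta (show (4 : ℝ) ≤ t by linarith)
  have hst0 : 0 < Real.sqrt t := Real.sqrt_pos.2 ht0
  have : (1 - etaK K x) * Real.sqrt t ≤ (1 - etaK K t) * Real.sqrt t :=
    mul_le_mul_of_nonneg_right (by linarith) hst0.le
  nlinarith [hS, hT, hψθ, this]

/-- The (2.19)-error of the von Koch road: `2η_K(x) + (2 + β(1 + 4/log x))/log x + 4 log x/√x`.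
[cite: Nicolas2012, (2.19)] -/
def eta2K (K x : ℝ) : ℝ :=
  2 * etaK K x + (2 + nicolasBeta * (1 + 4 / Real.log x)) / Real.log x + 4 * Real.log x / Real.sqrt x

/-- `η₂,K → 0`. [folklore] -/
private theorem tendsto_eta2K (K : ℝ) : Tendsto (eta2K K) atTop (𝓝 0) := by
  have hL := Real.tendsto_log_atTop
  have h1 : Tendsto (fun x : ℝ ↦ 2 * etaK K x) atTop (𝓝 0) := by
    simpa using (tendsto_etaK K).const_mul 2
  have h4L : Tendsto (fun x : ℝ ↦ 4 / Real.log x) atTop (𝓝 0) := tendsto_const_nhds.div_atTop hL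
  have hnum : Tendsto (fun x : ℝ ↦ 2 + nicolasBeta * (1 + 4 / Real.log x)) atTop (𝓝 (2 + nicolasBeta)) := by
    have := (tendsto_const_nhds (x := (2 : ℝ))).add
      ((tendsto_const_nhds (x := nicolasBeta)).mul ((tendsto_const_nhds (x := (1 : ℝ))).add h4L))
    simpa using this
  have h2 : Tendsto (fun x : ℝ ↦ (2 + nicolasBeta * (1 + 4 / Real.log x)) / Real.log x) atTop (𝓝 0) :=
    hnum.div_atTop hL
  have h3 : Tendsto (fun x : ℝ ↦ 4 * Real.log x / Real.sqrt x) atTop (𝓝 0) := by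
    have hlo : Tendsto (fun x : ℝ ↦ Real.log x ^ (1 : ℝ) / x ^ ((1 : ℝ) / 2)) atTop (𝓝 0) :=
      (isLittleO_log_rpow_rpow_atTop 1 (by norm_num)).tendsto_div_nhds_zero
    have := hlo.const_mul 4
    rw [mul_zero] at this
    refine this.congr' ?_
    filter_upwards with x
    rw [Real.rpow_one, ← Real.sqrt_eq_rpow]
    ring
  have h0 : Tendsto (fun x : ℝ ↦ 2 * etaK K x + (2 + nicolasBeta * (1 + 4 / Real.log x)) / Real.log x
      + 4 * Real.log x / Real.sqrt x) atTop (𝓝 0) := by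
    simpa using (h1.add h2).add h3
  exact h0

/-- **The lower asymptotic input under RH with standard axioms**: there is `e → 0` with
`W(x) + 2 − e(x) ≤ −log f(x) · √x log x` eventually ((2.19) in `W`-form, von Koch road).
[cite: Nicolas2012, Prop. 2.1 (2.19)] -/
theorem lowRoad_of_RH (hRH : RiemannHypothesis) : ∃ e : ℝ → ℝ, Tendsto e atTop (𝓝 0) ∧
    ∀ᶠ x : ℝ in atTop, nicolasW x + 2 - e x ≤ -Real.log (nicolasF x) * (Real.sqrt x * Real.log x) := by
  obtain ⟨K, X₁, hK, hX₁, h⟩ := psi_sub_theta_ge_of_RH hRH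
  refine ⟨eta2K K, tendsto_eta2K K, ?_⟩
  have hev : ∀ᶠ x : ℝ in atTop, etaK K x < 1 := (tendsto_etaK K).eventually_lt_const one_pos
  filter_upwards [hev, eventually_ge_atTop X₁] with x hη1 hx
  have hx' : 358801 ≤ x := hX₁.trans hx
  have hJK := jk_ge_of_pointwise hRH (by linarith) fun t ht ↦ h x t hx ht
  have h2 := neg_log_nicolasF_ge_W_of hRH hx' (by linarith)
    (by linarith [etaK_nonneg hK.le (by linarith : (0 : ℝ) < x)]) hJK
  have e : 2 * (1 - (1 - etaK K x)) = 2 * etaK K x := by ring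
  rw [e] at h2
  rw [eta2K]
  exact h2

/-- The relative excess of `ψ − θ` over `√t` on the von Koch road:
`η⁺_K(x) = η_K(x) + log x/x^{1/4} + 14 x^{−1/6}`. [cite: Nicolas2012, Lemma 2.4 (2.12) (qualitative)] -/
def etaUp (K x : ℝ) : ℝ := etaK K x + Real.log x / x ^ ((1 : ℝ) / 4) + 14 * x ^ (-(1 : ℝ) / 6)

/-- `η⁺_K ≥ 0` (`x ≥ 1`). [folklore] -/
private theorem etaUp_nonneg {K x : ℝ} (hK : 0 ≤ K) (hx : 1 ≤ x) : 0 ≤ etaUp K x := by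
  have := etaK_nonneg hK (by linarith : (0 : ℝ) < x)
  have : 0 ≤ Real.log x := Real.log_nonneg hx
  unfold etaUp; positivity

/-- `η⁺_K` is non-increasing on `[e⁸, ∞)`. [folklore] -/
private theorem etaUp_anti {K x t : ℝ} (hK : 0 ≤ K) (hx : 358801 ≤ x) (hxt : x ≤ t) : etaUp K t ≤ etaUp K x := by
  have hx0 : 0 < x := by linarith
  have ht0 : 0 < t := by linarith
  have h1 := etaK_anti hK hx hxt
  have h2 : Real.log t / t ^ ((1 : ℝ) / 4) ≤ Real.log x / x ^ ((1 : ℝ) / 4) := by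
    have := log_pow_div_rpow_le (a := (1 : ℝ) / 4) (k := 1) (by norm_num) (by norm_num) hx0
      (by have := twelve_le_log hx; norm_num; linarith) hxt
    simpa using this
  have h3 : t ^ (-(1 : ℝ) / 6) ≤ x ^ (-(1 : ℝ) / 6) := by
    rw [show (-(1 : ℝ) / 6) = -((1 : ℝ) / 6) by ring, Real.rpow_neg ht0.le, Real.rpow_neg hx0.le]
    exact inv_anti₀ (Real.rpow_pos_of_pos hx0 _) (Real.rpow_le_rpow hx0.le hxt (by norm_num))
  unfold etaUp
  linarith

/-- `η⁺_K → 0`. [folklore] -/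
private theorem tendsto_etaUp (K : ℝ) : Tendsto (etaUp K) atTop (𝓝 0) := by
  have h1 := tendsto_etaK K
  have h2 : Tendsto (fun x : ℝ ↦ Real.log x / x ^ ((1 : ℝ) / 4)) atTop (𝓝 0) := by
    have hlo : Tendsto (fun x : ℝ ↦ Real.log x ^ (1 : ℝ) / x ^ ((1 : ℝ) / 4)) atTop (𝓝 0) :=
      (isLittleO_log_rpow_rpow_atTop 1 (by norm_num)).tendsto_div_nhds_zero
    refine hlo.congr' ?_
    filter_upwards with x
    rw [Real.rpow_one]
  have h3 : Tendsto (fun x : ℝ ↦ 14 * x ^ (-(1 : ℝ) / 6)) atTop (𝓝 0) := by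
    have := (tendsto_rpow_neg_atTop (show (0 : ℝ) < 1 / 6 by norm_num)).const_mul 14
    rw [mul_zero] at this
    exact this.congr' (by filter_upwards with x; ring_nf)
  have h0 : Tendsto (fun x : ℝ ↦ etaK K x + Real.log x / x ^ ((1 : ℝ) / 4) + 14 * x ^ (-(1 : ℝ) / 6))
      atTop (𝓝 0) := by
    simpa using (h1.add h2).add h3
  exact h0

/-- `log 4 + 4 ≤ 7`. [folklore] -/
private theorem log_four_add_four_le : Real.log 4 + 4 ≤ 7 := by
  have := Real.log_le_sub_one_of_pos (show (0 : ℝ) < 4 by norm_num)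
  linarith

/-- **Pointwise upper bound under RH via von Koch**: there are `K > 0`, `X₂` with
`|θ(x) − x| ≤ K √x log² x` (`x ≥ X₂`) and `ψ(t) − θ(t) ≤ (1 + η⁺_K(x)) √t` for `t ≥ x ≥ X₂`
(`ψ − θ ≤ ψ(√t) + ψ(t^{1/3}) + ψ(t^{1/5})`, Mathlib; `ψ(√t) ≤ θ(√t) + t^{1/4} log t`; von Koch at `√t`;
`ψ(y) ≤ (log 4 + 4) y`). [cite: Nicolas2012, Lemma 2.4 (2.12) (qualitative)] -/
theorem psi_sub_theta_le_of_RH (hRH : RiemannHypothesis) : ∃ K X₂ : ℝ, 0 < K ∧ 358801 ≤ X₂ ∧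
    (∀ x : ℝ, X₂ ≤ x → |θ x - x| ≤ K * Real.sqrt x * Real.log x ^ 2) ∧
    ∀ x t : ℝ, X₂ ≤ x → x ≤ t → ψ t - θ t ≤ (1 + etaUp K x) * Real.sqrt t := by
  obtain ⟨K, X, hK, hX, h⟩ := LiThetaRH.exists_abs_theta_sub_le_of_RH hRH
  have hXX : X ≤ max 358801 (X ^ 2) := le_trans (by nlinarith) (le_max_right _ _)
  refine ⟨K, max 358801 (X ^ 2), hK, le_max_left _ _, fun x hx ↦ h x (hXX.trans hx), fun x t hx hxt ↦ ?_⟩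
  have hx1 : 358801 ≤ x := (le_max_left _ _).trans hx
  have hX2 : X ^ 2 ≤ t := ((le_max_right _ _).trans hx).trans hxt
  have ht0 : 0 < t := by linarith
  have ht1 : (1 : ℝ) ≤ t := by linarith
  have hst0 : 0 < Real.sqrt t := Real.sqrt_pos.2 ht0
  have hsq : X ≤ Real.sqrt t := by
    rw [show X = Real.sqrt (X ^ 2) from (Real.sqrt_sq (by linarith)).symm]
    exact Real.sqrt_le_sqrt hX2
  have hst1 : (1 : ℝ) ≤ Real.sqrt t := by linarith
  -- Mathlib: `ψ − θ ≤ ψ(t^{1/2}) + ψ(t^{1/3}) + ψ(t^{1/5})`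
  have h0 := Chebyshev.psi_sub_theta_le_psi_add_psi_add_psi t
  have e2 : t ^ (2 : ℝ)⁻¹ = Real.sqrt t := by rw [Real.sqrt_eq_rpow]; norm_num
  rw [e2] at h0
  -- `ψ(√t) ≤ θ(√t) + 2 √√t log √t = θ(√t) + t^{1/4} log t`
  have hψ2 := Chebyshev.psi_sub_theta_le hst1
  have hq : Real.sqrt (Real.sqrt t) = t ^ ((1 : ℝ) / 4) := by
    rw [Real.sqrt_eq_rpow, Real.sqrt_eq_rpow, ← Real.rpow_mul ht0.le]; norm_num
  have hls : Real.log (Real.sqrt t) = Real.log t / 2 := by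
    rw [Real.sqrt_eq_rpow, Real.log_rpow ht0]; ring
  rw [hq, hls] at hψ2
  -- von Koch at `√t`
  have hθ2 := (abs_le.1 (h (Real.sqrt t) hsq)).2
  have hT := vonKoch_sqrt_eq (K := K) ht0
  -- `ψ(t^{1/3}) ≤ 7 t^{1/3}`, `ψ(t^{1/5}) ≤ 7 t^{1/3}`
  have h7 := log_four_add_four_le
  have h13 : 0 ≤ t ^ (3 : ℝ)⁻¹ := Real.rpow_nonneg ht0.le _
  have h15 : 0 ≤ t ^ (5 : ℝ)⁻¹ := Real.rpow_nonneg ht0.le _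
  have hψ3 : ψ (t ^ (3 : ℝ)⁻¹) ≤ 7 * t ^ (3 : ℝ)⁻¹ :=
    (Chebyshev.psi_le_const_mul_self h13).trans (mul_le_mul_of_nonneg_right h7 h13)
  have hψ5 : ψ (t ^ (5 : ℝ)⁻¹) ≤ 7 * t ^ (3 : ℝ)⁻¹ := by
    have h53 : t ^ (5 : ℝ)⁻¹ ≤ t ^ (3 : ℝ)⁻¹ := Real.rpow_le_rpow_of_exponent_le ht1 (by norm_num)
    exact (Chebyshev.psi_le_const_mul_self h15).trans ((mul_le_mul_of_nonneg_right h7 h15).trans (by linarith))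
  -- units of `√t`
  have hq0 : 0 < t ^ ((1 : ℝ) / 4) := Real.rpow_pos_of_pos ht0 _
  have h4 : t ^ ((1 : ℝ) / 4) * t ^ ((1 : ℝ) / 4) = Real.sqrt t := by
    rw [← Real.rpow_add ht0, Real.sqrt_eq_rpow]; norm_num
  have e1 : t ^ ((1 : ℝ) / 4) * Real.log t = Real.sqrt t * (Real.log t / t ^ ((1 : ℝ) / 4)) := by
    rw [← h4, mul_assoc, ← mul_div_assoc, mul_div_cancel_left₀ _ hq0.ne']
  have e3 : t ^ (3 : ℝ)⁻¹ = Real.sqrt t * t ^ (-(1 : ℝ) / 6) := by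
    rw [Real.sqrt_eq_rpow, ← Real.rpow_add ht0]; norm_num
  have hηle := etaUp_anti hK.le hx1 hxt
  have hmain : ψ t - θ t ≤ (1 + etaUp K t) * Real.sqrt t := by
    rw [etaUp]
    have : 2 * t ^ ((1 : ℝ) / 4) * (Real.log t / 2) = Real.sqrt t * (Real.log t / t ^ ((1 : ℝ) / 4)) := by
      rw [← e1]; ring
    nlinarith [h0, hψ2, hθ2, hT, hψ3, hψ5, this, e3, hst0]
  exact hmain.trans (mul_le_mul_of_nonneg_right (by linarith) hst0.le)

/-- **The asymptotic lower bound (2.18) for `log f`, generic form (PROVED under RH)**: for `x ≥ 121`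
with `θ(x) ≥ 4x/5`, if `J(x) − K(x) ≤ c F_{1/2}(x)` with `c ≥ 0`, then
`−log f(x) · √x log x ≤ β + β(1+4/log x)/log x + log(2π)/√x + c (2 − 2/log x + 8/log² x) + (θ(x)−x)²/(x√x)`
(Lemma 2.1 lower (2.1), Lemma 2.5 lower (2.14)–(2.15), (2.4)). [cite: Nicolas2012, Prop. 2.1 (2.18)] -/
theorem neg_log_nicolasF_mul_le_of (hRH : RiemannHypothesis) {x c : ℝ} (hx : 121 ≤ x)
    (hθ45 : 4 / 5 * x ≤ θ x) (hc : 0 ≤ c)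
    (hJK : nicolasJ x - nicolasKInt x ≤ c * (Fz (1 / 2 : ℝ) x).re) :
    -Real.log (nicolasF x) * (Real.sqrt x * Real.log x) ≤
      nicolasBeta + nicolasBeta * (1 + 4 / Real.log x) / Real.log x + Real.log (2 * π) / Real.sqrt x
        + c * (2 - 2 / Real.log x + 8 / Real.log x ^ 2) + (θ x - x) ^ 2 / (x * Real.sqrt x) := by
  have hx1 : 1 < x := by linarith
  have hx0 : 0 < x := by linarith
  have h1 := lemma21_lower hx hθ45
  have h2 := nicolasJ_ge_of_RH hRH hx1
  have h3 := Fhalf_le hx1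
  set S := θ x - x with hSdef
  set L := Real.log x with hLdef
  set s := Real.sqrt x with hsdef
  have hs0 : 0 < s := Real.sqrt_pos.2 hx0
  have hL0 : 0 < L := Real.log_pos hx1
  have hxs : x = s * s := (Real.mul_self_sqrt hx0.le).symm
  have hsL : 0 < s * L := mul_pos hs0 hL0
  have h3c := mul_le_mul_of_nonneg_left h3 hc
  have hlogf : -Real.log (nicolasF x) ≤ nicolasBeta / (s * L) + nicolasBeta * ((1 + 4 / L) / (s * L ^ 2))
      + Real.log (2 * π) / (x * L) + c * (2 / (s * L) - 2 / (s * L ^ 2) + 8 / (s * L ^ 3))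
      + S ^ 2 / (x ^ 2 * L) := by
    have e : -nicolasBeta / (s * L) = -(nicolasBeta / (s * L)) := neg_div _ _
    rw [e] at h2
    linarith
  have key := mul_le_mul_of_nonneg_right hlogf hsL.le
  refine key.trans (le_of_eq ?_)
  rw [hxs]
  field_simp

/-- The upper comparison function of the von Koch road:
`u_K(x) = β + β(1+4/log x)/log x + log(2π)/√x + (1 + η⁺_K(x))(2 − 2/log x + 8/log² x) + K² log⁴ x/√x`.
[cite: Nicolas2012, (2.18) ⟹ (2.20)] -/
def uK (K x : ℝ) : ℝ :=
  nicolasBeta + nicolasBeta * (1 + 4 / Real.log x) / Real.log x + Real.log (2 * π) / Real.sqrt x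
    + (1 + etaUp K x) * (2 - 2 / Real.log x + 8 / Real.log x ^ 2) + K ^ 2 * Real.log x ^ 4 / Real.sqrt x

/-- `u_K → β + 2`. [folklore] -/
private theorem tendsto_uK (K : ℝ) : Tendsto (uK K) atTop (𝓝 (nicolasBeta + 2)) := by
  have hL := Real.tendsto_log_atTop
  have hs : Tendsto Real.sqrt atTop atTop := by
    have := tendsto_rpow_atTop (show (0 : ℝ) < 1 / 2 by norm_num)
    exact this.congr' (by filter_upwards with x; exact (Real.sqrt_eq_rpow x).symm)
  have h4L : Tendsto (fun x : ℝ ↦ 4 / Real.log x) atTop (𝓝 0) := tendsto_const_nhds.div_atTop hL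
  have h1 : Tendsto (fun x : ℝ ↦ nicolasBeta * (1 + 4 / Real.log x) / Real.log x) atTop (𝓝 0) := by
    have hnum : Tendsto (fun x : ℝ ↦ nicolasBeta * (1 + 4 / Real.log x)) atTop (𝓝 nicolasBeta) := by
      simpa using (tendsto_const_nhds (x := nicolasBeta)).mul ((tendsto_const_nhds (x := (1 : ℝ))).add h4L)
    exact hnum.div_atTop hL
  have h2 : Tendsto (fun x : ℝ ↦ Real.log (2 * π) / Real.sqrt x) atTop (𝓝 0) :=
    tendsto_const_nhds.div_atTop hs
  have h2L : Tendsto (fun x : ℝ ↦ 2 / Real.log x) atTop (𝓝 0) := tendsto_const_nhds.div_atTop hL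
  have h8L : Tendsto (fun x : ℝ ↦ 8 / Real.log x ^ 2) atTop (𝓝 0) :=
    tendsto_const_nhds.div_atTop (hL.atTop_mul_atTop₀ hL |>.congr' (by filter_upwards with x; ring))
  have h3 : Tendsto (fun x : ℝ ↦ (1 + etaUp K x) * (2 - 2 / Real.log x + 8 / Real.log x ^ 2)) atTop
      (𝓝 ((1 + 0) * (2 - 0 + 0))) :=
    ((tendsto_const_nhds (x := (1 : ℝ))).add (tendsto_etaUp K)).mul
      (((tendsto_const_nhds (x := (2 : ℝ))).sub h2L).add h8L)
  have h4 : Tendsto (fun x : ℝ ↦ K ^ 2 * Real.log x ^ 4 / Real.sqrt x) atTop (𝓝 0) := by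
    have hlo : Tendsto (fun x : ℝ ↦ Real.log x ^ (4 : ℝ) / x ^ ((1 : ℝ) / 2)) atTop (𝓝 0) :=
      (isLittleO_log_rpow_rpow_atTop 4 (by norm_num)).tendsto_div_nhds_zero
    have := hlo.const_mul (K ^ 2)
    rw [mul_zero] at this
    refine this.congr' ?_
    filter_upwards with x
    have hL4 : Real.log x ^ (4 : ℝ) = Real.log x ^ 4 := by norm_cast
    rw [hL4, ← Real.sqrt_eq_rpow]
    ring
  have h0 : Tendsto (fun x : ℝ ↦ nicolasBeta + nicolasBeta * (1 + 4 / Real.log x) / Real.log x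
      + Real.log (2 * π) / Real.sqrt x + (1 + etaUp K x) * (2 - 2 / Real.log x + 8 / Real.log x ^ 2)
      + K ^ 2 * Real.log x ^ 4 / Real.sqrt x) atTop (𝓝 (nicolasBeta + 2)) := by
    have := ((((tendsto_const_nhds (x := nicolasBeta)).add h1).add h2).add h3).add h4
    norm_num at this
    exact this
  exact h0

/-- **The upper asymptotic input under RH with standard axioms**: there is `u → β + 2` with
`−log f(x) · √x log x ≤ u(x)` eventually ((2.18) in asymptotic form, von Koch road).
[cite: Nicolas2012, Prop. 2.1 (2.16)/(2.18)] -/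
theorem upRoad_of_RH (hRH : RiemannHypothesis) : ∃ u : ℝ → ℝ, Tendsto u atTop (𝓝 (nicolasBeta + 2)) ∧
    ∀ᶠ x : ℝ in atTop, -Real.log (nicolasF x) * (Real.sqrt x * Real.log x) ≤ u x := by
  obtain ⟨K, X₂, hK, hX₂, hθ, hψ⟩ := psi_sub_theta_le_of_RH hRH
  refine ⟨uK K, tendsto_uK K, ?_⟩
  filter_upwards [eventually_theta_ge_four_fifths hRH, eventually_ge_atTop X₂] with x h45 hx
  have hx' : 358801 ≤ x := hX₂.trans hx
  have hx0 : 0 < x := by linarith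
  have hx1 : (1 : ℝ) ≤ x := by linarith
  have hc : 0 ≤ 1 + etaUp K x := by linarith [etaUp_nonneg hK.le hx1]
  have hJK := jk_le_of_pointwise hRH (by linarith) fun t ht ↦ hψ x t hx ht
  have h := neg_log_nicolasF_mul_le_of hRH (by linarith) h45 hc hJK
  -- `(θ x − x)² ≤ K² x log⁴ x`
  have hS := abs_le.1 (hθ x hx)
  have hsx : 0 < Real.sqrt x := Real.sqrt_pos.2 hx0
  have hxs : Real.sqrt x * Real.sqrt x = x := Real.mul_self_sqrt hx0.le
  have hS2 : (θ x - x) ^ 2 ≤ (K * Real.sqrt x * Real.log x ^ 2) ^ 2 := sq_le_sq' hS.1 hS.2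
  have hS3 : (θ x - x) ^ 2 / (x * Real.sqrt x) ≤ K ^ 2 * Real.log x ^ 4 / Real.sqrt x := by
    rw [div_le_div_iff₀ (by positivity) hsx]
    have e : (K * Real.sqrt x * Real.log x ^ 2) ^ 2 * Real.sqrt x =
        K ^ 2 * Real.log x ^ 4 * (x * Real.sqrt x) := by
      linear_combination (K ^ 2 * Real.log x ^ 4 * Real.sqrt x) * hxs
    calc (θ x - x) ^ 2 * Real.sqrt x ≤ (K * Real.sqrt x * Real.log x ^ 2) ^ 2 * Real.sqrt x :=
          mul_le_mul_of_nonneg_right hS2 hsx.le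
      _ = _ := e
  rw [uK]
  linarith

end NicolasLimsup

open NicolasLimsup

/-- **Nicolas 2012, Thm. 1.1 (1.4) (PROVED under RH, standard axioms)**: under the Riemann hypothesis,
`lim sup_{n→∞} c(n) = e^γ(2+β)`, `c(n) = (n/φ(n) − e^γ log log n)√(log n)`, `β = 2 + γ − log π − 2 log 2`
— in the `ε`-form of the named fact `Nicolas2012_thm1_1` (its first conjunct): for every `ε > 0`,
eventually `c(n) < e^γ(2+β) + ε` and frequently `c(n) > e^γ(2+β) − ε`. The three asymptotic inputs
(`θ(x)/x → 1`; `−log f · √x log x ≤ u → β+2`; `≥ W + 2 − e`, `e → 0`) come from von Koch's theorem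
(§7), so the axioms are standard. [cite: Nicolas2012, Thm. 1.1 (1.4); Broughan2017Arithmetic, §5.7] -/
theorem Nicolas2012_thm1_1_limsup (hRH : RiemannHypothesis) :
    ∀ ε : ℝ, 0 < ε →
      (∀ᶠ n : ℕ in atTop, nicolasC n < nicolasCLimsup + ε) ∧
        (∃ᶠ n : ℕ in atTop, nicolasCLimsup - ε < nicolasC n) := by
  intro ε hε
  obtain ⟨u, hu, hup⟩ := upRoad_of_RH hRH
  obtain ⟨e, he, hlow⟩ := lowRoad_of_RH hRH
  exact ⟨eventually_nicolasC_lt_of (tendsto_theta_div_of_RH hRH) hu hup hε,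
    frequently_lt_nicolasC_of hRH (tendsto_theta_div_of_RH hRH) he hlow hε⟩

/-- **Nicolas 2012, Thm. 1.1 (1.4), explicit road**: over Schoenfeld's `θ`-bound under RH
(`Schoenfeld1976_theta`, (1.12)) and Nicolas's (2.18) (`Nicolas2012_logf_lower_sharp`) as hypotheses —
both DISCHARGED in the tree (`Schoenfeld1976_theta_holds`, `Nicolas2012_logf_lower_sharp_holds`, with
computational closures) — the same conclusion, through the printed explicit bounds. Standard axioms.
[cite: Nicolas2012, Thm. 1.1 (1.4); Broughan2017Arithmetic, §5.7] -/
theorem Nicolas2012_thm1_1_limsup_of (hS : Schoenfeld1976_theta) (h18 : Nicolas2012_logf_lower_sharp)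
    (hRH : RiemannHypothesis) :
    ∀ ε : ℝ, 0 < ε →
      (∀ᶠ n : ℕ in atTop, nicolasC n < nicolasCLimsup + ε) ∧
        (∃ᶠ n : ℕ in atTop, nicolasCLimsup - ε < nicolasC n) :=
  fun _ hε ↦ ⟨eventually_nicolasC_lt hS h18 hRH hε, frequently_lt_nicolasC hS hRH hε⟩

/-- The `⟸` half of Cor. 1.1 (1.4): if `c(n) < e^γ(2+β) + 1` eventually then RH (the tree's
`Nicolas2012_nicolasC_primorial_unbounded_holds`: if RH fails, `c(N_k)` is unbounded above).
[cite: Nicolas2012, Cor. 1.1 (proof)] -/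
theorem riemannHypothesis_of_eventually_nicolasC_lt {A : ℝ}
    (h : ∀ᶠ n : ℕ in atTop, nicolasC n < A) : RiemannHypothesis := by
  by_contra hRH
  obtain ⟨N, hN⟩ := eventually_atTop.1 h
  obtain ⟨p, -, hXp, hA⟩ := (Nicolas2012_nicolasC_primorial_unbounded_holds hRH).2 A N
  have hNp : N ≤ primorial p := le_trans (by exact_mod_cast hXp.le) le_primorial_self
  exact lt_asymm hA (hN (primorial p) hNp)

/-- **Nicolas 2012, Cor. 1.1 for (1.4), explicit road, kernel-grade** (standard axioms): over
`Schoenfeld1976_theta` and `Nicolas2012_logf_lower_sharp`, RH `⟺ lim sup c(n) = e^γ(2+β)` (in `ε`-form).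
[cite: Nicolas2012, Cor. 1.1 with Thm. 1.1 (1.4); Broughan2017Arithmetic, §5.7] -/
theorem riemannHypothesis_iff_nicolasC_limsup_of' (hS : Schoenfeld1976_theta)
    (h18 : Nicolas2012_logf_lower_sharp) :
    RiemannHypothesis ↔
      ∀ ε : ℝ, 0 < ε →
        (∀ᶠ n : ℕ in atTop, nicolasC n < nicolasCLimsup + ε) ∧
          (∃ᶠ n : ℕ in atTop, nicolasCLimsup - ε < nicolasC n) :=
  ⟨Nicolas2012_thm1_1_limsup_of hS h18, fun h ↦ riemannHypothesis_of_eventually_nicolasC_lt (h 1 one_pos).1⟩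

/-- **Nicolas 2012, Cor. 1.1 for (1.4) (PROVED, unconditional, standard axioms)**:
RH `⟺ lim sup c(n) = e^γ(2+β)` (in `ε`-form) — Broughan vol. 1 §5.7, the `lim sup` clause of
"Nicolas' second theorem" as a theorem of the tree. `⟹` is `Nicolas2012_thm1_1_limsup` (von Koch road);
`⟸` uses only the upper half (`riemannHypothesis_of_eventually_nicolasC_lt`). The tree's
`riemannHypothesis_iff_nicolasC_limsup_of` is this statement over the whole named fact `Nicolas2012_thm1_1`.
[cite: Nicolas2012, Cor. 1.1 with Thm. 1.1 (1.4); Broughan2017Arithmetic, §5.7] -/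
theorem riemannHypothesis_iff_nicolasC_limsup :
    RiemannHypothesis ↔
      ∀ ε : ℝ, 0 < ε →
        (∀ᶠ n : ℕ in atTop, nicolasC n < nicolasCLimsup + ε) ∧
          (∃ᶠ n : ℕ in atTop, nicolasCLimsup - ε < nicolasC n) :=
  ⟨Nicolas2012_thm1_1_limsup, fun h ↦ riemannHypothesis_of_eventually_nicolasC_lt (h 1 one_pos).1⟩

/-- **RH `⟺ lim sup_k c(N_k) = e^γ(2+β)` along the primorials** (the form of the abstract: "under
RH `c(N_k)` is bounded and explicit bounds are given while, if RH fails, `c(N_k)` is not bounded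
above or below"): for every `ε > 0`, eventually in `p`, `c(p#) < e^γ(2+β) + ε`, and for arbitrarily
large `p`, `c(p#) > e^γ(2+β) − ε`. Standard axioms. [cite: Nicolas2012, abstract, Prop. 3.1, §4] -/
theorem riemannHypothesis_iff_nicolasC_primorial_limsup :
    RiemannHypothesis ↔
      ∀ ε : ℝ, 0 < ε →
        (∀ᶠ p : ℕ in atTop, nicolasC (primorial p) < nicolasCLimsup + ε) ∧
          (∃ᶠ p : ℕ in atTop, nicolasCLimsup - ε < nicolasC (primorial p)) := by
  constructor
  · intro hRH ε hε
    obtain ⟨hev, -⟩ := Nicolas2012_thm1_1_limsup hRH ε hε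
    obtain ⟨e, he, hlow⟩ := lowRoad_of_RH hRH
    refine ⟨(tendsto_atTop_mono (fun _ ↦ le_primorial_self) tendsto_id).eventually hev, ?_⟩
    exact tendsto_nat_floor_atTop.frequently
      (frequently_lt_nicolasC_floor_of hRH (tendsto_theta_div_of_RH hRH) he hlow hε)
  · intro h
    by_contra hRH
    obtain ⟨hev, -⟩ := h 1 one_pos
    obtain ⟨N, hN⟩ := eventually_atTop.1 hev
    obtain ⟨p, -, hXp, hA⟩ := (Nicolas2012_nicolasC_primorial_unbounded_holds hRH).2 (nicolasCLimsup + 1) N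
    exact lt_asymm hA (hN p (by exact_mod_cast hXp.le))

/-- What remains of the named fact `Nicolas2012_thm1_1` after this file: its computational clauses
(1.5)–(1.7) (Nicolas's Maple computation of `c(N_k)`, `k ≤ π(10⁹) = 50 847 534`, §4). Given them, the
fact follows. [cite: Nicolas2012, Thm. 1.1 (1.5)–(1.7), §4] -/
theorem Nicolas2012_thm1_1_of_clauses
    (h15 : RiemannHypothesis → ∀ n : ℕ, primorial 1591883 ≤ n → nicolasC n < nicolasCLimsup)
    (h16 : RiemannHypothesis → ∀ n : ℕ, 2 ≤ n → nicolasC n ≤ nicolasC (primorial 317))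
    (h17 : RiemannHypothesis → ∀ p : ℕ, p.Prime → nicolasC 2 ≤ nicolasC (primorial p)) :
    Nicolas2012_thm1_1 :=
  fun hRH ↦ ⟨Nicolas2012_thm1_1_limsup hRH, h15 hRH, h16 hRH, h17 hRH⟩

/-! ### §8 The abstract's form: under RH `c(N_k)` is bounded; RH `⟺ c(N_k)` bounded above `⟺` bounded below -/

namespace NicolasLimsup

/-- From an eventual real-variable statement about `⌊x⌋#` to the primorials `p#`. [folklore] -/
private theorem eventually_nat_of_floor {P : ℕ → Prop} (h : ∀ᶠ x : ℝ in atTop, P ⌊x⌋₊) :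
    ∀ᶠ p : ℕ in atTop, P p := by
  have := tendsto_natCast_atTop_atTop.eventually h
  filter_upwards [this] with p hp
  simpa using hp

/-- **Under RH, `c(N_k) > 2` for all large `k`** (Prop. 3.1 (3.3): `c(N_k) ≥ e^γ(2 − β) − o(1)`,
and `e^γ(2 − β) > 3.4`). [cite: Nicolas2012, Prop. 3.1 (3.3) and §4 ("`c(N_k) ≥ … = 3.30… > c(2)`")] -/
theorem eventually_two_lt_nicolasC_primorial (hRH : RiemannHypothesis) :
    ∀ᶠ p : ℕ in atTop, 2 < nicolasC (primorial p) := by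
  obtain ⟨e, he, hlow⟩ := lowRoad_of_RH hRH
  have hθ := tendsto_theta_div_of_RH hRH
  have h1 : ∀ᶠ x : ℝ in atTop, lowerErrOf e x < 1 := (tendsto_lowerErrOf hθ he).eventually_lt_const one_pos
  refine eventually_nat_of_floor ?_
  filter_upwards [h1, hlow, eventually_ge_atTop (3 : ℝ)] with x hE hlowx hx
  have h := nicolasC_primorial_floor_ge_of hRH hx hlowx
  rw [lowerErrOf] at hE
  have hW := neg_le_nicolasW hRH (by linarith : (0 : ℝ) < x)
  have hβ := nicolasBeta_lt'
  have hγpos := Real.exp_pos Real.eulerMascheroniConstant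
  have hγ : (1.54 : ℝ) < rexp Real.eulerMascheroniConstant := by
    have hg := Literature.Analysis.SpecialFunctions.Real.eulerMascheroniConstant_gt_d8
    have h1' : (1.54 : ℝ) < rexp 0.5772 := by
      have h2 : rexp 0.5772 = rexp 0.2886 * rexp 0.2886 := by rw [← Real.exp_add]; norm_num
      have h3 := Real.add_one_le_exp (0.2886 : ℝ)
      nlinarith [Real.exp_pos (0.2886 : ℝ)]
    exact h1'.trans_le (Real.exp_le_exp.2 (by linarith))
  have h4 : rexp Real.eulerMascheroniConstant * (2 - nicolasBeta) ≤
      rexp Real.eulerMascheroniConstant * (2 + nicolasW x) := mul_le_mul_of_nonneg_left (by linarith) hγpos.le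
  have h5 : (1.54 : ℝ) * 1.9526 ≤ rexp Real.eulerMascheroniConstant * (2 - nicolasBeta) :=
    mul_le_mul hγ.le (by linarith) (by norm_num) hγpos.le
  linarith

/-- A sequence that is eventually bounded above is bounded above. [folklore] -/
private theorem exists_forall_le_of_eventually {f : ℕ → ℝ} {C : ℝ} (h : ∀ᶠ n : ℕ in atTop, f n ≤ C) :
    ∃ B : ℝ, ∀ n : ℕ, f n ≤ B := by
  obtain ⟨N, hN⟩ := eventually_atTop.1 h
  refine ⟨max C 0 + ∑ i ∈ Finset.range N, |f i|, fun n ↦ ?_⟩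
  have hsum : 0 ≤ ∑ i ∈ Finset.range N, |f i| := Finset.sum_nonneg fun i _ ↦ abs_nonneg _
  rcases lt_or_ge n N with hn | hn
  · have h1 : |f n| ≤ ∑ i ∈ Finset.range N, |f i| :=
      Finset.single_le_sum (f := fun i ↦ |f i|) (fun i _ ↦ abs_nonneg _) (Finset.mem_range.2 hn)
    have h2 := le_abs_self (f n)
    have h3 := le_max_right C 0
    linarith
  · have h1 := hN n hn
    have h3 := le_max_left C 0
    linarith

end NicolasLimsup

/-- **Nicolas 2012, abstract: "Under Riemann's hypothesis, it is proved that `c(N_k)` is bounded"** —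
upper half (PROVED, standard axioms): under RH there is `B` with `c(p#) ≤ B` for every `p`.
[cite: Nicolas2012, abstract and Thm. 1.1 (1.4)/(1.6)] -/
theorem nicolasC_primorial_bddAbove_of_RH (hRH : RiemannHypothesis) :
    ∃ B : ℝ, ∀ p : ℕ, nicolasC (primorial p) ≤ B := by
  obtain ⟨hev, -⟩ := riemannHypothesis_iff_nicolasC_primorial_limsup.1 hRH 1 one_pos
  exact exists_forall_le_of_eventually (hev.mono fun p hp ↦ hp.le)

/-- **Nicolas 2012, abstract: "Under Riemann's hypothesis, it is proved that `c(N_k)` is bounded"** —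
lower half (PROVED, standard axioms): under RH there is `A` with `A ≤ c(p#)` for every `p`.
[cite: Nicolas2012, abstract and Thm. 1.1 (1.7)] -/
theorem nicolasC_primorial_bddBelow_of_RH (hRH : RiemannHypothesis) :
    ∃ A : ℝ, ∀ p : ℕ, A ≤ nicolasC (primorial p) := by
  have hev := (eventually_two_lt_nicolasC_primorial hRH).mono fun p (hp : 2 < nicolasC (primorial p)) ↦
    show -nicolasC (primorial p) ≤ -2 by linarith
  obtain ⟨B, hB⟩ := exists_forall_le_of_eventually hev
  exact ⟨-B, fun p ↦ by linarith [hB p]⟩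

/-- **RH `⟺ c(N_k)` is bounded above** (Nicolas 2012, abstract: bounded under RH, "not bounded above
or below" if RH fails — the tree's `Nicolas2012_nicolasC_primorial_unbounded_holds`). PROVED, standard
axioms. [cite: Nicolas2012, abstract, Thm. 1.1 and p. 3 (from (1.10))] -/
theorem riemannHypothesis_iff_nicolasC_primorial_bddAbove :
    RiemannHypothesis ↔ ∃ B : ℝ, ∀ p : ℕ, p.Prime → nicolasC (primorial p) ≤ B := by
  refine ⟨fun hRH ↦ ?_, fun ⟨B, hB⟩ ↦ ?_⟩
  · obtain ⟨B, hB⟩ := nicolasC_primorial_bddAbove_of_RH hRH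
    exact ⟨B, fun p _ ↦ hB p⟩
  · by_contra hRH
    obtain ⟨p, hp, -, hA⟩ := (Nicolas2012_nicolasC_primorial_unbounded_holds hRH).2 B 0
    exact absurd (hB p hp) (not_le.2 hA)

/-- **RH `⟺ c(N_k)` is bounded below** (Nicolas 2012, abstract; `⟸` is the tree's
`riemannHypothesis_of_nicolasC_primorial_bddBelow`). PROVED, standard axioms.
[cite: Nicolas2012, abstract, Thm. 1.1 and p. 3 (from (1.10))] -/
theorem riemannHypothesis_iff_nicolasC_primorial_bddBelow :
    RiemannHypothesis ↔ ∃ A : ℝ, ∀ p : ℕ, p.Prime → A ≤ nicolasC (primorial p) := by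
  refine ⟨fun hRH ↦ ?_, fun ⟨A, hA⟩ ↦ ?_⟩
  · obtain ⟨A, hA⟩ := nicolasC_primorial_bddBelow_of_RH hRH
    exact ⟨A, fun p _ ↦ hA p⟩
  · exact riemannHypothesis_of_nicolasC_primorial_bddBelow (X := 0) fun p hp _ ↦ hA p hp

/-! ### §9 The analytic range of (1.7) with an explicit threshold: under RH, `c(N_k) > c(2)` for `p_k ≥ 599²` -/

namespace NicolasLimsup

/-- `x^{1/4} ≥ 24` for `x ≥ 358801` (`24⁴ = 331776`). [folklore] -/
private theorem rpow_quarter_ge {x : ℝ} (hx : 358801 ≤ x) : 24 ≤ x ^ ((1 : ℝ) / 4) := by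
  have h24 : (24 : ℝ) = ((24 : ℝ) ^ (4 : ℕ)) ^ ((1 : ℝ) / 4) := by
    rw [← Real.rpow_natCast, ← Real.rpow_mul (by norm_num)]; norm_num
  rw [h24]
  exact Real.rpow_le_rpow (by norm_num) (by norm_num; linarith) (by norm_num)

/-- `log 358801 ≤ 13` (`e¹³ > 2.718¹³ > 440000`). [folklore] -/
private theorem log_X_le : Real.log (358801 : ℝ) ≤ 13 := by
  rw [Real.log_le_iff_le_exp (by norm_num)]
  have h := Real.exp_one_gt_d9
  have e13 : Real.exp 13 = Real.exp 1 ^ 13 := by rw [← Real.exp_nat_mul]; norm_num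
  rw [e13]
  have h2 : (2.7182818283 : ℝ) ^ 13 ≤ Real.exp 1 ^ 13 := pow_le_pow_left₀ (by norm_num) h.le 13
  have h3 : (358801 : ℝ) ≤ (2.7182818283 : ℝ) ^ 13 := by norm_num
  linarith

/-- `η(x) ≤ 0.0701` for `x ≥ 358801` (`η` is non-increasing from `e⁸` on; `η(599²) ≤ 13²/(32π·24)`).
[folklore] -/
private theorem eta_le_sharp {x : ℝ} (hx : 358801 ≤ x) : eta x ≤ 0.0701 := by
  have hX0 : (0 : ℝ) < 358801 := by norm_num
  have hmono := log_pow_div_rpow_le (a := (1 : ℝ) / 4) (k := 2) (by norm_num) (by norm_num) hX0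
    (by have := twelve_le_log (le_refl (358801 : ℝ)); norm_num; linarith) hx
  have hq := rpow_quarter_ge (le_refl (358801 : ℝ))
  have hL := log_X_le
  have hL0 : 0 ≤ Real.log (358801 : ℝ) := Real.log_nonneg (by norm_num)
  have hπ := Real.pi_gt_d2
  have hx0 : 0 < x := by linarith
  have hxq : 0 < x ^ ((1 : ℝ) / 4) := Real.rpow_pos_of_pos hx0 _
  have hXq : 0 < (358801 : ℝ) ^ ((1 : ℝ) / 4) := Real.rpow_pos_of_pos hX0 _
  -- `η(x) = (log² x/x^{1/4})/(32π) ≤ (log² X/X^{1/4})/(32π) ≤ (169/24)/(32π)`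
  have h1 : Real.log (358801 : ℝ) ^ 2 / (358801 : ℝ) ^ ((1 : ℝ) / 4) ≤ 169 / 24 := by
    rw [div_le_div_iff₀ hXq (by norm_num)]
    have : Real.log (358801 : ℝ) ^ 2 ≤ 169 := by nlinarith
    nlinarith
  have e : eta x = Real.log x ^ 2 / x ^ ((1 : ℝ) / 4) / (32 * π) := by
    rw [eta]; field_simp
  rw [e, div_le_iff₀ (by positivity)]
  nlinarith [hmono.trans h1]

/-- `η₂(x) ≤ 0.3991` (and `≥ 0`) for `x ≥ 358801`. [folklore] -/
private theorem eta2_bounds {x : ℝ} (hx : 358801 ≤ x) : 0 ≤ eta2 x ∧ eta2 x ≤ 0.3991 := by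
  have hx0 : 0 < x := by linarith
  have hx1 : 1 < x := by linarith
  have hL := twelve_le_log hx
  have hL0 : 0 < Real.log x := by linarith
  have hs : 0 < Real.sqrt x := Real.sqrt_pos.2 hx0
  have hβ0 : 0 < nicolasBeta := lt_trans (by norm_num) nicolasBeta_gt
  have hβ1 := nicolasBeta_lt'
  have hη0 := eta_nonneg hx0
  have hη1 := eta_le_sharp hx
  -- `(2 + β(1 + 4/L))/L ≤ 0.172`
  have h2 : (2 + nicolasBeta * (1 + 4 / Real.log x)) / Real.log x ≤ 0.172 := by
    rw [div_le_iff₀ hL0]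
    have h4 : 4 / Real.log x ≤ 1 / 3 := by
      rw [div_le_div_iff₀ hL0 (by norm_num)]; linarith
    nlinarith
  have h2' : 0 ≤ (2 + nicolasBeta * (1 + 4 / Real.log x)) / Real.log x := by positivity
  -- `4 log x/√x ≤ 52/599`
  have h3 : 4 * Real.log x / Real.sqrt x ≤ 52 / 599 := by
    have hmono := log_pow_div_rpow_le (a := (1 : ℝ) / 2) (k := 1) (by norm_num) (by norm_num)
      (show (0 : ℝ) < 358801 by norm_num)
      (by have := twelve_le_log (le_refl (358801 : ℝ)); norm_num; linarith) hx
    simp only [pow_one] at hmono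
    rw [← Real.sqrt_eq_rpow, ← Real.sqrt_eq_rpow] at hmono
    have hsX : Real.sqrt (358801 : ℝ) = 599 := by
      rw [show (358801 : ℝ) = 599 ^ 2 by norm_num, Real.sqrt_sq (by norm_num)]
    rw [hsX] at hmono
    have hLX := log_X_le
    calc 4 * Real.log x / Real.sqrt x = 4 * (Real.log x / Real.sqrt x) := by ring
      _ ≤ 4 * (Real.log (358801 : ℝ) / 599) := by gcongr
      _ ≤ 52 / 599 := by rw [mul_div_assoc']; exact div_le_div_of_nonneg_right (by linarith) (by norm_num)
  have h3' : 0 ≤ 4 * Real.log x / Real.sqrt x := by positivity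
  rw [eta2]
  constructor
  · positivity
  · have : (52 : ℝ) / 599 ≤ 0.0869 := by norm_num
    linarith

/-- `ratio(x) = √(θ(x)/x) · (1 + log(θ(x)/x)/log x)` (`x ≥ 3`). [folklore] -/
private theorem ratio_eq {x : ℝ} (hx : 3 ≤ x) :
    ratio x = Real.sqrt (θ x / x) * (1 + Real.log (θ x / x) / Real.log x) := by
  have hx0 : 0 < x := by linarith
  have hθ1 := one_lt_theta hx
  have hlx : Real.log x ≠ 0 := (Real.log_pos (by linarith)).ne'
  rw [ratio, Real.sqrt_div (Chebyshev.theta_nonneg x), Real.log_div (by linarith) hx0.ne']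
  field_simp
  ring

/-- Under RH (Schoenfeld road), `|ratio(x) − 1| ≤ 0.0125` for `x ≥ 358801`
(`|θ(x)/x − 1| ≤ log² x/(8π√x) ≤ 0.0113`). [cite: Nicolas2012, Prop. 3.1 (proof, "≤ 0.0069/log x")] -/
private theorem abs_ratio_sub_one_le (hS : Schoenfeld1976_theta) (hRH : RiemannHypothesis) {x : ℝ}
    (hx : 358801 ≤ x) : |ratio x - 1| ≤ 0.0125 := by
  have hx0 : 0 < x := by linarith
  have hx3 : (3 : ℝ) ≤ x := by linarith
  have hL := twelve_le_log hx
  have hL0 : 0 < Real.log x := by linarith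
  have hSx := abs_le.1 (hS hRH x (by linarith))
  have hs : 0 < Real.sqrt x := Real.sqrt_pos.2 hx0
  have hxs : Real.sqrt x * Real.sqrt x = x := Real.mul_self_sqrt hx0.le
  -- `δ = log² x/(8π√x) ≤ 0.01123`
  have hδ : Real.log x ^ 2 / (8 * π * Real.sqrt x) ≤ 0.0113 := by
    have hmono := log_pow_div_rpow_le (a := (1 : ℝ) / 2) (k := 2) (by norm_num) (by norm_num)
      (show (0 : ℝ) < 358801 by norm_num)
      (by have := twelve_le_log (le_refl (358801 : ℝ)); norm_num; linarith) hx
    rw [← Real.sqrt_eq_rpow, ← Real.sqrt_eq_rpow] at hmono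
    have hsX : Real.sqrt (358801 : ℝ) = 599 := by
      rw [show (358801 : ℝ) = 599 ^ 2 by norm_num, Real.sqrt_sq (by norm_num)]
    rw [hsX] at hmono
    have hLX := log_X_le
    have hLX0 : 0 ≤ Real.log (358801 : ℝ) := Real.log_nonneg (by norm_num)
    have hπ := Real.pi_gt_d2
    have h1 : Real.log (358801 : ℝ) ^ 2 / 599 ≤ 169 / 599 :=
      div_le_div_of_nonneg_right (by nlinarith) (by norm_num)
    have e : Real.log x ^ 2 / (8 * π * Real.sqrt x) = Real.log x ^ 2 / Real.sqrt x / (8 * π) := by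
      field_simp
    rw [e, div_le_iff₀ (by positivity)]
    nlinarith [hmono.trans h1]
  set q : ℝ := θ x / x with hq
  have hq1 : |q - 1| ≤ 0.0113 := by
    have e : q - 1 = (θ x - x) / x := by rw [hq]; field_simp
    rw [e, abs_div, abs_of_pos hx0, div_le_iff₀ hx0]
    have : |θ x - x| ≤ Real.log x ^ 2 / (8 * π * Real.sqrt x) * x := by
      have e2 : Real.log x ^ 2 / (8 * π * Real.sqrt x) * x = Real.sqrt x * Real.log x ^ 2 / (8 * π) := by
        field_simp
        nlinarith [hxs]
      rw [e2]
      exact abs_le.2 hSx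
    nlinarith [abs_nonneg (θ x - x)]
  have hqb := abs_le.1 hq1
  have hq0 : 0 < q := by linarith [hqb.1]
  -- `√q ∈ [1 − 0.01123, 1 + 0.01123]`
  have hsq1 : 1 - 0.0113 ≤ Real.sqrt q := by
    have h1 : 1 - 0.0113 ≤ q := by linarith [hqb.1]
    calc (1 : ℝ) - 0.0113 = Real.sqrt ((1 - 0.0113) ^ 2) := (Real.sqrt_sq (by norm_num)).symm
      _ ≤ Real.sqrt q := Real.sqrt_le_sqrt (by nlinarith)
  have hsq2 : Real.sqrt q ≤ 1 + 0.0113 := by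
    calc Real.sqrt q ≤ Real.sqrt ((1 + 0.0113) ^ 2) := Real.sqrt_le_sqrt (by nlinarith [hqb.2])
      _ = 1 + 0.0113 := Real.sqrt_sq (by norm_num)
  -- `log q ∈ [1 − 1/q, q − 1]`
  have hlq2 : Real.log q ≤ 0.0113 := (Real.log_le_sub_one_of_pos hq0).trans (by linarith [hqb.2])
  have hlq1 : -0.0115 ≤ Real.log q := by
    have h := Real.one_sub_inv_le_log_of_pos hq0
    have hinv : q⁻¹ ≤ 1 / (1 - 0.0113) := by
      rw [inv_eq_one_div]; exact one_div_le_one_div_of_le (by norm_num) (by linarith [hqb.1])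
    have : (1 : ℝ) / (1 - 0.0113) ≤ 1.0115 := by norm_num
    linarith
  have hlL2 : Real.log q / Real.log x ≤ 0.00095 := by
    rw [div_le_iff₀ hL0]; nlinarith
  have hlL1 : -0.00096 ≤ Real.log q / Real.log x := by
    rw [le_div_iff₀ hL0]; nlinarith
  rw [ratio_eq hx3, ← hq]
  have hsq0 : 0 ≤ Real.sqrt q := Real.sqrt_nonneg _
  rw [abs_le]
  constructor
  · nlinarith [mul_le_mul hsq1 (show (1 : ℝ) - 0.00096 ≤ 1 + Real.log q / Real.log x by linarith)
      (by norm_num) hsq0]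
  · nlinarith [mul_le_mul hsq2 (show 1 + Real.log q / Real.log x ≤ 1 + 0.00095 by linarith)
      (by linarith) (by norm_num)]

/-- `c(2) = (2 − e^γ log log 2)√(log 2) ≤ 2.41`. [cite: Nicolas2012, Thm. 1.1 (1.7) (`c(2) = 2.2085…`)] -/
private theorem nicolasC_two_le : nicolasC 2 ≤ 2.41 := by
  rw [nicolasC, Nat.totient_prime Nat.prime_two]
  push_cast
  have hl2 := Real.log_two_gt_d9
  have hl2' := Real.log_two_lt_d9
  have hl0 : 0 < Real.log 2 := by linarith
  -- `e^γ < 2` (`γ < log 2`)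
  have hγ : rexp Real.eulerMascheroniConstant < 2 := by
    have hg := Literature.Analysis.SpecialFunctions.Real.eulerMascheroniConstant_lt_d8
    calc rexp Real.eulerMascheroniConstant < rexp (Real.log 2) := Real.exp_lt_exp.2 (by linarith)
      _ = 2 := Real.exp_log (by norm_num)
  have hγ0 := Real.exp_pos Real.eulerMascheroniConstant
  -- `log log 2 ≥ 1 − 1/log 2 ≥ −0.4427`
  have hll : -0.4427 ≤ Real.log (Real.log 2) := by
    have h := Real.one_sub_inv_le_log_of_pos hl0
    have : (Real.log 2)⁻¹ ≤ 1 / 0.6931471803 := by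
      rw [inv_eq_one_div]; exact one_div_le_one_div_of_le (by norm_num) hl2.le
    have : (1 : ℝ) / 0.6931471803 ≤ 1.4427 := by norm_num
    linarith
  have hll0 : Real.log (Real.log 2) < 0 := Real.log_neg hl0 (by linarith)
  -- `√(log 2) ≤ 0.8326`
  have hsq : Real.sqrt (Real.log 2) ≤ 0.8326 := by
    calc Real.sqrt (Real.log 2) ≤ Real.sqrt (0.8326 ^ 2) := Real.sqrt_le_sqrt (by nlinarith)
      _ = 0.8326 := Real.sqrt_sq (by norm_num)
  have hsq0 : 0 ≤ Real.sqrt (Real.log 2) := Real.sqrt_nonneg _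
  have h1 : (2 : ℝ) / 1 - rexp Real.eulerMascheroniConstant * Real.log (Real.log 2) ≤ 2.8854 := by
    nlinarith
  have h0 : 0 ≤ (2 : ℝ) / 1 - rexp Real.eulerMascheroniConstant * Real.log (Real.log 2) := by
    nlinarith
  calc ((2 : ℝ) / 1 - rexp Real.eulerMascheroniConstant * Real.log (Real.log 2)) * Real.sqrt (Real.log 2)
      ≤ 2.8854 * 0.8326 := mul_le_mul h1 hsq hsq0 (by norm_num)
    _ ≤ 2.41 := by norm_num

/-- **Under RH (Schoenfeld road), `c(⌊x⌋#) ≥ 2.65` for `x ≥ 599² = 358801`** (Prop. 3.1 (3.3) made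
explicit at Schoenfeld's threshold: `|ratio − 1| ≤ 0.0125`, `η₂ ≤ 0.3991`, `W ≥ −β`, `e^γ ≥ 1.7437`).
[cite: Nicolas2012, Prop. 3.1 (3.3) and §4 ("for `k > k₀`, (3.3) implies `c(N_k) ≥ 3.30… > c(2)`")] -/
theorem nicolasC_primorial_floor_ge_explicit (hS : Schoenfeld1976_theta) (hRH : RiemannHypothesis) {x : ℝ}
    (hx : 358801 ≤ x) : 2.65 ≤ nicolasC (primorial ⌊x⌋₊) := by
  have hx0 : 0 < x := by linarith
  have h := nicolasC_primorial_floor_ge hS hRH hx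
  have hr := abs_le.1 (abs_ratio_sub_one_le hS hRH hx)
  have hr' := abs_ratio_sub_one_le hS hRH hx
  obtain ⟨he0, he1⟩ := eta2_bounds hx
  have hW := neg_le_nicolasW hRH hx0
  have hβ := nicolasBeta_lt'
  have hβ0 : 0 < nicolasBeta := lt_trans (by norm_num) nicolasBeta_gt
  have hγ : (1.7437 : ℝ) ≤ rexp Real.eulerMascheroniConstant := by
    have hg := Literature.Analysis.SpecialFunctions.Real.eulerMascheroniConstant_gt_d8
    have h1 := Real.quadratic_le_exp_of_nonneg (show (0 : ℝ) ≤ 0.5772 by norm_num)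
    have h2 : rexp 0.5772 ≤ rexp Real.eulerMascheroniConstant := Real.exp_le_exp.2 (by linarith)
    nlinarith
  have hγ0 := Real.exp_pos Real.eulerMascheroniConstant
  rw [lowerErr, abs_of_nonneg he0] at h
  -- `lowerErr ≤ e^γ · 0.4297`
  have hE : |ratio x - 1| * (2 + nicolasBeta + eta2 x) + eta2 x ≤ 0.4297 := by
    nlinarith [abs_nonneg (ratio x - 1)]
  have h1 : rexp Real.eulerMascheroniConstant * (2 + nicolasW x) -
      rexp Real.eulerMascheroniConstant * (|ratio x - 1| * (2 + nicolasBeta + eta2 x) + eta2 x) ≥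
      rexp Real.eulerMascheroniConstant * 1.5229 := by nlinarith
  nlinarith

/-- **Nicolas 2012, Thm. 1.1 (1.7), analytic range (PROVED under RH, explicit threshold)**: under RH,
`c(p#) > c(2)` for every `p ≥ 599² = 358801` (printed: for `k > k₀ = π(10⁹)` by (3.3), the range
`k ≤ k₀` being Nicolas's table). Schoenfeld road (`hS` discharged by `Schoenfeld1976_theta_holds`).
[cite: Nicolas2012, Thm. 1.1 (1.7) and §4] -/
theorem nicolasC_two_lt_nicolasC_primorial_of_RH (hS : Schoenfeld1976_theta) (hRH : RiemannHypothesis)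
    {p : ℕ} (hp : 358801 ≤ p) : nicolasC 2 < nicolasC (primorial p) := by
  have h := nicolasC_primorial_floor_ge_explicit hS hRH (x := p) (by exact_mod_cast hp)
  rw [Nat.floor_natCast] at h
  linarith [nicolasC_two_le]

end NicolasLimsup

/-- **Nicolas 2012, Cor. 1.1 for (1.7) modulo a finite check (kernel-grade, standard axioms)**: over
Schoenfeld's bound `Schoenfeld1976_theta` ((1.12)), if `c(p#) ≥ c(2)` for the `30 519` primes
`p < 599² = 358801` (a finite computation; Nicolas's table covers `k ≤ π(10⁹)`), then
RH `⟺ c(N_k) ≥ c(2)` for every `k ≥ 1`. `⟸` is the tree's `riemannHypothesis_of_nicolasC_primorial_bddBelow`.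
[cite: Nicolas2012, Cor. 1.1 with Thm. 1.1 (1.7); Broughan2017Arithmetic, §5.7] -/
theorem riemannHypothesis_iff_nicolasC_two_le_of_smallRange (hS : Schoenfeld1976_theta)
    (hsmall : ∀ p : ℕ, p.Prime → p < 358801 → nicolasC 2 ≤ nicolasC (primorial p)) :
    RiemannHypothesis ↔ ∀ p : ℕ, p.Prime → nicolasC 2 ≤ nicolasC (primorial p) := by
  refine ⟨fun hRH p hp ↦ ?_, fun h ↦ ?_⟩
  · rcases lt_or_ge p 358801 with hlt | hge
    · exact hsmall p hp hlt
    · exact (NicolasLimsup.nicolasC_two_lt_nicolasC_primorial_of_RH hS hRH hge).le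
  · exact riemannHypothesis_of_nicolasC_primorial_bddBelow (X := 0) fun p hp _ ↦ h p hp

/-! ### §10. Nicolas 1983, Théorème 1 (RH-FREE): infinitely many `n` with `n/φ(n) > e^γ log log n` -/

/-- **Nicolas 1983, Thm. 1 at the primorials (RH-FREE), PROVED with standard axioms**: Nicolas's
inequality `e^γ log log N_k < N_k/φ(N_k)` holds at infinitely many primorials `N_k = p#` — the
affirmative answer to Rosser–Schoenfeld's question (Nicolas 2012, §1, p. 311: "Rosser and Schoenfeld
… asked if there exists an infinite number of `n` such that `n/φ(n) > e^γ log log n`. In [NicJNT],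
I answer this question in the affirmative"). Proof by cases on RH, as in Nicolas 1983 (Thm. 2 (a)/(b)):
under RH, `c(N_k) > 2 > 0` for all large `k` (`NicolasLimsup.eventually_two_lt_nicolasC_primorial`,
the von Koch road of §7–§8; no certified zeros needed); if RH fails, Thm. 2 (b)
(`Nicolas.Nicolas1983_thm2b`: the inequality holds at infinitely many primorials).
[cite: Nicolas1983, Thm. 1 (and Thm. 2); Nicolas2012, §1 (p. 311); Broughan2017Arithmetic, §5.6] -/
theorem Nicolas1983_thm1_primorial (X : ℝ) :
    ∃ p : ℕ, p.Prime ∧ X < p ∧ nicolasInequality (primorial p) := by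
  by_cases hRH : RiemannHypothesis
  · obtain ⟨N, hN⟩ := eventually_atTop.mp (NicolasLimsup.eventually_two_lt_nicolasC_primorial hRH)
    obtain ⟨p, hpge, hp⟩ := Nat.exists_infinite_primes (max N (⌊X⌋₊ + 1))
    refine ⟨p, hp, ?_, ?_⟩
    · have h1 : ⌊X⌋₊ + 1 ≤ p := le_trans (le_max_right _ _) hpge
      calc X < (⌊X⌋₊ : ℝ) + 1 := Nat.lt_floor_add_one X
        _ ≤ p := by exact_mod_cast h1
    · have h2 : 2 < nicolasC (primorial p) := hN p (le_trans (le_max_left _ _) hpge)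
      have hp2 : 2 ≤ primorial p := by
        have h22 : primorial 2 = 2 := by decide
        calc 2 = primorial 2 := h22.symm
          _ ≤ primorial p := primorial_mono hp.two_le
      exact (nicolasC_pos_iff hp2).mp (by linarith)
  · obtain ⟨p, hp, hXp, h⟩ := (Nicolas.Nicolas1983_thm2b hRH).1 X
    exact ⟨p, hp, hXp, (nicolasInequality_iff _).mpr h⟩

/-- **Nicolas 1983, Thm. 1, as printed** (RH-FREE, standard axioms): there are infinitely many `n`
with `n/φ(n) > e^γ log log n` (`nicolasInequality n`). [cite: Nicolas1983, Thm. 1; Nicolas2012, §1 (p. 311); Broughan2017Arithmetic, §5.6] -/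
theorem Nicolas1983_thm1 : {n : ℕ | nicolasInequality n}.Infinite := by
  refine Set.infinite_of_forall_exists_gt fun m => ?_
  obtain ⟨p, hp, hmp, h⟩ := Nicolas1983_thm1_primorial m
  refine ⟨primorial p, h, ?_⟩
  have hdvd : p ∣ primorial p := by
    rw [primorial_eq_prod_primesLE]
    exact Finset.dvd_prod_of_mem _ (Nat.mem_primesLE.mpr ⟨le_rfl, hp⟩)
  have hle : p ≤ primorial p := Nat.le_of_dvd (primorial_pos p) hdvd
  have hmp' : m < p := by exact_mod_cast hmp
  exact lt_of_lt_of_le hmp' hle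

end Literature.NumberTheory.LFunctions

end
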